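import Summits.HodgeConjecture.HodgeConjecture.Cruxes.BlochSeedDiscOne.DiamondLevelLaws

/-!
# FloorPinTower — fourth workfile of the `h`-uniform ABSENT families of ◇_h (`h = 2μ`): THE FLOOR-PINNED NODE-2 TOWER
# `{c·ℓ_φ, 2I + m·ℓ_v, W, hI}` (§1, T2), THE TWO-CEILING-LETTER TOWER `{c·ℓ_φ, 2I + m·ℓ_v, y(w₁,Ka), y(w₂,Kb)}` with its `FL` edge
# (§2, T3), THE SUB-DIAGONAL BLOCK `{c·ℓ_φ, 2I + m·ℓ_v, σ_d(u) ∕ A, y(w,K)}` (§3, T4), THE TWO-FLOOR-LETTER `cu`-TOWER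
# `{c·ℓ_φ, c′·ℓ_u, 2I + m·ℓ_v, cu_w}` (§4, T5), THE SECOND SUB-DIAGONAL `{c·ℓ_φ, 2I + m·ℓ_v, (h−4)·I ∕ τ_d(u), y(w,K)}` (§5, T6) and
# THE TWO-NODE-LETTER `cu`-ROWS `{c·ℓ_φ, 2I + m·ℓ_v, 2I + m′·ℓ_x, cu_w}` (§6, T7) — every charge, all phases, by the pin moves of RULE D
# (control lens, g22 v0.1 – v0.4, g23 v0.5 – v0.6)

STATUS: HC ∕ HC_CM ∕ HC_AV ∕ H2 = `BlochSeedDiscOne` (stmt-18881) ∕ (T_h) ∕ KAbsent_h are NOT proved here or anywhere; HC_CM is a displayed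
binder of the route only.  This file is KERNEL ARITHMETIC on the typed first-order encoder model of `Summits/Ventures/HSemireg/Pad4Tower*.lean`
(hypotheses: `C.InDiamond h`, RULE D on both levels `RuleDMu4N ∕ RuleDMu4P`, X⁺ `XPlusClosed`, A2I⁻ `A2IMinusClosed`, `S₄` on both levels
`PermClosed`; §2 – §6 also `Δ` on E₊ `DeltaClosed`, through F2⁺ only), census-neutral: every family is checked against the gs-eng-2 g54 j318002
peel tables (◇₈ a459e02921a60310 ∕ ◇₁₀ 74004db439790926) to have 0 SURVIVORS at `h ∈ {4, 6, 8, 10}`; the towers legitimately reach peel rounds 2 – 6.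

WHY A FOURTH FILE. `CeilingPair.lean` (g20), `CeilingPair2.lean` (g21) and `CeilingTower.lean` (g22 v0.5) are at the 200 KB cap and none is
importable on the farm (`unbuilt`), so §0 restates (credited, not new) the 75 declarations of `CeilingTower.lean` v0.5 (sha16 f23b80be89093fb2; its §0
credits g18 – g21) that §1 – §6 call: T1 `towerP ∕ N_absent` and its engine, the RULE-D service lemmas `servedBelow_floor_apex ∕ _dir`,
`servedAbove_ceiling_apex`, `subApex_upServer'`, the letter `ceilLetter`, F2⁺ `originUnitFree_P_absent'`, ON_d `originUnitCeilLine_N_absent`.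
Booking: bus RESULT-2 of control g22, director-hodge g31 BOOKED (l.12346), g32 R19.824 «same booking per version» (l.13040); kernel plates by
officer idea-crit-6 g27: v0.2 #72 (93∕93), v0.3 #73 (127∕127), v0.4 #75 = AUDIT 103 (137∕137, l.12983).  Architecture, every census digit and
the coverage history: memo `FLOOR-PIN-TOWER-g22.md` (v0.6) §1 – §3; this docstring keeps the headlines.

§1 (v0.1) T2 `floorPinTowerP_absent ∕ floorPinTowerN_absent` `{c·ℓ_φ, L(m)_v, W, hI} ∉ E_±`, `c ≥ 1`, `1 ≤ m ≤ μ − 2`, EVERY `W`; corollaries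
`floorTowerP ∕ N_absent` (`c ≥ 0`, `(c, W) ≠ (0, O)`), `doubleOriginTowerP_absent`.  ℕ-induction `floorPinTower_aux`; the `P`-step raises `L(m)`
to the top server and fires the X⁺ fork, the `N`-step lowers the pin.  NEW ◇₈ 2 178 ∕ ◇₁₀ 6 123.
§2 (v0.2) T3, from the RULE-D HULL of the typed base (memo DHULL): with `y(w, K) = ceilLetter h w K = (h−2−2K)·I + (1+K)·ℓ_w` (`y(w,0) = cu_w`,
`y(w, μ−1) = FL_w`), `twoCeilTowerP_absent` `P{c·ℓ_φ, L(m)_v, y(w₁,Ka), y(w₂,Kb)} ∉ C.upper` (`0 ≤ Ka ≤ μ−2`, `0 ≤ Kb ≤ 3`, `c = 0 → Kb ≤ 2`),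
`twoCeilTowerN_absent` (`Kb ≤ 2`, `c = 0 → Kb ≤ 1`), the `FL` edge `floorEdgeTowerP ∕ N_absent` (`Kb ≤ 2 ∕ 1`, `c ≥ 1`), the corner leaves
`originApexTwo_N ∕ P_absent` — `c ≥ 0`, `1 ≤ m ≤ μ − 2`.  Inductions `twoCeil_aux`, `floorEdge_aux`.  NEW ◇₈ 4 364 ∕ ◇₁₀ 14 948.
§3 (v0.3) T4, NO induction: with `σ_d(u) = subDiagLetter h u d = (h−2−2d)·I + d·ℓ_u` (`σ_0 = A`, `σ_{−1} = cu_{u+2}`, `σ_{μ−2} = L(μ−2)`),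
`apexRowP ∕ N_absent` `{c·ℓ_φ, L(m)_v, A, y(w,K)}` (every `0 ≤ K ≤ μ − 1`) and `subDiagTowerP ∕ N_absent` `{c·ℓ_φ, L(m)_v, σ_d(u), y(w,K)}` on the
SHARP admissible ranges stated at the theorems — `c ≥ 0`, `1 ≤ m ≤ μ − 2`.  Servers `subDiag_upServer ∕ subDiag_nodeServer`.  NEW ◇₈ 3 652 ∕
◇₁₀ 18 660.
§4 (v0.4) T5 `twoFloorTowerP_absent ∕ twoFloorTowerN_absent` `{c·ℓ_φ, c′·ℓ_u, L(m)_v, cu_w} ∉ E_±`, `c ≥ 0`, `1 ≤ c′ ≤ μ − 1` (primed forms: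
`c′ ≤ μ`), `1 ≤ m ≤ μ − 2`, NO proviso; ℕ-induction `twoFloor_aux` on `c + (μ − c′) + m`.  NEW ◇₈ 496 ∕ ◇₁₀ 2 504.
§5 (v0.5) T6, the second sub-diagonal: with `τ_d(u) = tauLetter h u d = (h−4−2d)·I + d·ℓ_u` (`τ_0 = B = (h−4)·I`), `bApexRowP_absent`
`P{c·ℓ_φ, L(m)_v, B, y(w,K)}` (`K ≤ μ−2 ∨ c ≥ 1`), `bApexRowN_absent` (`[c ≥ 1 ∧ K ≤ μ−2] ∨ [c = 0 ∧ K = 0]`), `tauOneRowP_absent`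
`P{c·ℓ_φ, L(m)_v, τ_1(u), y(w,K)}` (`c ≥ 1`, `K ≤ μ−2`) and the origin `τ`-column `originTauColP ∕ N_absent` `{O, L(m)_v, τ_d(u), cu_w}`
(`0 ≤ d ≤ μ−2`, induction `originTauCol_aux`).  NEW ◇₈ 1 272 ∕ ◇₁₀ 5 518.
§6 (v0.6, g23) T7, ONE pin move each, NO induction: `twoNodeTowerN_absent ∕ twoNodeTowerP_absent` `{c·ℓ_φ, L(m)_v, L(m′)_x, cu_w} ∉ E_±` for
`c ≥ 0`, `1 ≤ m, m′ ≤ μ − 2`, ALL phases (level `N`: the floor pin lowers `L(m′)_x` through its node frame onto `(m′+1)·ℓ_x` — T5; level `P`: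
the ceiling pin raises it along its top line to `L(m′+e)_x` — the `N`-row, or `L(μ−1)_x = y(x, μ−2)` and T3-N), and `tauPenultRowN_absent`
`N{c·ℓ_φ, L(m)_v, τ_{μ−4}(u), cu_w} ∉ C.lower` (`μ ≥ 5`; children `τ_{μ−3} = L(μ−3)_u` and `τ_{μ−2} = (μ−2)·ℓ_u`).  Found as the one CLEAN
support-closed package of the post-T6 hull (`tools/dclos2.py`; the `K = μ−2` `σ`-block closure sprawls over ≈ 80 classes and is NOT typed).
Census `tools/famAB.py 4 6 8 10`: members ◇₆ 260 ∕ ◇₈ 1 224 ∕ ◇₁₀ 4 284, 0 SURVIVORS; NEW ◇₆ 0 ∕ ◇₈ 170 ∕ ◇₁₀ 2 702 (r2 640, r3 1 577, r4 389,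
r5 92, r6 4).
COVERAGE (`tools/cover.py 6 8 10`, cumulative over the four files; v0.5 → v0.6): round-2 orbits typed ◇₁₀ 86.6 % → 89.3 % (21 297 ∕ 23 861),
◇₈ 87.1 % → 87.5 % (11 146 ∕ 12 744), ◇₆ 71.7 %; peel round ≥ 3 typed ◇₁₀ 44 356 → 46 418, ◇₈ 11 979 → 12 109; ALL absent orbits typed ◇₁₀
15.8 % → 16.4 % (70 990 ∕ 432 711), ◇₈ 25.9 % → 26.1 % (25 456 ∕ 97 541), ◇₆ 35.8 % (◇₁₀ history: v0.1 6.2 → v0.2 9.6 → v0.3 13.9 → v0.4 14.5 → v0.5 15.8 %).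
NEXT (memo §4): the post-T7 RULE-D hull is fragmented (`{F, F′, σ_d, y(K)}` sprawl, circular `τ` rows, `{F, L, L′, y(K ≥ 1)}`); the deep
complement (◇₁₀ ≈ 335 000 orbits of rounds ≥ 3) needs the X⁺ ∕ A2I⁻ clauses as MOVES — an X⁺-fork server over a general pin (g24 START-HERE).
-/

set_option linter.dupNamespace false
set_option linter.unusedSimpArgs false

namespace Summit.HodgeConjecture.HodgeConjecture.Cruxes.BlochSeedDiscOne.FloorPinTower

open Finset Summit.Ventures.HSemireg.Pad4Tower
open Summit.HodgeConjecture.HodgeConjecture.Cruxes.BlochSeedDiscOne.DiamondLevelLaws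

/-! ## §0 Restated — not new: from `CeilingTower.lean` v0.5 f23b80be89093fb2 (control g18 – g22, credited there; statements and proofs verbatim, eight docstrings abridged in v0.6), which the farm cannot import yet (`unbuilt`) -/

/-- [g18 `CeilingFork.xplus_unit_fork`] the X⁺ fork at a ceiling apex with two UNIT children needs no side condition. -/
theorem xplus_unit_fork {h : ℤ} {C : MConfig} (hU : C.InDiamond h) (hX : XPlusClosed C) {Z : MCell} (hZ : Z ∈ C.lower)
    {g f : Fin 4} (hfg : f ≠ g) (hg : Z g = (h, 0, 0)) (hf : Z f = (h, 0, 0)) {P₁ P₂ : MCell}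
    (hP₁ : P₁ ∈ C.upper) (hP₂ : P₂ ∈ C.upper) {r₁ r₂ : Fin 4} (hr : r₂ ≠ r₁) (h1 : UPartner Z P₁ g r₁) (h2 : UPartner Z P₂ g r₂)
    (hd₁ : (P₁ g).1 = h - 1) (hd₂ : (P₂ g).1 = h - 1) : False := by
  have hZg1 : (Z g).1 = h := by rw [hg]
  have h1ray : ((h, 0, 0) : BPoint) = ray (P₁ g) r₁ (h - (P₁ g).1) := by have := h1.2.2; rw [hg] at this; exact this
  refine hX (dualCell 0 P₁) (dualCell_mem_dual_lower hP₁) (dualCell 0 Z) (dualCell_mem_dual_upper hZ) (dualCell 0 P₂)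
    (dualCell_mem_dual_lower hP₂) g r₁ r₂ f ⟨?_, hfg, (uPartner_dual 0 Z P₁ g r₁).mpr h1, ?_, hr, ?_, ?_, ?_, ?_, ?_⟩
  · exact fun hap => not_isApex_below_apex (by omega) h1ray ((isApex_dual 0 (P₁ g)).mp hap)
  · intro P hP hPu
    obtain ⟨X, hXl, rfl⟩ := Finset.mem_image.mp hP
    have hu : UPartner X P₁ g r₁ := (uPartner_dual 0 X P₁ g r₁).mp hPu
    show 0 - (X g).1 ≤ 0 - (Z g).1
    have hlt : (P₁ g).1 < (X g).1 := hu.2.1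
    have hle : (X g).1 ≤ h := fst_le_of_inDiamond (hU.1 X hXl g)
    omega
  · exact ⟨magree_dual.mpr (fun j hj => (h2.1 j hj).symm), (ray_dual_iff 0 (Z g) (P₂ g) r₂).mpr ⟨h2.2.1, h2.2.2⟩⟩
  · intro P hP _ hlt1 hlt2 _
    obtain ⟨X, hXl, rfl⟩ := Finset.mem_image.mp hP
    exfalso
    change 0 - (Z g).1 < 0 - (X g).1 at hlt1
    change 0 - (X g).1 < 0 - (P₂ g).1 at hlt2
    have hle : (X g).1 ≤ h := fst_le_of_inDiamond (hU.1 X hXl g)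
    omega
  · intro P hP _ _ _ _
    obtain ⟨X, hXl, rfl⟩ := Finset.mem_image.mp hP
    show Effective (bsub (dualPt 0 (X g)) (dualPt 0 (Z g)))
    rw [bsub_dualPt0, hg]
    exact effective_ceilingApex_sub (hU.1 X hXl g)
  · intro P hP _ hnb _
    obtain ⟨X, hXl, rfl⟩ := Finset.mem_image.mp hP
    exfalso
    have e1 : (P₁ f).1 = h := by rw [(h1.1 f hfg).trans hf]
    have := hnb.1
    change 0 - (X f).1 < 0 - (P₁ f).1 at this
    have hle := fst_le_of_inDiamond (hU.1 X hXl f)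
    omega
  · intro P hP hnb
    obtain ⟨X, hXl, rfl⟩ := Finset.mem_image.mp hP
    exfalso
    have e1 : (P₁ f).1 = h := by rw [(h1.1 f hfg).trans hf]
    have := hnb.1
    change 0 - (X f).1 < 0 - (P₁ f).1 at this
    have hle := fst_le_of_inDiamond (hU.1 X hXl f)
    omega

/-- [g18] the unit floor letter `ℓ_φ = O + n_φ`. -/
abbrev floorUnit (φ : Fin 4) : BPoint := ray ((0, 0, 0) : BPoint) φ 1

/-- [g18] the unit ceiling letter `(h−2)I + ℓ_χ`. -/
abbrev ceilingUnit (h : ℤ) (χ : Fin 4) : BPoint := ray ((h - 2, 0, 0) : BPoint) χ 1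

/-- [g18] the floor letter `c·ℓ_φ` (node `0`, top `2c`). -/
abbrev floorLetter (φ : Fin 4) (c : ℤ) : BPoint := ray ((0, 0, 0) : BPoint) φ c

/-- [g18] the letter `2I + n·ℓ_u` (node `2`, top `2 + 2n`). -/
abbrev nodeTwoLetter (u : Fin 4) (n : ℤ) : BPoint := ray ((2, 0, 0) : BPoint) u n

theorem floorUnit_not_isApex (φ : Fin 4) : ¬ isApex (floorUnit φ) := by
  fin_cases φ <;> simp [ray, isApex]

theorem floorUnit_fst (φ : Fin 4) : (floorUnit φ).1 = 1 := by
  fin_cases φ <;> simp [ray]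

theorem floorUnit_top (φ : Fin 4) : Adapted (floorUnit φ) φ ∧ coord (floorUnit φ) φ = 2 := by
  fin_cases φ <;> simp [ray, coord, Adapted]

theorem ceilingUnit_not_isApex (h : ℤ) (χ : Fin 4) : ¬ isApex (ceilingUnit h χ) := by
  fin_cases χ <;> simp [ray, isApex]

theorem ceilingUnit_fst (h : ℤ) (χ : Fin 4) : (ceilingUnit h χ).1 = h - 1 := by
  fin_cases χ <;> simp [ray] <;> omega

theorem ceilingUnit_node (h : ℤ) (χ : Fin 4) : Adapted (ceilingUnit h χ) (χ + 2) ∧ coord (ceilingUnit h χ) (χ + 2) = h - 2 := by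
  fin_cases χ <;> simp [ray, coord, Adapted]

theorem ceilingApex_eq_ray_ceilingUnit (h : ℤ) (χ : Fin 4) : ((h, 0, 0) : BPoint) = ray (ceilingUnit h χ) (χ + 2) 1 := by
  fin_cases χ <;> simp [ray] <;> omega

/-- [g18] below a unit floor letter there is only `O`, along the letter's own ray. -/
theorem below_floorUnit {h : ℤ} {y : BPoint} (hy : InDiamond h y) {φ r : Fin 4} {d : ℤ} (hd : 0 < d)
    (he : floorUnit φ = ray y r d) : r = φ ∧ y = (0, 0, 0) := by
  obtain ⟨α, a, b⟩ := y
  obtain ⟨hax, h1, -, -⟩ := hy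
  simp only [AxisPt, absCharge, chargeOf, ray, Prod.mk.injEq] at hax h1 he
  fin_cases φ <;> fin_cases r <;> simp at he hax ⊢ <;>
    (simp only [abs_eq_max_neg, max_def] at h1; split_ifs at h1 <;> omega)

/-- [g18] above a unit ceiling letter there is only `hI`, along the node direction. -/
theorem above_ceilingUnit {h : ℤ} {y : BPoint} (hy : InDiamond h y) {χ r : Fin 4} {e : ℤ} (he0 : 0 < e)
    (he : y = ray (ceilingUnit h χ) r e) : r = χ + 2 ∧ y = (h, 0, 0) := by
  subst he
  obtain ⟨hax, h1, -, h3⟩ := hy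
  simp only [AxisPt, absCharge, chargeOf, ray, Prod.mk.injEq] at hax h1 h3 ⊢
  fin_cases χ <;> fin_cases r <;> simp at hax h1 h3 ⊢ <;>
    (simp only [abs_eq_max_neg, max_def] at h1 h3; split_ifs at h1 h3 <;> omega)

theorem deltaPt_ceilingUnit (h : ℤ) (χ : Fin 4) : deltaPt (ceilingUnit h χ) = ceilingUnit h (χ + 3) := by
  fin_cases χ <;> simp [ray, deltaPt]

theorem deltaPt_apex (a : ℤ) : deltaPt ((a, 0, 0) : BPoint) = (a, 0, 0) := by
  simp [deltaPt]

theorem floorUnit_inj {φ ψ : Fin 4} (e : floorUnit φ = floorUnit ψ) : φ = ψ :=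
  ray_apex_dir_inj one_ne_zero e

theorem fin4_add3_ne (χ : Fin 4) : χ + 3 ≠ χ := by fin_cases χ <;> decide

theorem fin4_add33_ne (χ : Fin 4) : χ + 3 + 3 ≠ χ := by fin_cases χ <;> decide

theorem fin4_add333_ne (χ : Fin 4) : χ + 3 + 3 + 3 ≠ χ := by fin_cases χ <;> decide

theorem floorLetter_not_isApex (φ : Fin 4) {c : ℤ} (hc : c ≠ 0) : ¬ isApex (floorLetter φ c) := by
  fin_cases φ <;> simp [ray, isApex, hc]

theorem nodeTwoLetter_not_isApex (u : Fin 4) {n : ℤ} (hn : n ≠ 0) : ¬ isApex (nodeTwoLetter u n) := by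
  fin_cases u <;> simp [ray, isApex, hn]

theorem floorLetter_node (φ : Fin 4) (c : ℤ) : Adapted (floorLetter φ c) (φ + 2) ∧ coord (floorLetter φ c) (φ + 2) = 0 :=
  ⟨(adapted_ray_apex 0 φ c).2, coord_ray_apex_antip 0 φ c⟩

theorem nodeTwoLetter_node (u : Fin 4) (n : ℤ) : Adapted (nodeTwoLetter u n) (u + 2) ∧ coord (nodeTwoLetter u n) (u + 2) = 2 :=
  ⟨(adapted_ray_apex 2 u n).2, coord_ray_apex_antip 2 u n⟩

/-- [g18] below a floor-node letter `c·ℓ_φ` (`c ≥ 0`) only its own ray. -/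
theorem below_floorLetter {h c d : ℤ} {z : BPoint} (hz : InDiamond h z) {φ r : Fin 4} (hc : 0 ≤ c) (hd : 0 < d)
    (he : floorLetter φ c = ray z r d) : r = φ := by
  obtain ⟨α, a, b⟩ := z
  obtain ⟨hax, h1, -, -⟩ := hz
  simp only [AxisPt, absCharge, chargeOf, ray, Prod.mk.injEq] at hax h1 he
  fin_cases φ <;> fin_cases r <;> simp at hax h1 he ⊢ <;>
    (simp only [abs_eq_max_neg, max_def] at h1; split_ifs at h1 <;> omega)

/-- [g18 `lift_of_ceilingUnit`] a unit ceiling letter next to a ceiling letter forces the lift `P(d ↦ hI)`, as a `(χ+2)`-partner. -/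
theorem lift_of_ceilingUnit {h : ℤ} {C : MConfig} (hU : C.InDiamond h) {P : MCell} (hP : P ∈ C.upper) (hD : RuleDMu4P C P)
    {a d : Fin 4} (had : a ≠ d) (hac : OnCeiling h (P a)) {χ : Fin 4} (hd : P d = ceilingUnit h χ) :
    ∃ N ∈ C.lower, UPartner N P d (χ + 2) ∧ N d = (h, 0, 0) := by
  have hna : ¬ isApex (P d) := by rw [hd]; exact ceilingUnit_not_isApex h χ
  have hk : Adapted (P d) (χ + 2) := by rw [hd]; exact (ceilingUnit_node h χ).1
  have hkh : coord (P d) (χ + 2) ≠ h := by rw [hd, (ceilingUnit_node h χ).2]; omega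
  obtain ⟨N, hN, hNP⟩ := upLine_of_ruleDMu4P hU hP hD had hac hna hk hkh
  have he0 : 0 < (N d).1 - (P d).1 := by have := hNP.2.1; omega
  have e : N d = ray (ceilingUnit h χ) (χ + 2) ((N d).1 - (P d).1) := by rw [← hd]; exact hNP.2.2
  exact ⟨N, hN, hNP, (above_ceilingUnit (hU.1 N hN d) he0 e).2⟩

/-- [g19 `CeilingUnitApex.apexCeilingUnit_absent_of_secondChild`] THE SECOND-CHILD THEOREM. -/
theorem apexCeilingUnit_absent_of_secondChild {h : ℤ} {C : MConfig} (hU : C.InDiamond h) (hDP : ∀ P ∈ C.upper, RuleDMu4P C P)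
    (hX : XPlusClosed C) {Z Z' : MCell} {d f : Fin 4} (hfd : f ≠ d) {χ χ' : Fin 4} (hχ : χ' ≠ χ)
    (hd : Z d = ceilingUnit h χ) (hf : Z f = (h, 0, 0)) (hZ' : Z ∈ C.upper → Z' ∈ C.upper) (hagree : ∀ j, j ≠ d → Z' j = Z j)
    (hd' : Z' d = ceilingUnit h χ') : Z ∉ C.upper := fun hZ => by
  obtain ⟨X, hXl, hXZ, hXd⟩ := lift_of_ceilingUnit hU hZ (hDP Z hZ) hfd (by rw [hf]; exact onCeiling_apex h) hd
  have hXf : X f = (h, 0, 0) := (hXZ.1 f hfd).symm.trans hf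
  have u2 : UPartner X Z' d (χ' + 2) := by
    refine ⟨fun j hj => ?_, ?_, ?_⟩
    · rw [hagree j hj]; exact hXZ.1 j hj
    · rw [hd', ceilingUnit_fst, hXd]; omega
    · rw [hd', hXd, ceilingUnit_fst, show h - (h - 1) = 1 by ring]
      exact ceilingApex_eq_ray_ceilingUnit h χ'
  have hr : χ' + 2 ≠ χ + 2 := fun e => hχ (add_right_cancel e)
  have hd₁ : (Z d).1 = h - 1 := by rw [hd, ceilingUnit_fst]
  have hd₂ : (Z' d).1 = h - 1 := by rw [hd', ceilingUnit_fst]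
  exact xplus_unit_fork hU hX hXl hfd hXd hXf hZ (hZ' hZ) hr hXZ u2 hd₁ hd₂

/-- [g19 CUA sub-family A] `P{pure, pure, cu_χ, hI}`-type cells (`Δ`-fixed off `d`) are absent. -/
theorem apexCeilingUnitFamily_absent {h : ℤ} {C : MConfig} (hU : C.InDiamond h) (hDP : ∀ P ∈ C.upper, RuleDMu4P C P)
    (hX : XPlusClosed C) (hΔu : DeltaClosed C.upper) {Z : MCell} {d f : Fin 4} (hfd : f ≠ d) {χ : Fin 4}
    (hd : Z d = ceilingUnit h χ) (hf : Z f = (h, 0, 0)) (hpure : ∀ j, j ≠ d → deltaPt (Z j) = Z j) : Z ∉ C.upper :=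
  have d1 : ∀ j, Z.delta j = deltaPt (Z j) := fun _ => rfl
  apexCeilingUnit_absent_of_secondChild hU hDP hX hfd (fin4_add3_ne χ) hd hf (hΔu Z) (fun j hj => by rw [d1, hpure j hj])
    (by rw [d1, hd, deltaPt_ceilingUnit])

/-- the unit ceiling letter lies on the ceiling: causal top `h`. -/
theorem onCeiling_ceilingUnit (h : ℤ) (χ : Fin 4) : OnCeiling h (ceilingUnit h χ) := by
  show (ray ((h - 2, 0, 0) : BPoint) χ 1).1 + absCharge (ray ((h - 2, 0, 0) : BPoint) χ 1) = h
  rw [top_ray_apex (h - 2) χ (by decide)]; ring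

/-- **DESCENT NEXT TO A FLOOR NODE** (KERNEL, every `h`; RULE D at the `N`-cell): an `N`-cell `Z` with a floor-node letter `Z b = c₀·ℓ_φ` (`c₀ ≥ 0`; `c₀ = 0` is … (memo §1) -/
theorem descent_of_floorNode_floorUnit {h c₀ : ℤ} {C : MConfig} (hU : C.InDiamond h) {Z : MCell} (hD : RuleDMu4N C Z)
    {b c : Fin 4} (hbc : b ≠ c) {φ ψ : Fin 4} (hc₀ : 0 ≤ c₀) (hb : Z b = floorLetter φ c₀) (hc : Z c = floorUnit ψ) :
    ∃ P ∈ C.upper, MAgree P Z c ∧ P c = (0, 0, 0) := by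
  have hk : Adapted (Z b) (φ + 2) := by rw [hb]; exact (floorLetter_node φ c₀).1
  have hk0 : coord (Z b) (φ + 2) = 0 := by rw [hb]; exact (floorLetter_node φ c₀).2
  have hk' : Adapted (Z c) ψ := by rw [hc]; exact (floorUnit_top ψ).1
  have hk'2 : coord (Z c) ψ = 2 := by rw [hc]; exact (floorUnit_top ψ).2
  have hne : coord (Z b) (φ + 2) ≠ coord (Z c) ψ := by rw [hk0, hk'2]; decide
  -- below the floor-node letter only its own ray
  have nob : ∀ P ∈ C.upper, ∀ r : Fin 4, (P b).1 < (Z b).1 → Z b = ray (P b) r ((Z b).1 - (P b).1) → r = φ :=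
    fun P hP r hlt hray => by
      have e : floorLetter φ c₀ = ray (P b) r ((Z b).1 - (P b).1) := by rw [← hb]; exact hray
      exact below_floorLetter (hU.2 P hP b) hc₀ (by omega) e
  rcases hD b c hbc (φ + 2) ψ hk hk' hne with ⟨r, hr, P, hP, hZP⟩ | ⟨r, hr, P, hP, hZP⟩ | ⟨a, a', ha, -, P, hP, -, hb1, hb2, -, -⟩
  · -- `(b, φ+2)` settled below in a direction `r ≠ φ` — impossible
    exact absurd ((nob P hP r hZP.2.1 hZP.2.2).trans (fin4_add_two_add_two φ).symm) hr
  · -- `(c, ψ)` settled below: the server is `Z(c ↦ O)`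
    have hd : 0 < (Z c).1 - (P c).1 := by have := hZP.2.1; omega
    have e : floorUnit ψ = ray (P c) r ((Z c).1 - (P c).1) := by rw [← hc]; exact hZP.2.2
    exact ⟨P, hP, hZP.1, (below_floorUnit (hU.2 P hP c) hd e).2⟩
  · -- covered below: the cover moves the floor-node letter down in a direction `a` with `DirOK (Z b) (φ+2) a`, i.e. `a ≠ φ` — impossible
    have hφ := nob P hP a hb1 hb2
    rcases ha with e | ⟨-, hne2⟩
    · exact absurd (e.symm.trans hφ) (fin4_ne_add_two φ).symm
    · exact (hne2 (hφ.trans (fin4_add_two_add_two φ).symm)).elim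

/-- **BELOW `2I + n·ℓ_u` OFF ITS OWN RAY THERE IS ONLY `(n+1)·ℓ_u`, ONE STEP DOWN THE NODE DIRECTION** (every `h`, `n ≥ 1`): a point `z` of ◇_h with `2I + n ℓ_u = …` (memo §1) -/
theorem below_nodeTwo_offRay {h n d : ℤ} {z : BPoint} {u r : Fin 4} (hn : 1 ≤ n) (hz : InDiamond h z) (hd : 0 < d) (hr : r ≠ u)
    (he : nodeTwoLetter u n = ray z r d) : r = u + 2 ∧ d = 1 ∧ z = floorLetter u (n + 1) := by
  obtain ⟨α, a, b⟩ := z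
  obtain ⟨hax, h1, -, -⟩ := hz
  simp only [AxisPt, absCharge, chargeOf, ray, Prod.mk.injEq] at hax h1 he ⊢
  fin_cases u <;> fin_cases r <;> simp at hax h1 he hr ⊢ <;>
    (simp only [abs_eq_max_neg, max_def] at h1; split_ifs at h1 <;> omega)

/-- **DESCENT OF `2I + n·ℓ_u` NEXT TO A FLOOR NODE** (KERNEL, every `h`; RULE D at the `N`-cell): an `N`-cell `N` with a floor-node letter `N b = c₀·ℓ_φ` (`c₀ ≥ …` (memo §1) -/
theorem descent_of_floorNode_nodeTwo {h c₀ n : ℤ} {C : MConfig} (hU : C.InDiamond h) (hc₀ : 0 ≤ c₀) (hn : 1 ≤ n) {N : MCell}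
    (hD : RuleDMu4N C N) {b c : Fin 4} (hbc : b ≠ c) {φ u : Fin 4} (hb : N b = floorLetter φ c₀) (hc : N c = nodeTwoLetter u n) :
    ∃ P' ∈ C.upper, UPartner N P' c (u + 2) ∧ P' c = floorLetter u (n + 1) := by
  have hk : Adapted (N b) (φ + 2) := by rw [hb]; exact (floorLetter_node φ c₀).1
  have hk0 : coord (N b) (φ + 2) = 0 := by rw [hb]; exact (floorLetter_node φ c₀).2
  have hk' : Adapted (N c) (u + 2) := by rw [hc]; exact (nodeTwoLetter_node u n).1
  have hk'2 : coord (N c) (u + 2) = 2 := by rw [hc]; exact (nodeTwoLetter_node u n).2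
  have hne : coord (N b) (φ + 2) ≠ coord (N c) (u + 2) := by rw [hk0, hk'2]; decide
  have nob : ∀ P ∈ C.upper, ∀ r : Fin 4, (P b).1 < (N b).1 → N b = ray (P b) r ((N b).1 - (P b).1) → r = φ :=
    fun P hP r hlt hray => by
      have e : floorLetter φ c₀ = ray (P b) r ((N b).1 - (P b).1) := by rw [← hb]; exact hray
      exact below_floorLetter (hU.2 P hP b) hc₀ (by omega) e
  rcases hD b c hbc (φ + 2) (u + 2) hk hk' hne with ⟨r, hr, P, hP, hZP⟩ | ⟨r, hr, P, hP, hZP⟩ | ⟨a, a', ha, -, P, hP, -, hb1, hb2, -, -⟩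
  · exact absurd ((nob P hP r hZP.2.1 hZP.2.2).trans (fin4_add_two_add_two φ).symm) hr
  · have hd : 0 < (N c).1 - (P c).1 := by have := hZP.2.1; omega
    have e : nodeTwoLetter u n = ray (P c) r ((N c).1 - (P c).1) := by rw [← hc]; exact hZP.2.2
    have hr' : r ≠ u := fun e' => hr (by rw [e', fin4_add_two_add_two])
    obtain ⟨hr2, -, hz⟩ := below_nodeTwo_offRay hn (hU.2 P hP c) hd hr' e
    subst hr2
    exact ⟨P, hP, hZP, hz⟩
  · have hφ := nob P hP a hb1 hb2
    rcases ha with e | ⟨-, hne2⟩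
    · exact absurd (e.symm.trans hφ) (fin4_ne_add_two φ).symm
    · exact (hne2 (hφ.trans (fin4_add_two_add_two φ).symm)).elim

/-- **B1** `N{O, ℓ_φ, cu_χ, hI}` (slots 0,1,2,3) **IS ABSENT** (KERNEL, every `h`; ◇_h, RULE D, X⁺, `Δ` on the `P`-level): the descent `N(1 ↦ O) = P{O, O, cu_χ, …` (memo §1) -/
theorem loneUnit_apex_absent {h : ℤ} {C : MConfig} (hU : C.InDiamond h) (hDN : ∀ Z ∈ C.lower, RuleDMu4N C Z)
    (hDP : ∀ P ∈ C.upper, RuleDMu4P C P) (hX : XPlusClosed C) (hΔu : DeltaClosed C.upper) {N : MCell} {φ χ : Fin 4}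
    (h0 : N 0 = (0, 0, 0)) (h1 : N 1 = floorUnit φ) (h2 : N 2 = ceilingUnit h χ) (h3 : N 3 = (h, 0, 0)) : N ∉ C.lower := fun hN => by
  have h0' : N 0 = floorLetter φ 0 := h0.trans (ray_zero _ φ).symm
  obtain ⟨P₁, hP₁, hagree, hP₁1⟩ := descent_of_floorNode_floorUnit hU (hDN N hN) (b := 0) (c := 1) (by decide) le_rfl h0' h1
  have hP₁0 : P₁ 0 = (0, 0, 0) := (hagree 0 (by decide)).trans h0
  have hP₁2 : P₁ 2 = ceilingUnit h χ := (hagree 2 (by decide)).trans h2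
  have hP₁3 : P₁ 3 = (h, 0, 0) := (hagree 3 (by decide)).trans h3
  exact apexCeilingUnitFamily_absent hU hDP hX hΔu (d := 2) (f := 3) (by decide) hP₁2 hP₁3 (fun j hj => by
    fin_cases j
    · show deltaPt (P₁ 0) = P₁ 0; rw [hP₁0, deltaPt_apex]
    · show deltaPt (P₁ 1) = P₁ 1; rw [hP₁1, deltaPt_apex]
    · exact absurd rfl hj
    · show deltaPt (P₁ 3) = P₁ 3; rw [hP₁3, deltaPt_apex]) hP₁

/-- **B2** `P{O, ℓ_φ, cu_χ, cu_χ'}` (slots 0,1,2,3; ALL `χ, χ'`, equal included) **IS ABSENT** (KERNEL, every `h`; ◇_h, RULE D, X⁺, `Δ` on the `P`-level): the lift … (memo §1) -/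
theorem loneUnit_pair_absent {h : ℤ} {C : MConfig} (hU : C.InDiamond h) (hDN : ∀ Z ∈ C.lower, RuleDMu4N C Z)
    (hDP : ∀ P ∈ C.upper, RuleDMu4P C P) (hX : XPlusClosed C) (hΔu : DeltaClosed C.upper) {P : MCell} {φ χ χ' : Fin 4}
    (h0 : P 0 = (0, 0, 0)) (h1 : P 1 = floorUnit φ) (h2 : P 2 = ceilingUnit h χ) (h3 : P 3 = ceilingUnit h χ') : P ∉ C.upper :=
  fun hP => by
  obtain ⟨N, hN, hNP, hN3⟩ := lift_of_ceilingUnit hU hP (hDP P hP) (a := 2) (d := 3) (by decide)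
    (by rw [h2]; exact onCeiling_ceilingUnit h χ) h3
  exact loneUnit_apex_absent hU hDN hDP hX hΔu ((hNP.1 0 (by decide)).symm.trans h0) ((hNP.1 1 (by decide)).symm.trans h1)
    ((hNP.1 2 (by decide)).symm.trans h2) hN3 hN

theorem nodeTwoLetter_top (u : Fin 4) (n : ℤ) : Adapted (nodeTwoLetter u n) u ∧ coord (nodeTwoLetter u n) u = 2 + 2 * n := by
  refine ⟨(adapted_ray_apex 2 u n).1, ?_⟩
  rw [coord_ray_self, coord_of_isApex ⟨rfl, rfl⟩]

/-- the CEILING-LINE letter `y_d = (h − 2 − 2d)·I + (1 + d)·ℓ_χ` (`d = 0`: `cu_χ`; top coordinate `h`). -/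
abbrev ceilLetter (h : ℤ) (χ : Fin 4) (d : ℤ) : BPoint := ray ((h - 2 - 2 * d, 0, 0) : BPoint) χ (1 + d)

theorem ceilLetter_node (h : ℤ) (χ : Fin 4) (d : ℤ) :
    Adapted (ceilLetter h χ d) (χ + 2) ∧ coord (ceilLetter h χ d) (χ + 2) = h - 2 - 2 * d :=
  ⟨(adapted_ray_apex _ χ _).2, coord_ray_apex_antip _ χ _⟩

/-- one diamond step above the sub-ceiling apex `(h−2)·I`. -/
theorem above_subApex {h e : ℤ} {z : BPoint} {r : Fin 4} (he : 0 < e) (hz : InDiamond h z)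
    (hze : z = ray ((h - 2, 0, 0) : BPoint) r e) : e = 1 := by
  have htop := hz.2.2.2
  rw [hze, top_ray_apex (h - 2) r (by omega)] at htop
  omega

theorem ceilLetter_zero (h : ℤ) (χ : Fin 4) : ceilLetter h χ 0 = ceilingUnit h χ := by
  show ray ((h - 2 - 2 * 0, 0, 0) : BPoint) χ (1 + 0) = ray ((h - 2, 0, 0) : BPoint) χ 1
  rw [mul_zero, sub_zero, add_zero]

theorem ceilLetter_not_isApex {h d : ℤ} (v : Fin 4) (hd : 1 + d ≠ 0) : ¬ isApex (ceilLetter h v d) := by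
  fin_cases v <;> simp [ray, isApex, hd] <;> omega

theorem ceilLetter_neg_one (h : ℤ) (v : Fin 4) : ceilLetter h v (-1) = (h, 0, 0) := by
  fin_cases v <;> simp [ray]

/-- ABOVE a ceiling-line letter `y_d` (`d ≥ 0`) in ◇_h: only the off-ray step up the node direction, `y_d + e·ℓ_{v+2} = y_{d−e}`, `e ≤ d + 1`. -/
theorem above_ceilLetter_offRay {h d e : ℤ} {z : BPoint} {v r : Fin 4} (hd : 0 ≤ d) (hz : InDiamond h z) (he : 0 < e)
    (heq : z = ray (ceilLetter h v d) r e) : r = v + 2 ∧ e ≤ d + 1 ∧ z = ceilLetter h v (d - e) := by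
  subst heq
  obtain ⟨hax, h1, -, h3⟩ := hz
  simp only [AxisPt, absCharge, chargeOf, ray, Prod.mk.injEq] at hax h1 h3 ⊢
  fin_cases v <;> fin_cases r <;> simp at hax h1 h3 ⊢ <;>
    (simp only [abs_eq_max_neg, max_def] at h1 h3; split_ifs at h1 h3 <;> omega)

theorem fst_nonneg_of_inDiamond {h : ℤ} {z : BPoint} (hz : InDiamond h z) : 0 ≤ z.1 := by
  have h1 : absCharge z ≤ z.1 := hz.2.1
  have h2 : 0 ≤ absCharge z := abs_nonneg _
  omega

/-- a letter of ◇_h is never spacelike-separated from the origin. -/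
theorem not_spacelike_of_inDiamond {h : ℤ} {z : BPoint} (hz : InDiamond h z) : ¬ Spacelike (bsub z (0, 0, 0)) := by
  obtain ⟨α, a, b⟩ := z
  obtain ⟨hax, h1, -, -⟩ := hz
  simp only [AxisPt, absCharge, chargeOf, Prod.mk.injEq] at hax h1
  have key : a ^ 2 + b ^ 2 ≤ α ^ 2 := by
    rcases hax with ⟨rfl, rfl⟩ | ⟨-, rfl⟩ | ⟨rfl, -⟩
    · simp only [sub_self, abs_zero] at h1; nlinarith
    · simp only [sub_zero] at h1
      obtain ⟨l, r⟩ := abs_le.mp h1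
      nlinarith [mul_nonneg (sub_nonneg.mpr r) (show (0:ℤ) ≤ α + a by linarith)]
    · simp only [zero_sub, abs_neg] at h1
      obtain ⟨l, r⟩ := abs_le.mp h1
      nlinarith [mul_nonneg (sub_nonneg.mpr r) (show (0:ℤ) ≤ α + b by linarith)]
  simp only [Spacelike, bsub, sub_zero, not_lt]
  exact key

/-- **THE A2I⁻ INTERFACE AT THE ORIGIN** (KERNEL, every `h`) [◇_h, A2I⁻, `S₄` on E₋]. -/
theorem a2i_origin_interface {h : ℤ} {C : MConfig} (hU : C.InDiamond h) (hA : A2IMinusClosed C) (hGl : PermClosed C.lower)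
    {Z : MCell} (hZ : Z ∈ C.lower) {a b : Fin 4} (hab : a ≠ b) {φ : Fin 4} (ha : Z a = (0, 0, 0)) (hb : Z b = floorUnit φ)
    {q : MCell} (hq : q ∈ C.upper) (hqZ : MAgree q Z b) (hqb : q b = (0, 0, 0)) :
    ∃ P ∈ C.upper, MAgree2 P Z a b ∧ P a = floorUnit φ ∧ P b = (0, 0, 0) := by
  by_contra hno
  have hN' : Z.perm (Equiv.swap a b) ∈ C.lower := hGl (Equiv.swap a b) Z hZ
  have eNa : Z.perm (Equiv.swap a b) a = floorUnit φ := by show Z (Equiv.swap a b a) = _; rw [Equiv.swap_apply_left, hb]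
  have eNb : Z.perm (Equiv.swap a b) b = (0, 0, 0) := by show Z (Equiv.swap a b b) = _; rw [Equiv.swap_apply_right, ha]
  have hqa : q a = (0, 0, 0) := (hqZ a hab).trans ha
  have hZb1 : (Z b).1 = 1 := by rw [hb, floorUnit_fst]
  have hqb1 : (q b).1 = 0 := by rw [hqb]
  have hZa1 : (Z a).1 = 0 := by rw [ha]
  have hqa1 : (q a).1 = 0 := by rw [hqa]
  have nob : ∀ P ∈ C.upper, ∀ w : Fin 4, UPartner Z P b w → w = φ ∧ P b = (0, 0, 0) := fun P hP w hZP => by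
    have hd : 0 < (Z b).1 - (P b).1 := by have := hZP.2.1; omega
    have e : floorUnit φ = ray (P b) w ((Z b).1 - (P b).1) := by rw [← hb]; exact hZP.2.2
    exact below_floorUnit (hU.2 P hP b) hd e
  refine hA Z hZ q hq _ hN' b φ a φ ⟨by rw [hb]; exact floorUnit_not_isApex φ, ?_, ?_, fun _ => ?_, hab, ?_, ?_, ?_, ?_, ?_, ?_⟩
  · rw [hb]; fin_cases φ <;> simp [EncDir, cabs, ray]
  · exact ⟨hqZ, by omega, by rw [hZb1, hqb1, hb, hqb]; norm_num⟩
  · rw [hZb1, hqb1, hb]; fin_cases φ <;> simp [cabs, ray]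
  · refine ⟨fun g hg => ?_, by rw [eNa, floorUnit_fst, hqa1]; norm_num, by rw [eNa, floorUnit_fst, hqa1, hqa]; norm_num⟩
    by_cases hgb : g = b
    · rw [hgb, hqb, eNb]
    · show q g = Z (Equiv.swap a b g)
      rw [Equiv.swap_apply_of_ne_of_ne hg hgb]; exact hqZ g hgb
  · exact fun P hP w hw hZP => hw (nob P hP w hZP).1
  · exact fun P hP hZP => by rw [(nob P hP φ hZP).2, hqb]
  · exact fun P hP hqP => by
      have h1 := hqP.2.1; have h2 := fst_nonneg_of_inDiamond (hU.2 P hP b); rw [hqb1] at h1; exact absurd h1 (by omega)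
  · exact fun P hP hnb _ => by
      have h1 := hnb.1; have h2 := fst_nonneg_of_inDiamond (hU.2 P hP a); rw [hZa1] at h1; exact absurd h1 (by omega)
  · intro P hP hPg hul
    refine ⟨fun h3b => ?_, fun h3d => not_spacelike_of_inDiamond (hU.2 P hP a) (by rw [ha] at h3d; exact h3d.2)⟩
    have hNa1 : (Z.perm (Equiv.swap a b) a).1 = 1 := by rw [eNa, floorUnit_fst]
    have hPa1 : (P a).1 = 1 := by have := h3b.1; have := h3b.2.1; omega
    have hPa : P a = floorUnit φ := by
      have e := h3b.2.2; rw [hPa1, hZa1, ha] at e; rw [e]; norm_num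
    have hPb1 : (P b).1 = 0 := by have := hul.1; have := fst_nonneg_of_inDiamond (hU.2 P hP b); omega
    have hPb : P b = (0, 0, 0) := by
      have e := hul.2; rw [hqb1, hPb1, show ((0:ℤ) - 0) = 0 by norm_num, ray_zero] at e; rw [← e, hqb]
    exact hno ⟨P, hP, fun g hga hgb => hPg g hgb hga, hPa, hPb⟩

/-- **B4** `N{O, ℓ_φ, cu_χ, cu_χ'} ∉ C.lower` [◇_h, RULE D, X⁺, `S₄` both levels, `Δ` on E₊, A2I⁻]: `q = N(1 ↦ O)` (RULE D at `O` × the top of `ℓ_φ`),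
then the interface gives B2 after (0 1).  Census: the 10 `[Am]`-dependent round-1 orbits (kind `P:Xp`) of every diamond. -/
theorem loneUnit_pair_N_absent {h : ℤ} {C : MConfig} (hU : C.InDiamond h) (hDN : ∀ Z ∈ C.lower, RuleDMu4N C Z)
    (hDP : ∀ P ∈ C.upper, RuleDMu4P C P) (hX : XPlusClosed C) (hA : A2IMinusClosed C) (hGl : PermClosed C.lower)
    (hGu : PermClosed C.upper) (hΔu : DeltaClosed C.upper) {N : MCell} {φ χ χ' : Fin 4}
    (h0 : N 0 = (0, 0, 0)) (h1 : N 1 = floorUnit φ) (h2 : N 2 = ceilingUnit h χ) (h3 : N 3 = ceilingUnit h χ') : N ∉ C.lower := fun hN => by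
  have h0' : N 0 = floorLetter φ 0 := h0.trans (ray_zero _ φ).symm
  obtain ⟨q, hq, hqN, hq1⟩ := descent_of_floorNode_floorUnit hU (hDN N hN) (b := 0) (c := 1) (by decide) le_rfl h0' h1
  obtain ⟨P, hP, hPN, hP0, hP1⟩ := a2i_origin_interface hU hA hGl hN (a := 0) (b := 1) (by decide) h0 h1 hq hqN hq1
  exact loneUnit_pair_absent hU hDN hDP hX hΔu (P := P.perm (Equiv.swap 0 1)) (φ := φ) (χ := χ) (χ' := χ')
    (by show P (Equiv.swap (0 : Fin 4) 1 0) = _; simpa using hP1)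
    (by show P (Equiv.swap (0 : Fin 4) 1 1) = _; simpa using hP0)
    (by show P (Equiv.swap (0 : Fin 4) 1 2) = _; simpa [Equiv.swap_apply_of_ne_of_ne] using (hPN 2 (by decide) (by decide)).trans h2)
    (by show P (Equiv.swap (0 : Fin 4) 1 3) = _; simpa [Equiv.swap_apply_of_ne_of_ne] using (hPN 3 (by decide) (by decide)).trans h3)
    (hGu _ P hP)

/-- the sub-apex up-server of §2 with the frame of `(h−2)I` as a parameter: the serving ceiling unit `cu_r` has `r ≠ k' + 2`. -/
theorem subApex_upServer' {h : ℤ} {C : MConfig} (hU : C.InDiamond h) {P : MCell} (hP : P ∈ C.upper) (hD : RuleDMu4P C P) {g j : Fin 4}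
    (hgj : g ≠ j) (hgc : OnCeiling h (P g)) (hj : P j = (h - 2, 0, 0)) (k' : Fin 4) :
    ∃ N ∈ C.lower, ∃ r : Fin 4, r ≠ k' + 2 ∧ (∀ i, i ≠ j → N i = P i) ∧ N j = ceilingUnit h r := by
  obtain ⟨m, hm, hmh⟩ := exists_top_dir hgc (hU.2 P hP g).1
  have hk' : Adapted (P j) k' := by rw [hj]; fin_cases k' <;> simp [Adapted]
  have hk'c : coord (P j) k' = h - 2 := by rw [hj]; exact coord_of_isApex ⟨rfl, rfl⟩ k'
  have hne : coord (P g) m ≠ coord (P j) k' := by rw [hmh, hk'c]; omega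
  have above : ∀ N ∈ C.lower, ∀ a : Fin 4, a ≠ m + 2 → (P g).1 < (N g).1 → N g = ray (P g) a ((N g).1 - (P g).1) → False :=
    fun N hN a ha hlt hray =>
      not_inDiamond_above_offnode hgc (hU.2 P hP g).1 hm hmh ha (by omega) hray (hU.1 N hN g).1 (hU.1 N hN g).2.2.2
  rcases hD g j hgj m k' hm hk' hne with ⟨r, hr, N, hN, hNP⟩ | ⟨r, hr, N, hN, hNP⟩ | ⟨a, b, ha, -, N, hN, -, hg1, hg2, -, -⟩
  · exact (above N hN r hr hNP.2.1 hNP.2.2).elim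
  · have he0 : 0 < (N j).1 - (P j).1 := by have := hNP.2.1; omega
    have e : N j = ray ((h - 2, 0, 0) : BPoint) r ((N j).1 - (P j).1) := by rw [← hj]; exact hNP.2.2
    have he1 := above_subApex he0 (hU.1 N hN j) e
    rw [he1] at e
    exact ⟨N, hN, r, hr, fun i hi => (hNP.1 i hi).symm, e⟩
  · have ha' : a ≠ m + 2 := by
      rcases ha with e | ⟨_, hne2⟩
      · rw [e]; exact fin4_ne_add_two m
      · exact hne2
    exact (above N hN a ha' hg1 hg2).elim

/-- below the apex `2I` in any direction `r` sits only the floor unit `ℓ_{r+2}`. -/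
theorem apexTwo_downRay {h d : ℤ} {z : BPoint} {r : Fin 4} (hz : InDiamond h z) (hd : 0 < d)
    (heq : ((2 : ℤ), (0 : ℤ), (0 : ℤ)) = ray z r d) : z = floorUnit (r + 2) := by
  obtain ⟨α, a, b⟩ := z
  obtain ⟨hax, h1, -, -⟩ := hz
  simp only [floorUnit, AxisPt, absCharge, chargeOf, ray, Prod.mk.injEq] at hax h1 heq ⊢
  fin_cases r <;> simp at hax h1 heq ⊢ <;>
    (simp only [abs_eq_max_neg, max_def] at h1; split_ifs at h1 <;> omega)

/-- **SERVICE BELOW OF AN APEX FORCED BY A FLOOR LETTER** (= `servedBelow_of_floorLetter` of the tree for an apex at `g`: served in SOME direction). -/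
theorem servedBelow_floor_apex {h : ℤ} {C : MConfig} (hU : C.InDiamond h) {Z : MCell} (hZ : Z ∈ C.lower) (hD : RuleDMu4N C Z) {i g : Fin 4}
    (hig : i ≠ g) (hi : OnFloor (Z i)) {k : Fin 4} (hk : Adapted (Z g) k) (hk0 : coord (Z g) k ≠ 0) : ∃ r, MServedBelow C Z g r := by
  obtain ⟨m, hm, hm0⟩ := exists_node_dir (hU.1 Z hZ i).1
  have hm0' : coord (Z i) m = 0 := by rw [hm0, hi, sub_self]
  have hne : coord (Z i) m ≠ coord (Z g) k := by rw [hm0']; exact Ne.symm hk0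
  have below : ∀ P ∈ C.upper, ∀ a : Fin 4, a ≠ m + 2 → (P i).1 < (Z i).1 → Z i = ray (P i) a ((Z i).1 - (P i).1) → False :=
    fun P hP a ha hlt hray =>
      not_inDiamond_below_offtop hi (hU.1 Z hZ i).1 hm hm0' ha (by omega) hray (hU.2 P hP i).1 (hU.2 P hP i).2.1
  rcases hD i g hig m k hm hk hne with ⟨r, hr, P, hP, hZP⟩ | ⟨r, -, P, hP, hZP⟩ | ⟨a, b, ha, -, P, hP, -, hi1, hi2, -, -⟩
  · exact (below P hP r hr hZP.2.1 hZP.2.2).elim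
  · exact ⟨r, P, hP, hZP⟩
  · have ha' : a ≠ m + 2 := by
      rcases ha with e | ⟨-, hne2⟩
      · rw [e]; exact fin4_ne_add_two m
      · exact hne2
    exact (below P hP a ha' hi1 hi2).elim

/-- **SERVICE ABOVE OF AN APEX FORCED BY A CEILING LETTER** (= `upLine_of_ruleDMu4P` of the tree for an apex at `j`: served in SOME direction). -/
theorem servedAbove_ceiling_apex {h : ℤ} {C : MConfig} (hU : C.InDiamond h) {P : MCell} (hP : P ∈ C.upper) (hD : RuleDMu4P C P) {g j : Fin 4}
    (hgj : g ≠ j) (hgc : OnCeiling h (P g)) {k : Fin 4} (hk : Adapted (P j) k) (hkh : coord (P j) k ≠ h) : ∃ r, MServedAbove C P j r := by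
  obtain ⟨m, hm, hmh⟩ := exists_top_dir hgc (hU.2 P hP g).1
  have hne : coord (P g) m ≠ coord (P j) k := by rw [hmh]; exact Ne.symm hkh
  have above : ∀ N ∈ C.lower, ∀ a : Fin 4, a ≠ m + 2 → (P g).1 < (N g).1 → N g = ray (P g) a ((N g).1 - (P g).1) → False :=
    fun N hN a ha hlt hray =>
      not_inDiamond_above_offnode hgc (hU.2 P hP g).1 hm hmh ha (by omega) hray (hU.1 N hN g).1 (hU.1 N hN g).2.2.2
  rcases hD g j hgj m k hm hk hne with ⟨r, hr, N, hN, hNP⟩ | ⟨r, -, N, hN, hNP⟩ | ⟨a, b, ha, -, N, hN, -, hg1, hg2, -, -⟩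
  · exact (above N hN r hr hNP.2.1 hNP.2.2).elim
  · exact ⟨r, N, hN, hNP⟩
  · have ha' : a ≠ m + 2 := by
      rcases ha with e | ⟨-, hne2⟩
      · rw [e]; exact fin4_ne_add_two m
      · exact hne2
    exact (above N hN a ha' hg1 hg2).elim

theorem adapted_apexTwo (k : Fin 4) : Adapted (((2 : ℤ), (0 : ℤ), (0 : ℤ)) : BPoint) k := by fin_cases k <;> simp [Adapted]

theorem coord_apexTwo (k : Fin 4) : coord (((2 : ℤ), (0 : ℤ), (0 : ℤ)) : BPoint) k = 2 := coord_of_isApex ⟨rfl, rfl⟩ k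

/-- the UP-LINE OF A CEILING-LINE LETTER: in a `P`-cell with `y_d(v)` (`d ≥ 1`) in slot 2 and `cu_χ` in slot 3, slot 2 is served above along the
node ray of `y_d` by some `y_{d−e}`, `1 ≤ e ≤ d+1`. -/
theorem upLine_ceilLetter {h d : ℤ} {C : MConfig} (hU : C.InDiamond h) {P : MCell} (hP : P ∈ C.upper) (hD : RuleDMu4P C P)
    {v χ : Fin 4} (hd : 1 ≤ d) (h2 : P 2 = ceilLetter h v d) (h3 : P 3 = ceilingUnit h χ) :
    ∃ N ∈ C.lower, (∀ i, i ≠ 2 → N i = P i) ∧ ∃ e, 1 ≤ e ∧ e ≤ d + 1 ∧ N 2 = ceilLetter h v (d - e) := by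
  have hna : ¬ isApex (P 2) := by rw [h2]; exact ceilLetter_not_isApex v (by omega)
  have hk : Adapted (P 2) (v + 2) := by rw [h2]; exact (ceilLetter_node h v d).1
  have hkh : coord (P 2) (v + 2) ≠ h := by rw [h2, (ceilLetter_node h v d).2]; omega
  obtain ⟨N, hN, hNP⟩ := upLine_of_ruleDMu4P hU hP hD (g := 3) (j := 2) (by decide) (by rw [h3]; exact onCeiling_ceilingUnit h χ) hna hk hkh
  have he0 : 0 < (N 2).1 - (P 2).1 := by have := hNP.2.1; omega
  have e : N 2 = ray (ceilLetter h v d) (v + 2) ((N 2).1 - (P 2).1) := by rw [← h2]; exact hNP.2.2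
  obtain ⟨-, hle, hN2⟩ := above_ceilLetter_offRay (by omega) (hU.1 N hN 2) he0 e
  exact ⟨N, hN, fun g hg => (hNP.1 g hg).symm, (N 2).1 - (P 2).1, by omega, hle, hN2⟩

/-- the induction behind OP_d: `P{O, ℓ_φ, y_d, cu_χ} ∉ C.upper` for `1 ≤ d ≤ n`, by induction on `n`. -/
theorem originUnitCeilLine_aux {h : ℤ} {C : MConfig} (hU : C.InDiamond h) (hDN : ∀ Z ∈ C.lower, RuleDMu4N C Z)
    (hDP : ∀ P ∈ C.upper, RuleDMu4P C P) (hX : XPlusClosed C) (hA : A2IMinusClosed C) (hGl : PermClosed C.lower)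
    (hGu : PermClosed C.upper) (hΔu : DeltaClosed C.upper) :
    ∀ n : ℕ, ∀ {P : MCell} {d : ℤ} {φ v χ : Fin 4}, 1 ≤ d → d ≤ n → P 0 = (0, 0, 0) → P 1 = floorUnit φ →
      P 2 = ceilLetter h v d → P 3 = ceilingUnit h χ → P ∉ C.upper := by
  intro n
  induction n with
  | zero => intro P d φ v χ hd hdn _ _ _ _ _; omega
  | succ n ih =>
    intro P d φ v χ hd hdn h0 h1 h2 h3 hP
    obtain ⟨N, hN, hNP, e, he1, he2, hN2⟩ := upLine_ceilLetter hU hP (hDP P hP) hd h2 h3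
    have hN0 : N 0 = (0, 0, 0) := (hNP 0 (by decide)).trans h0
    have hN1 : N 1 = floorUnit φ := (hNP 1 (by decide)).trans h1
    have hN3 : N 3 = ceilingUnit h χ := (hNP 3 (by decide)).trans h3
    rcases (show 1 ≤ d - e ∨ d - e = 0 ∨ d - e = -1 by omega) with hge | hze | hneg
    · have hN0' : N 0 = floorLetter φ 0 := hN0.trans (ray_zero _ φ).symm
      obtain ⟨q, hq, hqN, hq1⟩ := descent_of_floorNode_floorUnit hU (hDN N hN) (b := 0) (c := 1) (by decide) le_rfl hN0' hN1
      obtain ⟨P', hP', hP'N, hP'0, hP'1⟩ := a2i_origin_interface hU hA hGl hN (a := 0) (b := 1) (by decide) hN0 hN1 hq hqN hq1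
      exact ih (P := P'.perm (Equiv.swap 0 1)) (d := d - e) (φ := φ) (v := v) (χ := χ) hge (by omega)
        (by show P' (Equiv.swap (0 : Fin 4) 1 0) = _; simpa using hP'1)
        (by show P' (Equiv.swap (0 : Fin 4) 1 1) = _; simpa using hP'0)
        (by show P' (Equiv.swap (0 : Fin 4) 1 2) = _; simpa [Equiv.swap_apply_of_ne_of_ne] using (hP'N 2 (by decide) (by decide)).trans hN2)
        (by show P' (Equiv.swap (0 : Fin 4) 1 3) = _; simpa [Equiv.swap_apply_of_ne_of_ne] using (hP'N 3 (by decide) (by decide)).trans hN3)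
        (hGu _ P' hP')
    · rw [hze, ceilLetter_zero] at hN2
      exact loneUnit_pair_N_absent hU hDN hDP hX hA hGl hGu hΔu hN0 hN1 hN2 hN3 hN
    · rw [hneg, ceilLetter_neg_one] at hN2
      exact loneUnit_apex_absent hU hDN hDP hX hΔu (N := N.perm (Equiv.swap 2 3)) (φ := φ) (χ := χ)
        (by show N (Equiv.swap (2 : Fin 4) 3 0) = _; simpa [Equiv.swap_apply_of_ne_of_ne] using hN0)
        (by show N (Equiv.swap (2 : Fin 4) 3 1) = _; simpa [Equiv.swap_apply_of_ne_of_ne] using hN1)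
        (by show N (Equiv.swap (2 : Fin 4) 3 2) = _; simpa using hN3)
        (by show N (Equiv.swap (2 : Fin 4) 3 3) = _; simpa using hN2) (hGl _ N hN)

/-- **OP_d.** `P{O, ℓ_φ, y_d(v), cu_χ} ∉ C.upper` for EVERY `d ≥ 1` [◇_h, RULE D, X⁺, A2I⁻, `S₄` on both levels, `Δ` on E₊; every `h`] (`d = 1` is TP18).
Census: peel rounds 2 – 3, 0 survivors. -/
theorem originUnitCeilLine_P_absent {h d : ℤ} {C : MConfig} (hU : C.InDiamond h) (hDN : ∀ Z ∈ C.lower, RuleDMu4N C Z)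
    (hDP : ∀ P ∈ C.upper, RuleDMu4P C P) (hX : XPlusClosed C) (hA : A2IMinusClosed C) (hGl : PermClosed C.lower)
    (hGu : PermClosed C.upper) (hΔu : DeltaClosed C.upper) (hd : 1 ≤ d) {P : MCell} {φ v χ : Fin 4} (h0 : P 0 = (0, 0, 0))
    (h1 : P 1 = floorUnit φ) (h2 : P 2 = ceilLetter h v d) (h3 : P 3 = ceilingUnit h χ) : P ∉ C.upper :=
  originUnitCeilLine_aux hU hDN hDP hX hA hGl hGu hΔu d.toNat hd (Int.self_le_toNat d) h0 h1 h2 h3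

/-- **ON_d.** `N{O, ℓ_φ, y_d(v), cu_χ} ∉ C.lower` for every `d ≥ 1` [same]: the descent `N(1 ↦ O)` and the origin interface give OP_d after (0 1).
Census: ◇₈ 16 ∕ 16 ∕ 16, ◇₁₀ 16 ∕ 16 ∕ 16 ∕ 16 orbits (rounds 2, 2, 3, 3), 0 survivors, all untyped before. -/
theorem originUnitCeilLine_N_absent {h d : ℤ} {C : MConfig} (hU : C.InDiamond h) (hDN : ∀ Z ∈ C.lower, RuleDMu4N C Z)
    (hDP : ∀ P ∈ C.upper, RuleDMu4P C P) (hX : XPlusClosed C) (hA : A2IMinusClosed C) (hGl : PermClosed C.lower)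
    (hGu : PermClosed C.upper) (hΔu : DeltaClosed C.upper) (hd : 1 ≤ d) {N : MCell} {φ v χ : Fin 4} (h0 : N 0 = (0, 0, 0))
    (h1 : N 1 = floorUnit φ) (h2 : N 2 = ceilLetter h v d) (h3 : N 3 = ceilingUnit h χ) : N ∉ C.lower := fun hN => by
  have h0' : N 0 = floorLetter φ 0 := h0.trans (ray_zero _ φ).symm
  obtain ⟨q, hq, hqN, hq1⟩ := descent_of_floorNode_floorUnit hU (hDN N hN) (b := 0) (c := 1) (by decide) le_rfl h0' h1
  obtain ⟨P, hP, hPN, hP0, hP1⟩ := a2i_origin_interface hU hA hGl hN (a := 0) (b := 1) (by decide) h0 h1 hq hqN hq1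
  exact originUnitCeilLine_P_absent hU hDN hDP hX hA hGl hGu hΔu hd (P := P.perm (Equiv.swap 0 1)) (φ := φ) (v := v) (χ := χ)
    (by show P (Equiv.swap (0 : Fin 4) 1 0) = _; simpa using hP1)
    (by show P (Equiv.swap (0 : Fin 4) 1 1) = _; simpa using hP0)
    (by show P (Equiv.swap (0 : Fin 4) 1 2) = _; simpa [Equiv.swap_apply_of_ne_of_ne] using (hPN 2 (by decide) (by decide)).trans h2)
    (by show P (Equiv.swap (0 : Fin 4) 1 3) = _; simpa [Equiv.swap_apply_of_ne_of_ne] using (hPN 3 (by decide) (by decide)).trans h3)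
    (hGu _ P hP)

/-- below the apex `hI`, some adapted frame coordinate of a ◇_h letter is not `h` (the node frame): RULE D at a `P`-cell can serve it ABOVE. -/
theorem exists_frame_ne_h {h : ℤ} {z : BPoint} (hz : InDiamond h z) (hne : z ≠ (h, 0, 0)) : ∃ k : Fin 4, Adapted z k ∧ coord z k ≠ h := by
  obtain ⟨k, hk, hkc⟩ := exists_node_dir hz.1
  refine ⟨k, hk, fun e => hne ?_⟩
  have c0 : 0 ≤ absCharge z := abs_nonneg _
  have htop : z.1 + absCharge z ≤ h := hz.2.2.2
  have hz1 : z.1 = h := by rw [hkc] at e; omega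
  have hc : absCharge z = 0 := by rw [hkc] at e; omega
  have hax := hz.1
  obtain ⟨α, a, b⟩ := z
  simp only [absCharge, chargeOf, AxisPt, Prod.mk.injEq, abs_eq_zero, sub_eq_zero] at hc hax hz1 ⊢
  refine ⟨hz1, ?_, ?_⟩ <;> omega

/-- the induction step of F1: if every HIGHER completion `N{O, ℓ_φ, X', cu_χ}` (`X'.1 > X.1`) is absent, so is `N{O, ℓ_φ, X, cu_χ}`. -/
theorem originUnitFree_step {h : ℤ} {C : MConfig} (hU : C.InDiamond h) (hDN : ∀ Z ∈ C.lower, RuleDMu4N C Z)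
    (hDP : ∀ P ∈ C.upper, RuleDMu4P C P) (hX : XPlusClosed C) (hA : A2IMinusClosed C) (hGl : PermClosed C.lower)
    (hΔu : DeltaClosed C.upper) {N : MCell} {φ χ : Fin 4}
    (ih : ∀ N' : MCell, (N 2).1 < (N' 2).1 → N' 0 = (0, 0, 0) → N' 1 = floorUnit φ → N' 3 = ceilingUnit h χ → N' ∉ C.lower)
    (h0 : N 0 = (0, 0, 0)) (h1 : N 1 = floorUnit φ) (h3 : N 3 = ceilingUnit h χ) : N ∉ C.lower := fun hN => by
  by_cases hap : N 2 = (h, 0, 0)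
  · exact loneUnit_apex_absent hU hDN hDP hX hΔu (N := N.perm (Equiv.swap 2 3)) (φ := φ) (χ := χ)
      (by show N (Equiv.swap (2 : Fin 4) 3 0) = _; simpa [Equiv.swap_apply_of_ne_of_ne] using h0)
      (by show N (Equiv.swap (2 : Fin 4) 3 1) = _; simpa [Equiv.swap_apply_of_ne_of_ne] using h1)
      (by show N (Equiv.swap (2 : Fin 4) 3 2) = _; simpa using h3)
      (by show N (Equiv.swap (2 : Fin 4) 3 3) = _; simpa using hap) (hGl _ N hN)
  · have h0' : N 0 = floorLetter φ 0 := h0.trans (ray_zero _ φ).symm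
    obtain ⟨q, hq, hqN, hq1⟩ := descent_of_floorNode_floorUnit hU (hDN N hN) (b := 0) (c := 1) (by decide) le_rfl h0' h1
    obtain ⟨P, hP, hPN, hP0, hP1⟩ := a2i_origin_interface hU hA hGl hN (a := 0) (b := 1) (by decide) h0 h1 hq hqN hq1
    have hP2 : P 2 = N 2 := hPN 2 (by decide) (by decide)
    have hP3 : P 3 = ceilingUnit h χ := (hPN 3 (by decide) (by decide)).trans h3
    obtain ⟨k, hk, hkh⟩ := exists_frame_ne_h (hU.2 P hP 2) (by rw [hP2]; exact hap)
    obtain ⟨r, N', hN', hN'P⟩ := servedAbove_ceiling_apex hU hP (hDP P hP) (g := 3) (j := 2) (by decide)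
      (by rw [hP3]; exact onCeiling_ceilingUnit h χ) hk hkh
    have hlt : (N 2).1 < (N' 2).1 := by rw [← hP2]; exact hN'P.2.1
    exact ih (N'.perm (Equiv.swap 0 1))
      (by show (N 2).1 < (N' (Equiv.swap (0 : Fin 4) 1 2)).1; simpa [Equiv.swap_apply_of_ne_of_ne] using hlt)
      (by show N' (Equiv.swap (0 : Fin 4) 1 0) = _; simpa using (hN'P.1 1 (by decide)).symm.trans hP1)
      (by show N' (Equiv.swap (0 : Fin 4) 1 1) = _; simpa using (hN'P.1 0 (by decide)).symm.trans hP0)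
      (by show N' (Equiv.swap (0 : Fin 4) 1 3) = _; simpa [Equiv.swap_apply_of_ne_of_ne] using (hN'P.1 3 (by decide)).symm.trans hP3)
      (hGl _ N' hN')

theorem originUnitFree_aux {h : ℤ} {C : MConfig} (hU : C.InDiamond h) (hDN : ∀ Z ∈ C.lower, RuleDMu4N C Z)
    (hDP : ∀ P ∈ C.upper, RuleDMu4P C P) (hX : XPlusClosed C) (hA : A2IMinusClosed C) (hGl : PermClosed C.lower)
    (hΔu : DeltaClosed C.upper) : ∀ n : ℕ, ∀ {N : MCell} {φ χ : Fin 4}, h - (N 2).1 ≤ n → N 0 = (0, 0, 0) → N 1 = floorUnit φ →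
      N 3 = ceilingUnit h χ → N ∉ C.lower := by
  intro n
  induction n with
  | zero =>
    intro N φ χ hn h0 h1 h3
    exact originUnitFree_step hU hDN hDP hX hA hGl hΔu (fun N' hlt _ _ _ hN' => by
      have c0 : 0 ≤ absCharge (N' 2) := abs_nonneg _
      have htop : (N' 2).1 + absCharge (N' 2) ≤ h := (hU.1 N' hN' 2).2.2.2
      omega) h0 h1 h3
  | succ n ih =>
    intro N φ χ hn h0 h1 h3
    exact originUnitFree_step hU hDN hDP hX hA hGl hΔu (fun N' hlt h0' h1' h3' => ih (by omega) h0' h1' h3') h0 h1 h3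

/-- **F1.** `N{O, ℓ_φ, X, cu_χ} ∉ C.lower` for EVERY fourth letter `X` [◇_h, RULE D, X⁺, A2I⁻, `S₄` on E₋, `Δ` on E₊; every `h`] (B4 is `X = cu`, ON_d is
`X = y_d`, `loneUnit_apex_absent` is `X = hI`).  Census: ◇₈ 168 ∕ ◇₁₀ 252 orbits, rounds 1 – 5, 0 survivors. -/
theorem originUnitFree_N_absent {h : ℤ} {C : MConfig} (hU : C.InDiamond h) (hDN : ∀ Z ∈ C.lower, RuleDMu4N C Z)
    (hDP : ∀ P ∈ C.upper, RuleDMu4P C P) (hX : XPlusClosed C) (hA : A2IMinusClosed C) (hGl : PermClosed C.lower)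
    (hΔu : DeltaClosed C.upper) {N : MCell} {φ χ : Fin 4} (h0 : N 0 = (0, 0, 0)) (h1 : N 1 = floorUnit φ)
    (h3 : N 3 = ceilingUnit h χ) : N ∉ C.lower :=
  originUnitFree_aux hU hDN hDP hX hA hGl hΔu (h - (N 2).1).toNat (Int.self_le_toNat _) h0 h1 h3

/-- **F2.** `P{O, ℓ_φ, X, cu_χ} ∉ C.upper` for every fourth letter `X ≠ hI` [same]: the ceiling pin serves `X` above, then F1
(B2 is `X = cu`, TP18 ∕ OP_d are `X = y_d`).  Census: ◇₈ 164 ∕ ◇₁₀ 248 orbits (rounds 1 – 5), 0 survivors; new ◇₈ 102 ∕ ◇₁₀ 170. -/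
theorem originUnitFree_P_absent {h : ℤ} {C : MConfig} (hU : C.InDiamond h) (hDN : ∀ Z ∈ C.lower, RuleDMu4N C Z)
    (hDP : ∀ P ∈ C.upper, RuleDMu4P C P) (hX : XPlusClosed C) (hA : A2IMinusClosed C) (hGl : PermClosed C.lower)
    (hΔu : DeltaClosed C.upper) {P : MCell} {φ χ : Fin 4} (h2 : P 2 ≠ (h, 0, 0)) (h0 : P 0 = (0, 0, 0)) (h1 : P 1 = floorUnit φ)
    (h3 : P 3 = ceilingUnit h χ) : P ∉ C.upper := fun hP => by
  obtain ⟨k, hk, hkh⟩ := exists_frame_ne_h (hU.2 P hP 2) h2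
  obtain ⟨r, N, hN, hNP⟩ := servedAbove_ceiling_apex hU hP (hDP P hP) (g := 3) (j := 2) (by decide)
    (by rw [h3]; exact onCeiling_ceilingUnit h χ) hk hkh
  exact originUnitFree_N_absent hU hDN hDP hX hA hGl hΔu ((hNP.1 0 (by decide)).symm.trans h0) ((hNP.1 1 (by decide)).symm.trans h1)
    ((hNP.1 3 (by decide)).symm.trans h3) hN

theorem nodeTwoLetter_fst (u : Fin 4) (n : ℤ) : (nodeTwoLetter u n).1 = 2 + n := rfl

theorem floorLetter_fst (φ : Fin 4) (c : ℤ) : (floorLetter φ c).1 = c := show (0 : ℤ) + c = c from zero_add c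

/-- a letter of ◇_h other than the origin has an adapted frame coordinate `≠ 0` (RULE D at an `N`-cell with a floor pin can serve it BELOW). -/
theorem exists_frame_ne_zero {z : BPoint} (hzax : z.2 = (0, 0) ∨ AxisPt z) (hne : z ≠ (0, 0, 0)) :
    ∃ k : Fin 4, Adapted z k ∧ coord z k ≠ 0 := by
  obtain ⟨α, a, b⟩ := z
  simp only [AxisPt, Prod.mk.injEq] at hzax
  simp only [ne_eq, Prod.mk.injEq] at hne
  rcases hzax with ⟨ha, hb⟩ | ⟨ha, hb⟩ | ⟨ha, hb⟩
  · exact ⟨0, by simp [Adapted, hb], by simp [coord]; omega⟩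
  · by_cases e : α + a = 0
    · exact ⟨2, by simp [Adapted, hb], by simp [coord]; omega⟩
    · exact ⟨0, by simp [Adapted, hb], by simp [coord]; omega⟩
  · by_cases e : α - b = 0
    · exact ⟨3, by simp [Adapted, ha], by simp [coord]; omega⟩
    · exact ⟨1, by simp [Adapted, ha], by simp [coord]; omega⟩

/-- `servedBelow_floor_apex` keeping the direction datum of RULE D: served below in a direction other than the antipode `k + 2`. -/
theorem servedBelow_floor_dir {h : ℤ} {C : MConfig} (hU : C.InDiamond h) {Z : MCell} (hZ : Z ∈ C.lower) (hD : RuleDMu4N C Z) {i g : Fin 4}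
    (hig : i ≠ g) (hi : OnFloor (Z i)) {k : Fin 4} (hk : Adapted (Z g) k) (hk0 : coord (Z g) k ≠ 0) :
    ∃ r, r ≠ k + 2 ∧ MServedBelow C Z g r := by
  obtain ⟨m, hm, hm0⟩ := exists_node_dir (hU.1 Z hZ i).1
  have hm0' : coord (Z i) m = 0 := by rw [hm0, hi, sub_self]
  have hne : coord (Z i) m ≠ coord (Z g) k := by rw [hm0']; exact Ne.symm hk0
  have below : ∀ P ∈ C.upper, ∀ a : Fin 4, a ≠ m + 2 → (P i).1 < (Z i).1 → Z i = ray (P i) a ((Z i).1 - (P i).1) → False :=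
    fun P hP a ha hlt hray =>
      not_inDiamond_below_offtop hi (hU.1 Z hZ i).1 hm hm0' ha (by omega) hray (hU.2 P hP i).1 (hU.2 P hP i).2.1
  rcases hD i g hig m k hm hk hne with ⟨r, hr, P, hP, hZP⟩ | ⟨r, hr, P, hP, hZP⟩ | ⟨a, b, ha, -, P, hP, -, hi1, hi2, -, -⟩
  · exact (below P hP r hr hZP.2.1 hZP.2.2).elim
  · exact ⟨r, hr, P, hP, hZP⟩
  · have ha' : a ≠ m + 2 := by
      rcases ha with e | ⟨-, hne2⟩
      · rw [e]; exact fin4_ne_add_two m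
      · exact hne2
    exact (below P hP a ha' hi1 hi2).elim

/-- **THE A2I⁻ ORIGIN INTERFACE FOR A FLOOR LETTER OF ANY CHARGE** (A2I⁻, `S₄` on E₋): `Z ∈ E₋` with `Z a = O`, `Z b = c·ℓ_ψ` (`c ≥ 1`), its full
descent `Z(b ↦ O) ∈ E₊` and no shallower `ψ`-partner present ⇒ some `Z(a ↦ c′·ℓ_ψ, b ↦ O) ∈ E₊`, `1 ≤ c′ ≤ c` (docstring abridged; `CeilingTower` §0). -/
theorem a2i_origin_floor_interface {h c : ℤ} {C : MConfig} (hU : C.InDiamond h) (hA : A2IMinusClosed C) (hGl : PermClosed C.lower)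
    {Z : MCell} (hZ : Z ∈ C.lower) {a b : Fin 4} (hab : a ≠ b) {ψ : Fin 4} (ha : Z a = (0, 0, 0)) (hb : Z b = floorLetter ψ c)
    (hc : 1 ≤ c) {q : MCell} (hq : q ∈ C.upper) (hqZ : MAgree q Z b) (hqb : q b = (0, 0, 0))
    (hinter : ∀ P ∈ C.upper, UPartner Z P b ψ → (P b).1 ≤ 0) :
    ∃ P ∈ C.upper, ∃ c', 1 ≤ c' ∧ c' ≤ c ∧ MAgree2 P Z a b ∧ P a = floorLetter ψ c' ∧ P b = (0, 0, 0) := by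
  by_contra hno
  have hN' : Z.perm (Equiv.swap a b) ∈ C.lower := hGl (Equiv.swap a b) Z hZ
  have eNa : Z.perm (Equiv.swap a b) a = floorLetter ψ c := by show Z (Equiv.swap a b a) = _; rw [Equiv.swap_apply_left, hb]
  have eNb : Z.perm (Equiv.swap a b) b = (0, 0, 0) := by show Z (Equiv.swap a b b) = _; rw [Equiv.swap_apply_right, ha]
  have hqa : q a = (0, 0, 0) := (hqZ a hab).trans ha
  have hZb1 : (Z b).1 = c := by rw [hb, floorLetter_fst]
  have hqb1 : (q b).1 = 0 := by rw [hqb]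
  have hZa1 : (Z a).1 = 0 := by rw [ha]
  have hqa1 : (q a).1 = 0 := by rw [hqa]
  have hc0 : |c| = c := abs_of_nonneg (by omega)
  have h0c : (0 : ℤ) ≤ c := by omega
  have nob : ∀ P ∈ C.upper, ∀ w : Fin 4, UPartner Z P b w → w = ψ := fun P hP w hZP => by
    have hd : 0 < (Z b).1 - (P b).1 := by have := hZP.2.1; omega
    have e : floorLetter ψ c = ray (P b) w ((Z b).1 - (P b).1) := by rw [← hb]; exact hZP.2.2
    exact below_floorLetter (hU.2 P hP b) h0c hd e
  refine hA Z hZ q hq _ hN' b ψ a ψ ⟨by rw [hb]; exact floorLetter_not_isApex ψ (by omega), ?_, ?_, fun _ => ?_, hab, ?_, ?_, ?_, ?_, ?_, ?_⟩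
  · rw [hb]; left
    fin_cases ψ <;> simp [EncDir, cabs, ray, hc0, h0c]
  · exact ⟨hqZ, by omega, by rw [hZb1, hqb1, hb, hqb, sub_zero]⟩
  · rw [hZb1, hqb1, hb]; fin_cases ψ <;> simp [cabs, ray, hc0, h0c]
  · refine ⟨fun g hg => ?_, by rw [eNa, floorLetter_fst, hqa1]; omega, by rw [eNa, floorLetter_fst, hqa1, hqa, sub_zero]⟩
    by_cases hgb : g = b
    · rw [hgb, hqb, eNb]
    · show q g = Z (Equiv.swap a b g)
      rw [Equiv.swap_apply_of_ne_of_ne hg hgb]; exact hqZ g hgb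
  · exact fun P hP w hw hZP => hw (nob P hP w hZP)
  · exact fun P hP hZP => by rw [hqb1]; exact hinter P hP hZP
  · exact fun P hP hqP => by
      have h1 := hqP.2.1; have h2 := fst_nonneg_of_inDiamond (hU.2 P hP b); rw [hqb1] at h1; exact absurd h1 (by omega)
  · exact fun P hP hnb _ => by
      have h1 := hnb.1; have h2 := fst_nonneg_of_inDiamond (hU.2 P hP a); rw [hZa1] at h1; exact absurd h1 (by omega)
  · intro P hP hPg hul
    refine ⟨fun h3b => ?_, fun h3d => not_spacelike_of_inDiamond (hU.2 P hP a) (by rw [ha] at h3d; exact h3d.2)⟩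
    have hNa1 : (Z.perm (Equiv.swap a b) a).1 = c := by rw [eNa, floorLetter_fst]
    obtain ⟨c', hc'⟩ : ∃ c', c' = (P a).1 := ⟨_, rfl⟩
    have hc'1 : 1 ≤ c' := by have := h3b.1; omega
    have hc'c : c' ≤ c := by have := h3b.2.1; omega
    have hPa : P a = floorLetter ψ c' := by
      have e := h3b.2.2; rw [hZa1, sub_zero, ha, ← hc'] at e; exact e
    have hPb1 : (P b).1 = 0 := by have := hul.1; have := fst_nonneg_of_inDiamond (hU.2 P hP b); omega
    have hPb : P b = (0, 0, 0) := by
      have e := hul.2; rw [hqb1, hPb1, show ((0:ℤ) - 0) = 0 by norm_num, ray_zero] at e; rw [← e, hqb]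
    exact hno ⟨P, hP, c', hc'1, hc'c, fun g hga hgb => hPg g hgb hga, hPa, hPb⟩

/-- **N-STEP: THE ORIGIN PIN LOWERS THE FREE LETTER** (RULE D on E₋, A2I⁻, `S₄`): if every present `P`-cell `{O, L, W′, X}` has `W′ = O`, then so
does every present `N`-cell `{O, L, W, X}` (the floor pin serves `W ≠ O` below onto `O`, and the origin interface + `(0 2)` give `{O, L, c′ℓ_r, X} ∈ E₊`). -/
theorem originPin_lower_step {h : ℤ} {C : MConfig} (hU : C.InDiamond h) (hDN : ∀ Z ∈ C.lower, RuleDMu4N C Z) (hA : A2IMinusClosed C)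
    (hGl : PermClosed C.lower) (hGu : PermClosed C.upper) {N : MCell} (hN : N ∈ C.lower) (h0 : N 0 = (0, 0, 0)) (h2 : N 2 ≠ (0, 0, 0))
    (hP : ∀ P ∈ C.upper, P 0 = (0, 0, 0) → P 1 = N 1 → P 3 = N 3 → P 2 = (0, 0, 0)) : False := by
  obtain ⟨k, hk, hk0⟩ := exists_frame_ne_zero (hU.1 N hN 2).1 h2
  have hfl : OnFloor (N 0) := by rw [h0]; simp [OnFloor, absCharge, chargeOf]
  obtain ⟨r, P, hPu, hNP⟩ := servedBelow_floor_apex hU hN (hDN N hN) (i := 0) (g := 2) (by decide) hfl hk hk0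
  have hP0 : P 0 = (0, 0, 0) := (hNP.1 0 (by decide)).trans h0
  have hW' : P 2 = (0, 0, 0) := hP P hPu hP0 (hNP.1 1 (by decide)) (hNP.1 3 (by decide))
  obtain ⟨d, hdd⟩ : ∃ d, d = (N 2).1 - (P 2).1 := ⟨_, rfl⟩
  have hd : 1 ≤ d := by have := hNP.2.1; omega
  have hN2 : N 2 = floorLetter r d := by have e := hNP.2.2; rw [← hdd, hW'] at e; exact e
  obtain ⟨P', hP', c', hc1, -, hagree, hP'0, hP'2⟩ := a2i_origin_floor_interface hU hA hGl hN (a := 0) (b := 2) (by decide) h0 hN2 hd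
    hPu hNP.1 hW' (fun Q hQ hNQ => by rw [hP Q hQ ((hNQ.1 0 (by decide)).trans h0) (hNQ.1 1 (by decide)) (hNQ.1 3 (by decide))])
  have e := hP _ (hGu (Equiv.swap 0 2) P' hP') (by show P' (Equiv.swap (0 : Fin 4) 2 0) = _; simpa using hP'2)
    (by show P' (Equiv.swap (0 : Fin 4) 2 1) = _; simpa [Equiv.swap_apply_of_ne_of_ne] using hagree 1 (by decide) (by decide))
    (by show P' (Equiv.swap (0 : Fin 4) 2 3) = _; simpa [Equiv.swap_apply_of_ne_of_ne] using hagree 3 (by decide) (by decide))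
  have e' : P' 0 = (0, 0, 0) := by have e2 : P' (Equiv.swap (0 : Fin 4) 2 2) = (0, 0, 0) := e; simpa using e2
  have := congrArg Prod.fst e'
  rw [hP'0, floorLetter_fst] at this
  simp at this; omega

/-- **P-STEP: THE APEX PIN RAISES THE NODE-2 LETTER TO THE CEILING, WHERE THE X⁺ FORK FIRES** (`h = 2μ`; RULE D both levels, X⁺): `P = {O, L(m), W, hI}`
(`m ≠ 0`, `−1 ≤ m ≤ μ − 2`, ANY `W`) is absent provided the servers `{O, L(m′), W, hI} ∈ E₋`, `m < m′ ≤ μ − 2`, are (`ih`). -/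
theorem towerP_step {h μ m : ℤ} {C : MConfig} (hU : C.InDiamond h) (hDN : ∀ Z ∈ C.lower, RuleDMu4N C Z)
    (hDP : ∀ P ∈ C.upper, RuleDMu4P C P) (hX : XPlusClosed C) (hh : h = 2 * μ) (hμ : 2 ≤ μ) (hm0 : m ≠ 0) (hm1 : -1 ≤ m)
    (hmμ : m ≤ μ - 2) {P : MCell} {v : Fin 4}
    (ih : ∀ m', m < m' → m' ≤ μ - 2 → ∀ X ∈ C.lower, X 0 = (0, 0, 0) → X 1 = nodeTwoLetter v m' → X 2 = P 2 → X 3 = (h, 0, 0) → False)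
    (h0 : P 0 = (0, 0, 0)) (h1 : P 1 = nodeTwoLetter v m) (h3 : P 3 = (h, 0, 0)) : P ∉ C.upper := fun hP => by
  have hna : ¬ isApex (P 1) := by rw [h1]; exact nodeTwoLetter_not_isApex v hm0
  have hk : Adapted (P 1) v := by rw [h1]; exact (nodeTwoLetter_top v m).1
  have hkh : coord (P 1) v ≠ h := by rw [h1, (nodeTwoLetter_top v m).2]; omega
  have hP1 : (P 1).1 = 2 + m := by rw [h1, nodeTwoLetter_fst]
  -- every `v`-server `X` of `P` at slot 1 is `P(1 ↦ L(m+e))`, `m + e ≤ μ − 1`; by `ih` it is the TOP one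
  have server : ∀ X ∈ C.lower, UPartner X P 1 v → (X 1).1 = μ + 1 ∧ X 1 = nodeTwoLetter v (μ - 1) := fun X hXl hXP => by
    obtain ⟨e, he⟩ : ∃ e, e = (X 1).1 - (P 1).1 := ⟨_, rfl⟩
    have he0 : 0 < e := by have := hXP.2.1; omega
    have hX1 : X 1 = ray ((2, 0, 0) : BPoint) v (m + e) := by rw [hXP.2.2, ← he, h1]; exact (ray_add _ v m e).symm
    have htop := (hU.1 X hXl 1).2.2.2
    rw [hX1, top_ray_apex 2 v (by omega)] at htop
    by_cases hlt : m + e ≤ μ - 2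
    · exact (ih (m + e) (by omega) hlt X hXl ((hXP.1 0 (by decide)).symm.trans h0) hX1 (hXP.1 2 (by decide)).symm
        ((hXP.1 3 (by decide)).symm.trans h3)).elim
    · have hme : m + e = μ - 1 := by omega
      rw [hme] at hX1
      exact ⟨by rw [hX1]; show (2 : ℤ) + (μ - 1) = μ + 1; ring, hX1⟩
  obtain ⟨N, hN, hNP⟩ := upLine_of_ruleDMu4P hU hP (hDP P hP) (g := 3) (j := 1) (by decide) (by rw [h3]; exact onCeiling_apex h) hna hk hkh
  obtain ⟨hN1, hN1'⟩ := server N hN hNP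
  have hN0 : N 0 = (0, 0, 0) := (hNP.1 0 (by decide)).symm.trans h0
  have hN3 : N 3 = (h, 0, 0) := (hNP.1 3 (by decide)).symm.trans h3
  -- RULE D at the top server (pins `O`, `L(μ−1)`): the descent `Q = N(1 ↦ μ·ℓ_v) ∈ E₊` on the ceiling line
  have hN0' : N 0 = floorLetter v 0 := hN0.trans (ray_zero _ v).symm
  obtain ⟨Q, hQ, hNQ, hQ1⟩ := descent_of_floorNode_nodeTwo hU le_rfl (by omega : (1 : ℤ) ≤ μ - 1) (hDN N hN) (b := 0) (c := 1)
    (by decide) hN0' hN1'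
  have hQ1f : (Q 1).1 = μ := by rw [hQ1, floorLetter_fst]; ring
  have hQc : OnCeiling h (Q 1) := by
    rw [hQ1]; show (ray ((0, 0, 0) : BPoint) v (μ - 1 + 1)).1 + absCharge (ray ((0, 0, 0) : BPoint) v (μ - 1 + 1)) = h
    rw [top_ray_apex 0 v (by omega)]; omega
  have hzI : N 1 = ray ((h, 0, 0) : BPoint) (v + 2) (-(μ - 1)) := by
    rw [hN1', show nodeTwoLetter v (μ - 1) = ray ((2, 0, 0) : BPoint) v (μ - 1) from rfl, ray_apex_flip,
      show (2 : ℤ) + 2 * (μ - 1) = h by omega]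
  have hwI : Q 1 = ray ((h, 0, 0) : BPoint) (v + 2) (-μ) := by
    rw [hQ1, show floorLetter v (μ - 1 + 1) = ray ((0, 0, 0) : BPoint) v μ by rw [sub_add_cancel], ray_apex_flip,
      show (0 : ℤ) + 2 * μ = h by omega]
  have hs0 : 0 < μ - 1 - m := by omega
  have hyz : P 1 = ray (N 1) (v + 2 + 2) (-(μ - 1 - m)) := by
    rw [fin4_add_two_add_two, show -(μ - 1 - m) = -((N 1).1 - (P 1).1) by rw [hN1, hP1]; ring]
    exact eq_ray_neg hNP.2.2
  refine xplus_fork hU hX hN (g := 1) (f := 3) (by decide) hN3 hP hQ (r₁ := v) (r₂ := v + 2) (fin4_ne_add_two v).symm hNP hNQ hna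
    (fun X hXl hXP => by have := (server X hXl hXP).1; omega) (fun X _ _ hlt hlt2 _ => by omega) (fun X hXl _ _ hE hnT => ?_)
  have hxc : OnCeiling h (X 1) := onCeiling_of_effective_above hQc (hU.2 Q hQ 1).1 (hU.1 X hXl 1) hE
  obtain ⟨d₂, -, -, hxd⟩ := ceiling_effective_sameRay (by omega : (0 : ℤ) < μ) hwI hxc (hU.1 X hXl 1).1 hE
  exact fork_effective hs0 hzI hyz hxd hnT

/-- the two levels of the tower at once, by downward induction on `μ − 2 − m`. -/
theorem tower_aux {h μ : ℤ} {C : MConfig} (hU : C.InDiamond h) (hDN : ∀ Z ∈ C.lower, RuleDMu4N C Z)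
    (hDP : ∀ P ∈ C.upper, RuleDMu4P C P) (hX : XPlusClosed C) (hA : A2IMinusClosed C) (hGl : PermClosed C.lower)
    (hGu : PermClosed C.upper) (hh : h = 2 * μ) (v : Fin 4) :
    ∀ n : ℕ, ∀ m : ℤ, μ - 2 - m ≤ n → 1 ≤ m → m ≤ μ - 2 →
      (∀ P ∈ C.upper, P 0 = (0, 0, 0) → P 1 = nodeTwoLetter v m → P 3 = (h, 0, 0) → P 2 ≠ (0, 0, 0) → False) ∧
      (∀ N ∈ C.lower, N 0 = (0, 0, 0) → N 1 = nodeTwoLetter v m → N 3 = (h, 0, 0) → N 2 ≠ (0, 0, 0) → False) := by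
  -- one level, given the `N`-claim at every higher level `≤ μ − 2`
  have level : ∀ m : ℤ, 1 ≤ m → m ≤ μ - 2 →
      (∀ m', m < m' → m' ≤ μ - 2 → ∀ X ∈ C.lower, X 0 = (0, 0, 0) → X 1 = nodeTwoLetter v m' → X 3 = (h, 0, 0) → X 2 ≠ (0, 0, 0) → False) →
      (∀ P ∈ C.upper, P 0 = (0, 0, 0) → P 1 = nodeTwoLetter v m → P 3 = (h, 0, 0) → P 2 ≠ (0, 0, 0) → False) ∧
      (∀ N ∈ C.lower, N 0 = (0, 0, 0) → N 1 = nodeTwoLetter v m → N 3 = (h, 0, 0) → N 2 ≠ (0, 0, 0) → False) := by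
    intro m hm1 hmμ ihN
    have hPA : ∀ P ∈ C.upper, P 0 = (0, 0, 0) → P 1 = nodeTwoLetter v m → P 3 = (h, 0, 0) → P 2 ≠ (0, 0, 0) → False :=
      fun P hP h0 h1 h3 h2 => towerP_step hU hDN hDP hX hh (by omega) (by omega) (by omega) hmμ
        (fun m' hlt hle X hXl hX0 hX1 hX2 hX3 => ihN m' hlt hle X hXl hX0 hX1 hX3 (by rw [hX2]; exact h2)) h0 h1 h3 hP
    exact ⟨hPA, fun N hN h0 h1 h3 h2 => originPin_lower_step hU hDN hA hGl hGu hN h0 h2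
      (fun P hP hP0 hP1 hP3 => by_contra fun hP2 => hPA P hP hP0 (hP1.trans h1) (hP3.trans h3) hP2)⟩
  intro n
  induction n with
  | zero => intro m hn hm1 hmμ; exact level m hm1 hmμ (fun m' hlt hle => absurd hle (by omega))
  | succ n ih => intro m hn hm1 hmμ; exact level m hm1 hmμ (fun m' hlt hle => (ih m' (by omega) (by omega) hle).2)

/-- **T1 (level `P`).** `P{O, 2I + m·ℓ_v, W, hI} ∉ C.upper` for `1 ≤ m ≤ μ − 2` (`h = 2μ`) and EVERY fourth letter `W ≠ O` [◇_h, RULE D, X⁺, A2I⁻,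
`S₄` on E₋ and E₊].  Census: peel rounds 2 – 3, 0 survivors. -/
theorem towerP_absent {h μ m : ℤ} {C : MConfig} (hU : C.InDiamond h) (hDN : ∀ Z ∈ C.lower, RuleDMu4N C Z)
    (hDP : ∀ P ∈ C.upper, RuleDMu4P C P) (hX : XPlusClosed C) (hA : A2IMinusClosed C) (hGl : PermClosed C.lower)
    (hGu : PermClosed C.upper) (hh : h = 2 * μ) (hm1 : 1 ≤ m) (hmμ : m ≤ μ - 2) {P : MCell} {v : Fin 4} (h0 : P 0 = (0, 0, 0))
    (h1 : P 1 = nodeTwoLetter v m) (h2 : P 2 ≠ (0, 0, 0)) (h3 : P 3 = (h, 0, 0)) : P ∉ C.upper := fun hP =>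
  (tower_aux hU hDN hDP hX hA hGl hGu hh v (μ - 2 - m).toNat m (Int.self_le_toNat _) hm1 hmμ).1 P hP h0 h1 h3 h2

/-- **T1 (level `N`).** `N{O, 2I + m·ℓ_v, W, hI} ∉ C.lower` for `1 ≤ m ≤ μ − 2` (`h = 2μ`) and EVERY `W ≠ O` [same].
Census: peel rounds 2 – 5 (the top level `m = μ − 2` was famC ∕ famD of g19), 0 survivors. -/
theorem towerN_absent {h μ m : ℤ} {C : MConfig} (hU : C.InDiamond h) (hDN : ∀ Z ∈ C.lower, RuleDMu4N C Z)
    (hDP : ∀ P ∈ C.upper, RuleDMu4P C P) (hX : XPlusClosed C) (hA : A2IMinusClosed C) (hGl : PermClosed C.lower)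
    (hGu : PermClosed C.upper) (hh : h = 2 * μ) (hm1 : 1 ≤ m) (hmμ : m ≤ μ - 2) {N : MCell} {v : Fin 4} (h0 : N 0 = (0, 0, 0))
    (h1 : N 1 = nodeTwoLetter v m) (h2 : N 2 ≠ (0, 0, 0)) (h3 : N 3 = (h, 0, 0)) : N ∉ C.lower := fun hN =>
  (tower_aux hU hDN hDP hX hA hGl hGu hh v (μ - 2 - m).toNat m (Int.self_le_toNat _) hm1 hmμ).2 N hN h0 h1 h3 h2

/-- **(R0)** relative to a present `P₁ = P{O, ℓ_φ, cu_χ, hI}` the apex row `N{O, 2I, cu_χ, hI}` is absent [RULE D, X⁺, `Δ` on E₊]: the floor pin lowers `2I`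
off the frame `φ` onto `ℓ_ψ`, and the `Δ`-rotate of that child is a second child of the lift of `P₁` (`apexCeilingUnit_absent_of_secondChild`). -/
theorem apexTwoCeilingUnit_N_rel {h : ℤ} {C : MConfig} (hU : C.InDiamond h) (hDN : ∀ Z ∈ C.lower, RuleDMu4N C Z)
    (hDP : ∀ P ∈ C.upper, RuleDMu4P C P) (hX : XPlusClosed C) (hΔu : DeltaClosed C.upper) {P₁ : MCell} (hP₁ : P₁ ∈ C.upper)
    {φ χ : Fin 4} (h0 : P₁ 0 = (0, 0, 0)) (h1 : P₁ 1 = floorUnit φ) (h2 : P₁ 2 = ceilingUnit h χ) (h3 : P₁ 3 = (h, 0, 0))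
    {X : MCell} (hXl : X ∈ C.lower) (hX0 : X 0 = (0, 0, 0)) (hX1 : X 1 = (2, 0, 0)) (hX2 : X 2 = ceilingUnit h χ)
    (hX3 : X 3 = (h, 0, 0)) : False := by
  have hfl : OnFloor (X 0) := by rw [hX0]; simp [OnFloor, absCharge, chargeOf]
  obtain ⟨r, hr, P, hP, hXP⟩ := servedBelow_floor_dir hU hXl (hDN X hXl) (i := 0) (g := 1) (by decide) hfl (k := φ)
    (by rw [hX1]; exact adapted_apexTwo φ) (by rw [hX1, coord_apexTwo]; decide)
  have hd : 0 < (X 1).1 - (P 1).1 := by have := hXP.2.1; omega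
  have hP1 : P 1 = floorUnit (r + 2) := apexTwo_downRay (hU.2 P hP 1) hd (by rw [← hX1]; exact hXP.2.2)
  have hψ : r + 2 ≠ φ := fun e => hr (by rw [← e, fin4_add_two_add_two])
  have hP0 : P 0 = (0, 0, 0) := (hXP.1 0 (by decide)).trans hX0
  have hP2 : P 2 = ceilingUnit h χ := (hXP.1 2 (by decide)).trans hX2
  have hP3 : P 3 = (h, 0, 0) := (hXP.1 3 (by decide)).trans hX3
  have child : ∀ Q ∈ C.upper, Q 0 = (0, 0, 0) → Q 1 = floorUnit φ → (∃ χ', χ' ≠ χ ∧ Q 2 = ceilingUnit h χ') → Q 3 = (h, 0, 0) → False :=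
    fun Q hQ hQ0 hQ1 ⟨χ', hχ', hQ2⟩ hQ3 =>
      apexCeilingUnit_absent_of_secondChild hU hDP hX (Z := P₁) (Z' := Q) (d := 2) (f := 3) (by decide) hχ' h2 h3 (fun _ => hQ)
        (fun j hj => by
          fin_cases j
          · simpa using hQ0.trans h0.symm
          · simpa using hQ1.trans h1.symm
          · exact absurd rfl hj
          · simpa using hQ3.trans h3.symm) hQ2 hP₁
  have d1 : ∀ Q : MCell, ∀ f, Q.delta f = deltaPt (Q f) := fun Q f => rfl
  rcases deltaPt_align 0 1 φ (r + 2) with e | e | e | e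
  · exact hψ (floorUnit_inj e).symm
  · refine child P.delta (hΔu P hP) ?_ ?_ ⟨χ + 3, fin4_add3_ne χ, ?_⟩ ?_
    · rw [d1, hP0, deltaPt_apex]
    · rw [d1, hP1]; exact e.symm
    · rw [d1, hP2, deltaPt_ceilingUnit]
    · rw [d1, hP3, deltaPt_apex]
  · refine child P.delta.delta (hΔu _ (hΔu P hP)) ?_ ?_ ⟨χ + 3 + 3, fin4_add33_ne χ, ?_⟩ ?_
    · rw [d1, d1, hP0, deltaPt_apex, deltaPt_apex]
    · rw [d1, d1, hP1]; exact e.symm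
    · rw [d1, d1, hP2, deltaPt_ceilingUnit, deltaPt_ceilingUnit]
    · rw [d1, d1, hP3, deltaPt_apex, deltaPt_apex]
  · refine child P.delta.delta.delta (hΔu _ (hΔu _ (hΔu P hP))) ?_ ?_ ⟨χ + 3 + 3 + 3, fin4_add333_ne χ, ?_⟩ ?_
    · rw [d1, d1, d1, hP0, deltaPt_apex, deltaPt_apex, deltaPt_apex]
    · rw [d1, d1, d1, hP1]; exact e.symm
    · rw [d1, d1, d1, hP2, deltaPt_ceilingUnit, deltaPt_ceilingUnit, deltaPt_ceilingUnit]
    · rw [d1, d1, d1, hP3, deltaPt_apex, deltaPt_apex, deltaPt_apex]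

theorem ceilingUnit_ne_origin {h : ℤ} (hh : 2 ≤ h) (χ : Fin 4) : ceilingUnit h χ ≠ (0, 0, 0) := fun e => by
  have := congrArg Prod.fst e; rw [ceilingUnit_fst] at this; simp at this; omega

/-- **OPA.** `P{O, ℓ_φ, cu_χ, hI} ∉ C.upper` for ALL `φ, χ` [◇_h, RULE D, X⁺, A2I⁻, `S₄` on E₋ and E₊, `Δ` on E₊; every `h`]: the P-step at level
`m = −1` of the tower of phase `v = φ + 2`; servers: the apex row (R0) and the tower's `N`-cells (T1).  Census: ◇₈ round 3, ◇₁₀ round 5, 0 survivors. -/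
theorem originUnitCeilingUnitApex_P_absent {h : ℤ} {C : MConfig} (hU : C.InDiamond h) (hDN : ∀ Z ∈ C.lower, RuleDMu4N C Z)
    (hDP : ∀ P ∈ C.upper, RuleDMu4P C P) (hX : XPlusClosed C) (hA : A2IMinusClosed C) (hGl : PermClosed C.lower)
    (hGu : PermClosed C.upper) (hΔu : DeltaClosed C.upper) {P : MCell} {φ χ : Fin 4} (h0 : P 0 = (0, 0, 0)) (h1 : P 1 = floorUnit φ)
    (h2 : P 2 = ceilingUnit h χ) (h3 : P 3 = (h, 0, 0)) : P ∉ C.upper := fun hP => by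
  obtain ⟨μ, hμ⟩ : ∃ μ, h = 2 * μ := ⟨h / 2, by
    have := (hU.2 P hP 3).2.2.1; rw [h3] at this; simp [absCharge, chargeOf] at this; omega⟩
  have h2h : (2 : ℤ) ≤ h := by
    have := (hU.2 P hP 1).2.2.2; rw [h1, show floorUnit φ = ray ((0, 0, 0) : BPoint) φ 1 from rfl, top_ray_apex 0 φ zero_le_one] at this
    omega
  have h1' : P 1 = nodeTwoLetter (φ + 2) (-1) := by
    rw [h1]; show ray ((0, 0, 0) : BPoint) φ 1 = ray ((2, 0, 0) : BPoint) (φ + 2) (-1); rw [ray_apex_flip]; norm_num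
  by_cases hμ1 : μ = 1
  · -- ◇₂: the only server of `ℓ_φ` along `v = φ + 2` is the apex row `N{O, 2I, cu_χ, hI}` of (R0)
    have hna : ¬ isApex (P 1) := by rw [h1']; exact nodeTwoLetter_not_isApex (φ + 2) (by decide)
    have hk : Adapted (P 1) (φ + 2) := by rw [h1']; exact (nodeTwoLetter_top (φ + 2) (-1)).1
    have hkh : coord (P 1) (φ + 2) ≠ h := by rw [h1', (nodeTwoLetter_top (φ + 2) (-1)).2]; omega
    obtain ⟨N, hN, hNP⟩ := upLine_of_ruleDMu4P hU hP (hDP P hP) (g := 3) (j := 1) (by decide) (by rw [h3]; exact onCeiling_apex h)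
      hna hk hkh
    obtain ⟨e, he⟩ : ∃ e, e = (N 1).1 - (P 1).1 := ⟨_, rfl⟩
    have he0 : 0 < e := by have := hNP.2.1; omega
    have hN1 : N 1 = ray ((2, 0, 0) : BPoint) (φ + 2) (-1 + e) := by rw [hNP.2.2, ← he, h1']; exact (ray_add _ _ _ _).symm
    have htop := (hU.1 N hN 1).2.2.2
    rw [hN1, top_ray_apex 2 (φ + 2) (by omega)] at htop
    rw [show -1 + e = 0 by omega, ray_zero] at hN1
    exact apexTwoCeilingUnit_N_rel hU hDN hDP hX hΔu hP h0 h1 h2 h3 hN ((hNP.1 0 (by decide)).symm.trans h0) hN1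
      ((hNP.1 2 (by decide)).symm.trans h2) ((hNP.1 3 (by decide)).symm.trans h3)
  refine towerP_step hU hDN hDP hX hμ (by omega) (m := -1) (by decide) le_rfl (by omega) (v := φ + 2)
    (fun m' hm' hm'μ X hXl hX0 hX1 hX2 hX3 => ?_) h0 h1' h3 hP
  rw [h2] at hX2
  rcases (show m' = 0 ∨ 1 ≤ m' by omega) with rfl | hm'1
  · exact apexTwoCeilingUnit_N_rel hU hDN hDP hX hΔu hP h0 h1 h2 h3 hXl hX0 (hX1.trans (ray_zero _ _)) hX2 hX3
  · exact towerN_absent hU hDN hDP hX hA hGl hGu hμ hm'1 hm'μ hX0 hX1 (by rw [hX2]; exact ceilingUnit_ne_origin h2h χ) hX3 hXl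

/-- **F2⁺.** `P{O, ℓ_φ, X, cu_χ} ∉ C.upper` for EVERY fourth letter `X` (F2 + OPA after `(2 3)`). -/
theorem originUnitFree_P_absent' {h : ℤ} {C : MConfig} (hU : C.InDiamond h) (hDN : ∀ Z ∈ C.lower, RuleDMu4N C Z)
    (hDP : ∀ P ∈ C.upper, RuleDMu4P C P) (hX : XPlusClosed C) (hA : A2IMinusClosed C) (hGl : PermClosed C.lower)
    (hGu : PermClosed C.upper) (hΔu : DeltaClosed C.upper) {P : MCell} {φ χ : Fin 4} (h0 : P 0 = (0, 0, 0)) (h1 : P 1 = floorUnit φ)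
    (h3 : P 3 = ceilingUnit h χ) : P ∉ C.upper := fun hP => by
  by_cases h2 : P 2 = (h, 0, 0)
  · exact originUnitCeilingUnitApex_P_absent hU hDN hDP hX hA hGl hGu hΔu (P := P.perm (Equiv.swap 2 3)) (φ := φ) (χ := χ)
      (by show P (Equiv.swap (2 : Fin 4) 3 0) = _; simpa [Equiv.swap_apply_of_ne_of_ne] using h0)
      (by show P (Equiv.swap (2 : Fin 4) 3 1) = _; simpa [Equiv.swap_apply_of_ne_of_ne] using h1)
      (by show P (Equiv.swap (2 : Fin 4) 3 2) = _; simpa using h3)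
      (by show P (Equiv.swap (2 : Fin 4) 3 3) = _; simpa using h2) (hGu _ P hP)
  · exact originUnitFree_P_absent hU hDN hDP hX hA hGl hΔu h2 h0 h1 h3 hP

/-! ## §1 T2: the floor-pinned node-2 tower `{c·ℓ_φ, 2I + m·ℓ_v, W, hI}`, `c ≥ 1`, every `W` (control g22) -/

/-- **P-STEP WITH A FLOOR-LETTER PIN** (= `CeilingTower.towerP_step` with the origin pin replaced by ANY floor letter `F = c·ℓ_φ`, `c ≥ 0`):
`P = {F, L(m), W, hI}` (`m ≠ 0`, `−1 ≤ m ≤ μ − 2`, ANY `W`) is absent provided the servers `{F, L(m′), W, hI} ∈ E₋`, `m < m′ ≤ μ − 2`, are (`ih`):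
the apex pin raises `L(m)` along `v` (`upLine_of_ruleDMu4P`) to the top server, RULE D there (`descent_of_floorNode_nodeTwo`) gives
`P♭ = {F, μ·ℓ_v, W, hI} ∈ E₊`, and the X⁺ fork at `L(μ−1)` fires (`xplus_fork`). -/
theorem floorPin_towerP_step {h μ m : ℤ} {C : MConfig} (hU : C.InDiamond h) (hDN : ∀ Z ∈ C.lower, RuleDMu4N C Z)
    (hDP : ∀ P ∈ C.upper, RuleDMu4P C P) (hX : XPlusClosed C) (hh : h = 2 * μ) (hμ : 2 ≤ μ) (hm0 : m ≠ 0) (hm1 : -1 ≤ m)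
    (hmμ : m ≤ μ - 2) {P : MCell} {v φ : Fin 4} {c : ℤ} (hc : 0 ≤ c)
    (ih : ∀ m', m < m' → m' ≤ μ - 2 → ∀ X ∈ C.lower, X 0 = floorLetter φ c → X 1 = nodeTwoLetter v m' → X 2 = P 2 → X 3 = (h, 0, 0) → False)
    (h0 : P 0 = floorLetter φ c) (h1 : P 1 = nodeTwoLetter v m) (h3 : P 3 = (h, 0, 0)) : P ∉ C.upper := fun hP => by
  have hna : ¬ isApex (P 1) := by rw [h1]; exact nodeTwoLetter_not_isApex v hm0
  have hk : Adapted (P 1) v := by rw [h1]; exact (nodeTwoLetter_top v m).1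
  have hkh : coord (P 1) v ≠ h := by rw [h1, (nodeTwoLetter_top v m).2]; omega
  have hP1 : (P 1).1 = 2 + m := by rw [h1, nodeTwoLetter_fst]
  -- every `v`-server `X` of `P` at slot 1 is `P(1 ↦ L(m+e))`, `m + e ≤ μ − 1`; by `ih` it is the TOP one
  have server : ∀ X ∈ C.lower, UPartner X P 1 v → (X 1).1 = μ + 1 ∧ X 1 = nodeTwoLetter v (μ - 1) := fun X hXl hXP => by
    obtain ⟨e, he⟩ : ∃ e, e = (X 1).1 - (P 1).1 := ⟨_, rfl⟩
    have he0 : 0 < e := by have := hXP.2.1; omega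
    have hX1 : X 1 = ray ((2, 0, 0) : BPoint) v (m + e) := by rw [hXP.2.2, ← he, h1]; exact (ray_add _ v m e).symm
    have htop := (hU.1 X hXl 1).2.2.2
    rw [hX1, top_ray_apex 2 v (by omega)] at htop
    by_cases hlt : m + e ≤ μ - 2
    · exact (ih (m + e) (by omega) hlt X hXl ((hXP.1 0 (by decide)).symm.trans h0) hX1 (hXP.1 2 (by decide)).symm
        ((hXP.1 3 (by decide)).symm.trans h3)).elim
    · have hme : m + e = μ - 1 := by omega
      rw [hme] at hX1
      exact ⟨by rw [hX1]; show (2 : ℤ) + (μ - 1) = μ + 1; ring, hX1⟩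
  obtain ⟨N, hN, hNP⟩ := upLine_of_ruleDMu4P hU hP (hDP P hP) (g := 3) (j := 1) (by decide) (by rw [h3]; exact onCeiling_apex h) hna hk hkh
  obtain ⟨hN1, hN1'⟩ := server N hN hNP
  have hN0 : N 0 = floorLetter φ c := (hNP.1 0 (by decide)).symm.trans h0
  have hN3 : N 3 = (h, 0, 0) := (hNP.1 3 (by decide)).symm.trans h3
  -- RULE D at the top server (pins `F`, `L(μ−1)`): the descent `Q = N(1 ↦ μ·ℓ_v) ∈ E₊` on the ceiling line
  obtain ⟨Q, hQ, hNQ, hQ1⟩ := descent_of_floorNode_nodeTwo hU hc (by omega : (1 : ℤ) ≤ μ - 1) (hDN N hN) (b := 0) (c := 1)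
    (by decide) hN0 hN1'
  have hQ1f : (Q 1).1 = μ := by rw [hQ1, floorLetter_fst]; ring
  have hQc : OnCeiling h (Q 1) := by
    rw [hQ1]; show (ray ((0, 0, 0) : BPoint) v (μ - 1 + 1)).1 + absCharge (ray ((0, 0, 0) : BPoint) v (μ - 1 + 1)) = h
    rw [top_ray_apex 0 v (by omega)]; omega
  have hzI : N 1 = ray ((h, 0, 0) : BPoint) (v + 2) (-(μ - 1)) := by
    rw [hN1', show nodeTwoLetter v (μ - 1) = ray ((2, 0, 0) : BPoint) v (μ - 1) from rfl, ray_apex_flip,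
      show (2 : ℤ) + 2 * (μ - 1) = h by omega]
  have hwI : Q 1 = ray ((h, 0, 0) : BPoint) (v + 2) (-μ) := by
    rw [hQ1, show floorLetter v (μ - 1 + 1) = ray ((0, 0, 0) : BPoint) v μ by rw [sub_add_cancel], ray_apex_flip,
      show (0 : ℤ) + 2 * μ = h by omega]
  have hs0 : 0 < μ - 1 - m := by omega
  have hyz : P 1 = ray (N 1) (v + 2 + 2) (-(μ - 1 - m)) := by
    rw [fin4_add_two_add_two, show -(μ - 1 - m) = -((N 1).1 - (P 1).1) by rw [hN1, hP1]; ring]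
    exact eq_ray_neg hNP.2.2
  refine xplus_fork hU hX hN (g := 1) (f := 3) (by decide) hN3 hP hQ (r₁ := v) (r₂ := v + 2) (fin4_ne_add_two v).symm hNP hNQ hna
    (fun X hXl hXP => by have := (server X hXl hXP).1; omega) (fun X _ _ hlt hlt2 _ => by omega) (fun X hXl _ _ hE hnT => ?_)
  have hxc : OnCeiling h (X 1) := onCeiling_of_effective_above hQc (hU.2 Q hQ 1).1 (hU.1 X hXl 1) hE
  obtain ⟨d₂, -, -, hxd⟩ := ceiling_effective_sameRay (by omega : (0 : ℤ) < μ) hwI hxc (hU.1 X hXl 1).1 hE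
  exact fork_effective hs0 hzI hyz hxd hnT


/-- **N-STEP WITH A CHARGED FLOOR-LETTER PIN** (RULE D on E₋): a present `N`-cell with a floor-letter pin at slot `0` (`OnFloor`) and a letter
`W ≠ O` at slot `2` has a child `N(2 ↦ W′) ∈ E₊` (`servedBelow_floor_apex`); so if every `P`-cell `{F, N 1, W′, N 3}` is absent, so is `N`.
(For the origin pin the child `W′ = O` escapes and A2I⁻ is needed: `CeilingTower.originPin_lower_step`.) -/
theorem floorPin_lower_step {h : ℤ} {C : MConfig} (hU : C.InDiamond h) (hDN : ∀ Z ∈ C.lower, RuleDMu4N C Z) {N : MCell} (hN : N ∈ C.lower)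
    (h0 : OnFloor (N 0)) (h2 : N 2 ≠ (0, 0, 0)) (hP : ∀ P ∈ C.upper, P 0 = N 0 → P 1 = N 1 → P 3 = N 3 → False) : False := by
  obtain ⟨k, hk, hk0⟩ := exists_frame_ne_zero (hU.1 N hN 2).1 h2
  obtain ⟨r, P, hPu, hNP⟩ := servedBelow_floor_apex hU hN (hDN N hN) (i := 0) (g := 2) (by decide) h0 hk hk0
  exact hP P hPu (hNP.1 0 (by decide)) (hNP.1 1 (by decide)) (hNP.1 3 (by decide))

theorem onFloor_floorLetter (φ : Fin 4) {c : ℤ} (hc : 0 ≤ c) : OnFloor (floorLetter φ c) := by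
  fin_cases φ <;> simp [OnFloor, absCharge, chargeOf, ray, abs_of_nonneg hc]

theorem floorLetter_ne_origin (φ : Fin 4) {c : ℤ} (hc : c ≠ 0) : floorLetter φ c ≠ (0, 0, 0) := fun e => by
  have := congrArg Prod.fst e; rw [floorLetter_fst] at this; exact hc this

/-- both levels of the CHARGED-floor-pin tower at once (`c ≥ 1`, all phases, all `W`), by induction on `μ − 2 − m`; the `W = O` cells are T1 after (0 2). -/
theorem floorPinTower_aux {h μ : ℤ} {C : MConfig} (hU : C.InDiamond h) (hDN : ∀ Z ∈ C.lower, RuleDMu4N C Z)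
    (hDP : ∀ P ∈ C.upper, RuleDMu4P C P) (hX : XPlusClosed C) (hA : A2IMinusClosed C) (hGl : PermClosed C.lower)
    (hGu : PermClosed C.upper) (hh : h = 2 * μ) :
    ∀ n : ℕ, ∀ m : ℤ, μ - 2 - m ≤ n → 1 ≤ m → m ≤ μ - 2 →
      (∀ (φ v : Fin 4) (c : ℤ), 1 ≤ c → ∀ P ∈ C.upper, P 0 = floorLetter φ c → P 1 = nodeTwoLetter v m → P 3 = (h, 0, 0) → False) ∧
      (∀ (φ v : Fin 4) (c : ℤ), 1 ≤ c → ∀ N ∈ C.lower, N 0 = floorLetter φ c → N 1 = nodeTwoLetter v m → N 3 = (h, 0, 0) → False) := by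
  -- the `W = O` cells of both levels are T1 after `(0 2)`
  have hWO : ∀ m : ℤ, 1 ≤ m → m ≤ μ - 2 → ∀ (φ v : Fin 4) (c : ℤ), 1 ≤ c → ∀ X : MCell, X 0 = floorLetter φ c → X 1 = nodeTwoLetter v m →
      X 3 = (h, 0, 0) → X 2 = (0, 0, 0) → (X ∈ C.upper → False) ∧ (X ∈ C.lower → False) := by
    intro m hm1 hmμ φ v c hc X h0 h1 h3 h2
    have e0 : X (Equiv.swap (0 : Fin 4) 2 0) = (0, 0, 0) := by simpa using h2
    have e1 : X (Equiv.swap (0 : Fin 4) 2 1) = nodeTwoLetter v m := by simpa [Equiv.swap_apply_of_ne_of_ne] using h1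
    have e2 : X (Equiv.swap (0 : Fin 4) 2 2) ≠ (0, 0, 0) := by simpa using h0 ▸ floorLetter_ne_origin φ (by omega : c ≠ 0)
    have e3 : X (Equiv.swap (0 : Fin 4) 2 3) = (h, 0, 0) := by simpa [Equiv.swap_apply_of_ne_of_ne] using h3
    exact ⟨fun hXu => towerP_absent hU hDN hDP hX hA hGl hGu hh hm1 hmμ (P := X.perm (Equiv.swap (0 : Fin 4) 2)) e0 e1 e2 e3 (hGu _ X hXu),
      fun hXl => towerN_absent hU hDN hDP hX hA hGl hGu hh hm1 hmμ (N := X.perm (Equiv.swap (0 : Fin 4) 2)) e0 e1 e2 e3 (hGl _ X hXl)⟩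
  -- one level, given the `N`-claim at every higher level `≤ μ − 2`
  have level : ∀ m : ℤ, 1 ≤ m → m ≤ μ - 2 →
      (∀ m', m < m' → m' ≤ μ - 2 → ∀ (φ v : Fin 4) (c : ℤ), 1 ≤ c → ∀ X ∈ C.lower, X 0 = floorLetter φ c → X 1 = nodeTwoLetter v m' →
        X 3 = (h, 0, 0) → False) →
      (∀ (φ v : Fin 4) (c : ℤ), 1 ≤ c → ∀ P ∈ C.upper, P 0 = floorLetter φ c → P 1 = nodeTwoLetter v m → P 3 = (h, 0, 0) → False) ∧
      (∀ (φ v : Fin 4) (c : ℤ), 1 ≤ c → ∀ N ∈ C.lower, N 0 = floorLetter φ c → N 1 = nodeTwoLetter v m → N 3 = (h, 0, 0) → False) := by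
    intro m hm1 hmμ ihN
    have hPA : ∀ (φ v : Fin 4) (c : ℤ), 1 ≤ c → ∀ P ∈ C.upper, P 0 = floorLetter φ c → P 1 = nodeTwoLetter v m → P 3 = (h, 0, 0) → False :=
      fun φ v c hc P hP h0 h1 h3 => floorPin_towerP_step hU hDN hDP hX hh (by omega) (by omega) (by omega) hmμ (by omega)
        (fun m' hlt hle X hXl hX0 hX1 _ hX3 => ihN m' hlt hle φ v c hc X hXl hX0 hX1 hX3) h0 h1 h3 hP
    refine ⟨hPA, fun φ v c hc N hN h0 h1 h3 => ?_⟩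
    by_cases h2 : N 2 = (0, 0, 0)
    · exact (hWO m hm1 hmμ φ v c hc N h0 h1 h3 h2).2 hN
    · exact floorPin_lower_step hU hDN hN (h0 ▸ onFloor_floorLetter φ (by omega)) h2
        (fun P hP hP0 hP1 hP3 => hPA φ v c hc P hP (hP0.trans h0) (hP1.trans h1) (hP3.trans h3))
  intro n
  induction n with
  | zero => intro m hn hm1 hmμ; exact level m hm1 hmμ (fun m' hlt hle => absurd hle (by omega))
  | succ n ih => intro m hn hm1 hmμ; exact level m hm1 hmμ (fun m' hlt hle => (ih m' (by omega) (by omega) hle).2)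

/-- **T2 (level `P`).** `P{c·ℓ_φ, 2I + m·ℓ_v, W, hI} ∉ C.upper` for `c ≥ 1`, `1 ≤ m ≤ μ − 2` (`h = 2μ`), all phases, EVERY fourth letter `W`
(`O` included) [◇_h, RULE D, X⁺, A2I⁻ (only through T1), `S₄` on E₋ and E₊].  Census (`tools/famW.py`): peel rounds 2 – 3, 0 survivors. -/
theorem floorPinTowerP_absent {h μ m c : ℤ} {C : MConfig} (hU : C.InDiamond h) (hDN : ∀ Z ∈ C.lower, RuleDMu4N C Z)
    (hDP : ∀ P ∈ C.upper, RuleDMu4P C P) (hX : XPlusClosed C) (hA : A2IMinusClosed C) (hGl : PermClosed C.lower)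
    (hGu : PermClosed C.upper) (hh : h = 2 * μ) (hm1 : 1 ≤ m) (hmμ : m ≤ μ - 2) (hc : 1 ≤ c) {P : MCell} {φ v : Fin 4}
    (h0 : P 0 = floorLetter φ c) (h1 : P 1 = nodeTwoLetter v m) (h3 : P 3 = (h, 0, 0)) : P ∉ C.upper := fun hP =>
  (floorPinTower_aux hU hDN hDP hX hA hGl hGu hh (μ - 2 - m).toNat m (Int.self_le_toNat _) hm1 hmμ).1 φ v c hc P hP h0 h1 h3

/-- **T2 (level `N`).** `N{c·ℓ_φ, 2I + m·ℓ_v, W, hI} ∉ C.lower` for `c ≥ 1`, `1 ≤ m ≤ μ − 2` (`h = 2μ`), all phases, EVERY `W` [same].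
Census: peel rounds 2 – 4 (◇₁₀: `m = 1` r3 – r4, `m = 2` r2 – r3, top `m = 3` typed by g19), 0 survivors. -/
theorem floorPinTowerN_absent {h μ m c : ℤ} {C : MConfig} (hU : C.InDiamond h) (hDN : ∀ Z ∈ C.lower, RuleDMu4N C Z)
    (hDP : ∀ P ∈ C.upper, RuleDMu4P C P) (hX : XPlusClosed C) (hA : A2IMinusClosed C) (hGl : PermClosed C.lower)
    (hGu : PermClosed C.upper) (hh : h = 2 * μ) (hm1 : 1 ≤ m) (hmμ : m ≤ μ - 2) (hc : 1 ≤ c) {N : MCell} {φ v : Fin 4}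
    (h0 : N 0 = floorLetter φ c) (h1 : N 1 = nodeTwoLetter v m) (h3 : N 3 = (h, 0, 0)) : N ∉ C.lower := fun hN =>
  (floorPinTower_aux hU hDN hDP hX hA hGl hGu hh (μ - 2 - m).toNat m (Int.self_le_toNat _) hm1 hmμ).2 φ v c hc N hN h0 h1 h3

/-- **T1 + T2: THE FLOOR-PINNED NODE-2 TOWER, level `P`.** `P{c·ℓ_φ, 2I + m·ℓ_v, W, hI} ∉ C.upper` for `c ≥ 0`, `1 ≤ m ≤ μ − 2`, every `W`,
except the doubly-origin cell `(c, W) = (0, O)` (absent too but DEEP; its `P`-level is `doubleOriginTowerP_absent`). -/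
theorem floorTowerP_absent {h μ m c : ℤ} {C : MConfig} (hU : C.InDiamond h) (hDN : ∀ Z ∈ C.lower, RuleDMu4N C Z)
    (hDP : ∀ P ∈ C.upper, RuleDMu4P C P) (hX : XPlusClosed C) (hA : A2IMinusClosed C) (hGl : PermClosed C.lower)
    (hGu : PermClosed C.upper) (hh : h = 2 * μ) (hm1 : 1 ≤ m) (hmμ : m ≤ μ - 2) (hc : 0 ≤ c) {P : MCell} {φ v : Fin 4}
    (h0 : P 0 = floorLetter φ c) (h1 : P 1 = nodeTwoLetter v m) (h3 : P 3 = (h, 0, 0)) (h2 : c = 0 → P 2 ≠ (0, 0, 0)) : P ∉ C.upper := by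
  rcases (show c = 0 ∨ 1 ≤ c by omega) with rfl | hc1
  · exact towerP_absent hU hDN hDP hX hA hGl hGu hh hm1 hmμ (h0.trans (ray_zero _ φ)) h1 (h2 rfl) h3
  · exact floorPinTowerP_absent hU hDN hDP hX hA hGl hGu hh hm1 hmμ hc1 h0 h1 h3

/-- **T1 + T2, level `N`.** `N{c·ℓ_φ, 2I + m·ℓ_v, W, hI} ∉ C.lower` for `c ≥ 0`, `1 ≤ m ≤ μ − 2`, every `W`, `(c, W) ≠ (0, O)`. -/
theorem floorTowerN_absent {h μ m c : ℤ} {C : MConfig} (hU : C.InDiamond h) (hDN : ∀ Z ∈ C.lower, RuleDMu4N C Z)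
    (hDP : ∀ P ∈ C.upper, RuleDMu4P C P) (hX : XPlusClosed C) (hA : A2IMinusClosed C) (hGl : PermClosed C.lower)
    (hGu : PermClosed C.upper) (hh : h = 2 * μ) (hm1 : 1 ≤ m) (hmμ : m ≤ μ - 2) (hc : 0 ≤ c) {N : MCell} {φ v : Fin 4}
    (h0 : N 0 = floorLetter φ c) (h1 : N 1 = nodeTwoLetter v m) (h3 : N 3 = (h, 0, 0)) (h2 : c = 0 → N 2 ≠ (0, 0, 0)) : N ∉ C.lower := by
  rcases (show c = 0 ∨ 1 ≤ c by omega) with rfl | hc1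
  · exact towerN_absent hU hDN hDP hX hA hGl hGu hh hm1 hmμ (h0.trans (ray_zero _ φ)) h1 (h2 rfl) h3
  · exact floorPinTowerN_absent hU hDN hDP hX hA hGl hGu hh hm1 hmμ hc1 h0 h1 h3

/-- **THE DOUBLY-ORIGIN COLUMN, level `P`.** `P{O, 2I + m·ℓ_v, O, hI} ∉ C.upper` for `1 ≤ m ≤ μ − 2` [◇_h, RULE D on E₊, T2]: the apex pin `hI`
forces `O` to be served ABOVE (`servedAbove_ceiling_apex`) by some `e·ℓ_r`, `e ≥ 1`, and that server is a T2 `N`-cell.  Census: ◇₁₀ rounds 3 – 5,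
0 survivors (the `N`-level of this column is deep — rounds 6 ∕ 9 — and NOT claimed). -/
theorem doubleOriginTowerP_absent {h μ m : ℤ} {C : MConfig} (hU : C.InDiamond h) (hDN : ∀ Z ∈ C.lower, RuleDMu4N C Z)
    (hDP : ∀ P ∈ C.upper, RuleDMu4P C P) (hX : XPlusClosed C) (hA : A2IMinusClosed C) (hGl : PermClosed C.lower)
    (hGu : PermClosed C.upper) (hh : h = 2 * μ) (hm1 : 1 ≤ m) (hmμ : m ≤ μ - 2) {P : MCell} {v : Fin 4} (h0 : P 0 = (0, 0, 0))
    (h1 : P 1 = nodeTwoLetter v m) (h3 : P 3 = (h, 0, 0)) : P ∉ C.upper := fun hP => by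
  have hh0 : h ≠ 0 := by omega
  obtain ⟨r, N, hN, hNP⟩ := servedAbove_ceiling_apex hU hP (hDP P hP) (g := 3) (j := 0) (by decide) (by rw [h3]; exact onCeiling_apex h)
    (k := 0) (by rw [h0]; simp [Adapted]) (by rw [h0]; simpa [coord] using hh0.symm)
  -- the server `N = P(0 ↦ e·ℓ_r)`, `e = (N 0).1 ≥ 1`
  have hN0 : N 0 = floorLetter r (N 0).1 := by have e := hNP.2.2; rw [h0] at e; simpa using e
  have he : 1 ≤ (N 0).1 := by have := hNP.2.1; rw [h0] at this; simp at this; omega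
  exact floorPinTowerN_absent hU hDN hDP hX hA hGl hGu hh hm1 hmμ he hN0 ((hNP.1 1 (by decide)).symm.trans h1)
    ((hNP.1 3 (by decide)).symm.trans h3) hN


/-! ## §2 T3 — THE TWO-CEILING-LETTER TOWER `{F, L(m), y, y′}` AND ITS `FL` EDGE (control g22, v0.2)

Letters: `F = c·ℓ_φ = floorLetter φ c` (`c ≥ 0`), `L(m) = 2I + m·ℓ_v = nodeTwoLetter v m` (`1 ≤ m ≤ μ − 2`), the ceiling-line letters
`y(w, K) = ceilLetter h w K = (h−2−2K)·I + (1+K)·ℓ_w` (`y(w,0) = cu_w`, `y(w, μ−1) = FL_w`; `h = 2μ`).  **T3-P** `P{F, L(m), y(w₁,Ka), y(w₂,Kb)} ∉ E₊`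
for `Kb ≤ 3` if `Ka ≤ μ − 2`, `Kb ≤ 2` on the `FL` edge `Ka = μ − 1`; **T3-N** for `Kb ≤ 2` resp. `Kb ≤ 1` — one less when `c = 0` (the corner
`{O, L(m), FL, y(K)}` beyond is deep, ◇₁₀ rounds 5 – 8).  MOVES: level `P` — pin `y(w₁,Ka)`, the inner letter climbs INWARD `y(w₂, Kb − e)`
(`above_ceilLetter_offRay`) down to `hI` (T1 ∕ T2); level `N`, `Ka ≤ μ−2` — pin `F`, `y(w₁,Ka)` slides OUTWARD `y(w₁, Ka + d)` (`below_ceilLetter_offTop`);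
`Ka = μ−1`, `c ≥ 1` — pin `FL`, `F` descends its ray (`below_floorLetter_eq`); `c = 0` — `L(m)` descends its line (`below_nodeTwo_line`) to the
§2b ∕ F2⁺ leaves.  Inductions `floorEdge_aux` (`c + m + Kb`), `twoCeil_aux` (`(μ−2−Ka) + Kb`).  Census (`tools/famX.py`): members ◇₆ 1 756 ∕
◇₈ 7 700 ∕ ◇₁₀ 20 982, 0 SURVIVORS; NEW ◇₈ 4 364 ∕ ◇₁₀ 14 948 (r2 656, r3 5 429, r4 4 071, r5 3 388, r6 1 404); `tools/t3check.py` 0 failures.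
HC ∕ HC_CM ∕ HC_AV ∕ H2 NOT proved; census-neutral. -/

/-! ### §2a Letter lemmas: the ceiling line, the floor ray, the node-2 line -/

theorem ceilLetter_fst (h : ℤ) (w : Fin 4) (K : ℤ) : (ceilLetter h w K).1 = h - 1 - K := by
  rw [ray_fst]; ring

theorem ceilLetter_ne_origin {h K : ℤ} (w : Fin 4) (hK : h - 1 - K ≠ 0) : ceilLetter h w K ≠ (0, 0, 0) := fun e => by
  have := congrArg Prod.fst e; rw [ceilLetter_fst] at this; exact hK this

theorem ceilLetter_ne_apex {h K : ℤ} (w : Fin 4) (hK : K ≠ -1) : ceilLetter h w K ≠ (h, 0, 0) := fun e => by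
  have := congrArg Prod.fst e; rw [ceilLetter_fst] at this; exact hK (by simpa using show K = -1 by linarith)

/-- a ceiling-line letter `y(w, K)`, `K ≥ −1`, lies on the ceiling of ◇_h. -/
theorem onCeiling_ceilLetter (h : ℤ) (w : Fin 4) {K : ℤ} (hK : 0 ≤ 1 + K) : OnCeiling h (ceilLetter h w K) := by
  fin_cases w <;> simp [OnCeiling, absCharge, chargeOf, ray] <;> (simp only [abs_eq_max_neg, max_def]; split_ifs <;> omega)

/-- the full floor letter `FL_w = μ·ℓ_w` is the last ceiling-line letter `y(w, μ − 1)` of ◇_{2μ}. -/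
theorem floorLetter_mu_eq_ceilLetter {h μ : ℤ} (hh : h = 2 * μ) (w : Fin 4) : floorLetter w μ = ceilLetter h w (μ - 1) := by
  subst hh
  show ray ((0 : ℤ), (0 : ℤ), (0 : ℤ)) w μ = ray ((2 * μ - 2 - 2 * (μ - 1), 0, 0) : BPoint) w (1 + (μ - 1))
  rw [show (2 * μ - 2 - 2 * (μ - 1) : ℤ) = 0 by ring, show (1 + (μ - 1) : ℤ) = μ by ring]

/-- the own frame `φ` of a floor letter `c·ℓ_φ`: adapted, coordinate `2c`. -/
theorem floorLetter_top (φ : Fin 4) (c : ℤ) : Adapted (floorLetter φ c) φ ∧ coord (floorLetter φ c) φ = 2 * c := by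
  refine ⟨(adapted_ray_apex 0 φ c).1, ?_⟩
  rw [coord_ray_self, coord_of_isApex ⟨rfl, rfl⟩, zero_add]

theorem nodeTwoLetter_neg_one (u : Fin 4) : nodeTwoLetter u (-1) = floorUnit (u + 2) := by
  fin_cases u <;> simp [ray]

/-- BELOW a ceiling-line letter `y(w, K)` (`K ≥ 0`) OFF its own ray: only the outward step along the ceiling, `y(w, K) − d·n_{w+2} = y(w, K + d)`,
and it stays in ◇_h only while `2(K + d) + 2 ≤ h` (`K + d ≤ μ − 1`: the last one is `FL_w`). -/
theorem below_ceilLetter_offTop {h K d : ℤ} {z : BPoint} {w r : Fin 4} (hK : 0 ≤ K) (hz : InDiamond h z) (hd : 0 < d) (hr : r ≠ w)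
    (he : ceilLetter h w K = ray z r d) : r = w + 2 ∧ 2 * (K + d) + 2 ≤ h ∧ z = ceilLetter h w (K + d) := by
  obtain ⟨α, a, b⟩ := z
  obtain ⟨hax, h1, -, -⟩ := hz
  simp only [AxisPt, absCharge, chargeOf, ray, Prod.mk.injEq] at hax h1 he ⊢
  fin_cases w <;> fin_cases r <;> simp at hax h1 he hr ⊢ <;>
    (simp only [abs_eq_max_neg, max_def] at h1; split_ifs at h1 <;> omega)

/-- BELOW a floor letter `c·ℓ_φ` (`c ≥ 0`): only its own ray, `(c − d)·ℓ_φ` with `d ≤ c`. -/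
theorem below_floorLetter_eq {h c d : ℤ} {z : BPoint} {φ r : Fin 4} (hz : InDiamond h z) (hc : 0 ≤ c) (hd : 0 < d)
    (he : floorLetter φ c = ray z r d) : r = φ ∧ d ≤ c ∧ z = floorLetter φ (c - d) := by
  obtain ⟨α, a, b⟩ := z
  obtain ⟨hax, h1, -, -⟩ := hz
  simp only [AxisPt, absCharge, chargeOf, ray, Prod.mk.injEq] at hax h1 he ⊢
  fin_cases φ <;> fin_cases r <;> simp at hax h1 he ⊢ <;>
    (simp only [abs_eq_max_neg, max_def] at h1; split_ifs at h1 <;> omega)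

/-- BELOW a node-2 letter `L(n) = 2I + n·ℓ_u` (`n ≥ 1`) OFF the direction `u + 2`: only its own line, `L(n − d)` with `n − d ≥ −1`
(`L(0) = 2I`, `L(−1) = ℓ_{u+2}`). -/
theorem below_nodeTwo_line {h n d : ℤ} {z : BPoint} {u r : Fin 4} (hn : 1 ≤ n) (hz : InDiamond h z) (hd : 0 < d) (hr : r ≠ u + 2)
    (he : nodeTwoLetter u n = ray z r d) : r = u ∧ d ≤ n + 1 ∧ z = nodeTwoLetter u (n - d) := by
  obtain ⟨α, a, b⟩ := z
  obtain ⟨hax, h1, -, -⟩ := hz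
  simp only [AxisPt, absCharge, chargeOf, ray, Prod.mk.injEq] at hax h1 he ⊢
  fin_cases u <;> fin_cases r <;> simp at hax h1 he hr ⊢ <;>
    (simp only [abs_eq_max_neg, max_def] at h1; split_ifs at h1 <;> omega)

/-- the UP-LINE OF A CEILING-LINE LETTER under ANY ceiling pin at slot `g`: `y(w, K)` (`K ≥ 0`) at slot `j ≠ g` is served above along its node ray
by some `y(w, K − e)`, `1 ≤ e ≤ K + 1` (`upLine_of_ruleDMu4P` + `above_ceilLetter_offRay`). -/
theorem upLine_ceilLetter' {h K : ℤ} {C : MConfig} (hU : C.InDiamond h) {P : MCell} (hP : P ∈ C.upper) (hD : RuleDMu4P C P)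
    {g j : Fin 4} (hgj : g ≠ j) (hg : OnCeiling h (P g)) {w : Fin 4} (hK : 0 ≤ K) (hj : P j = ceilLetter h w K) :
    ∃ N ∈ C.lower, (∀ i, i ≠ j → N i = P i) ∧ ∃ e, 1 ≤ e ∧ e ≤ K + 1 ∧ N j = ceilLetter h w (K - e) := by
  have hna : ¬ isApex (P j) := by rw [hj]; exact ceilLetter_not_isApex w (by omega)
  have hk : Adapted (P j) (w + 2) := by rw [hj]; exact (ceilLetter_node h w K).1
  have hkh : coord (P j) (w + 2) ≠ h := by rw [hj, (ceilLetter_node h w K).2]; omega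
  obtain ⟨N, hN, hNP⟩ := upLine_of_ruleDMu4P hU hP hD hgj hg hna hk hkh
  have he0 : 0 < (N j).1 - (P j).1 := by have := hNP.2.1; omega
  have e : N j = ray (ceilLetter h w K) (w + 2) ((N j).1 - (P j).1) := by rw [← hj]; exact hNP.2.2
  obtain ⟨-, hle, hNj⟩ := above_ceilLetter_offRay hK (hU.1 N hN j) he0 e
  exact ⟨N, hN, fun i hi => (hNP.1 i hi).symm, (N j).1 - (P j).1, by omega, hle, hNj⟩

/-! ### §2b The corner leaves `{O, 2I, X, cu_χ}` -/

/-- `N{O, 2I, X, cu_χ} ∉ C.lower` for EVERY fourth letter `X` [◇_h, RULE D, X⁺, A2I⁻, `S₄` on both levels, `Δ` on E₊]: the floor pin `O` serves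
the apex letter `2I` below, necessarily by a floor unit `ℓ_ψ` (`apexTwo_downRay`), and `P{O, ℓ_ψ, X, cu_χ} ∉ C.upper` is F2⁺. -/
theorem originApexTwo_N_absent {h : ℤ} {C : MConfig} (hU : C.InDiamond h) (hDN : ∀ Z ∈ C.lower, RuleDMu4N C Z)
    (hDP : ∀ P ∈ C.upper, RuleDMu4P C P) (hX : XPlusClosed C) (hA : A2IMinusClosed C) (hGl : PermClosed C.lower)
    (hGu : PermClosed C.upper) (hΔu : DeltaClosed C.upper) {N : MCell} {χ : Fin 4} (h0 : N 0 = (0, 0, 0))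
    (h1 : N 1 = ((2 : ℤ), (0 : ℤ), (0 : ℤ))) (h3 : N 3 = ceilingUnit h χ) : N ∉ C.lower := fun hN => by
  have hfl : OnFloor (N 0) := by rw [h0]; simp [OnFloor, absCharge, chargeOf]
  obtain ⟨r, P, hP, hNP⟩ := servedBelow_floor_apex hU hN (hDN N hN) (i := 0) (g := 1) (by decide) hfl (k := 0)
    (by rw [h1]; exact adapted_apexTwo 0) (by rw [h1, coord_apexTwo]; decide)
  have hd : 0 < (N 1).1 - (P 1).1 := by have := hNP.2.1; omega
  have e : (((2 : ℤ), (0 : ℤ), (0 : ℤ)) : BPoint) = ray (P 1) r ((N 1).1 - (P 1).1) := by rw [← h1]; exact hNP.2.2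
  exact originUnitFree_P_absent' hU hDN hDP hX hA hGl hGu hΔu ((hNP.1 0 (by decide)).trans h0) (apexTwo_downRay (hU.2 P hP 1) hd e)
    ((hNP.1 3 (by decide)).trans h3) hP

/-- `P{O, 2I, X, cu_χ} ∉ C.upper` for every fourth letter `X ≠ hI` [same]: the ceiling pin `cu_χ` serves `X` above (`exists_frame_ne_h`,
`servedAbove_ceiling_apex`) and the server `N{O, 2I, X′, cu_χ}` is excluded by `originApexTwo_N_absent`. -/
theorem originApexTwo_P_absent {h : ℤ} {C : MConfig} (hU : C.InDiamond h) (hDN : ∀ Z ∈ C.lower, RuleDMu4N C Z)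
    (hDP : ∀ P ∈ C.upper, RuleDMu4P C P) (hX : XPlusClosed C) (hA : A2IMinusClosed C) (hGl : PermClosed C.lower)
    (hGu : PermClosed C.upper) (hΔu : DeltaClosed C.upper) {P : MCell} {χ : Fin 4} (h2 : P 2 ≠ (h, 0, 0)) (h0 : P 0 = (0, 0, 0))
    (h1 : P 1 = ((2 : ℤ), (0 : ℤ), (0 : ℤ))) (h3 : P 3 = ceilingUnit h χ) : P ∉ C.upper := fun hP => by
  obtain ⟨k, hk, hkh⟩ := exists_frame_ne_h (hU.2 P hP 2) h2
  obtain ⟨r, N, hN, hNP⟩ := servedAbove_ceiling_apex hU hP (hDP P hP) (g := 3) (j := 2) (by decide)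
    (by rw [h3]; exact onCeiling_ceilingUnit h χ) hk hkh
  exact originApexTwo_N_absent hU hDN hDP hX hA hGl hGu hΔu ((hNP.1 0 (by decide)).symm.trans h0) ((hNP.1 1 (by decide)).symm.trans h1)
    ((hNP.1 3 (by decide)).symm.trans h3) hN

/-! ### §2c The `FL` edge `{F, L(m), FL_{w₁}, y(w₂, Kb)}` — induction on `c + m + Kb` -/

/-- both levels of the EDGE block `{c·ℓ_φ, L(m), FL_{w₁} = y(w₁, μ−1), y(w₂, Kb)}` at once, by induction on `c + m + Kb`
(level `P`: `Kb ≤ 2`, level `N`: `Kb ≤ 1`, one less for `c = 0`). -/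
theorem floorEdge_aux {h μ : ℤ} {C : MConfig} (hU : C.InDiamond h) (hDN : ∀ Z ∈ C.lower, RuleDMu4N C Z)
    (hDP : ∀ P ∈ C.upper, RuleDMu4P C P) (hX : XPlusClosed C) (hA : A2IMinusClosed C) (hGl : PermClosed C.lower)
    (hGu : PermClosed C.upper) (hΔu : DeltaClosed C.upper) (hh : h = 2 * μ) :
    ∀ n : ℕ, ∀ (c m Kb : ℤ), c + m + Kb ≤ n → 0 ≤ c → 1 ≤ m → m ≤ μ - 2 → 0 ≤ Kb →
      (Kb ≤ 2 → (c = 0 → Kb ≤ 1) → ∀ (φ v w₁ w₂ : Fin 4), ∀ P ∈ C.upper, P 0 = floorLetter φ c → P 1 = nodeTwoLetter v m →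
          P 2 = ceilLetter h w₁ (μ - 1) → P 3 = ceilLetter h w₂ Kb → False) ∧
      (Kb ≤ 1 → (c = 0 → Kb ≤ 0) → ∀ (φ v w₁ w₂ : Fin 4), ∀ N ∈ C.lower, N 0 = floorLetter φ c → N 1 = nodeTwoLetter v m →
          N 2 = ceilLetter h w₁ (μ - 1) → N 3 = ceilLetter h w₂ Kb → False) := by
  intro n
  induction n with
  | zero => intro c m Kb hn hc0 hm1 hmμ hKb0; exact absurd hn (by omega)
  | succ n ih =>
    intro c m Kb hn hc0 hm1 hmμ hKb0
    refine ⟨fun hKb2 hKbc φ v w₁ w₂ P hP h0 h1 h2 h3 => ?_, fun hKb1 hKbc φ v w₁ w₂ N hN h0 h1 h2 h3 => ?_⟩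
    · -- level P: under the pin FL_{w₁} (slot 2, on the ceiling) slot 3 is served above by y(w₂, Kb − e)
      obtain ⟨N, hN, hNP, e, he1, he2, hN3⟩ := upLine_ceilLetter' hU hP (hDP P hP) (g := 2) (j := 3) (by decide)
        (by rw [h2]; exact onCeiling_ceilLetter h w₁ (by omega)) hKb0 h3
      have hN0 : N 0 = floorLetter φ c := (hNP 0 (by decide)).trans h0
      have hN1 : N 1 = nodeTwoLetter v m := (hNP 1 (by decide)).trans h1
      have hN2 : N 2 = ceilLetter h w₁ (μ - 1) := (hNP 2 (by decide)).trans h2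
      rcases (show 0 ≤ Kb - e ∨ Kb - e = -1 by omega) with hge | hneg
      · exact (ih c m (Kb - e) (by omega) hc0 hm1 hmμ hge).2 (by omega) (fun h0c => by have := hKbc h0c; omega) φ v w₁ w₂ N hN
          hN0 hN1 hN2 hN3
      · rw [hneg, ceilLetter_neg_one] at hN3
        exact floorTowerN_absent hU hDN hDP hX hA hGl hGu hh hm1 hmμ hc0 hN0 hN1 hN3
          (fun _ => by rw [hN2]; exact ceilLetter_ne_origin w₁ (by omega)) hN
    · -- level N: the pin FL_{w₁} (slot 2, on the floor)
      have hfl : OnFloor (N 2) := by rw [h2, ← floorLetter_mu_eq_ceilLetter hh]; exact onFloor_floorLetter w₁ (by omega)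
      rcases (show c = 0 ∨ 1 ≤ c by omega) with hcz | hc1
      · -- the corner N{O, L(m), FL_{w₁}, cu_{w₂}}: L(m) is served below along its own line
        subst hcz
        have hKb : Kb = 0 := by have := hKbc rfl; omega
        subst hKb
        have hO : N 0 = (0, 0, 0) := h0.trans (ray_zero _ φ)
        have hcu : N 3 = ceilingUnit h w₂ := h3.trans (ceilLetter_zero h w₂)
        have hk : Adapted (N 1) v := by rw [h1]; exact (nodeTwoLetter_top v m).1
        have hk0 : coord (N 1) v ≠ 0 := by rw [h1, (nodeTwoLetter_top v m).2]; omega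
        obtain ⟨r, hr, P, hP, hNP⟩ := servedBelow_floor_dir hU hN (hDN N hN) (i := 2) (g := 1) (by decide) hfl hk hk0
        have hd : 0 < (N 1).1 - (P 1).1 := by have := hNP.2.1; omega
        have e : nodeTwoLetter v m = ray (P 1) r ((N 1).1 - (P 1).1) := by rw [← h1]; exact hNP.2.2
        obtain ⟨-, hdm, hP1⟩ := below_nodeTwo_line hm1 (hU.2 P hP 1) hd hr e
        have hP0 : P 0 = (0, 0, 0) := (hNP.1 0 (by decide)).trans hO
        have hP2 : P 2 = ceilLetter h w₁ (μ - 1) := (hNP.1 2 (by decide)).trans h2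
        have hP3 : P 3 = ceilingUnit h w₂ := (hNP.1 3 (by decide)).trans hcu
        rcases (show 1 ≤ m - ((N 1).1 - (P 1).1) ∨ m - ((N 1).1 - (P 1).1) = 0 ∨ m - ((N 1).1 - (P 1).1) = -1 by omega)
          with hge | hze | hneg
        · exact (ih 0 (m - ((N 1).1 - (P 1).1)) 0 (by omega) le_rfl hge (by omega) le_rfl).1 (by omega) (fun _ => by omega)
            φ v w₁ w₂ P hP (hP0.trans (ray_zero _ φ).symm) hP1 hP2 (hP3.trans (ceilLetter_zero h w₂).symm)
        · rw [hze] at hP1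
          exact originApexTwo_P_absent hU hDN hDP hX hA hGl hGu hΔu (by rw [hP2]; exact ceilLetter_ne_apex w₁ (by omega)) hP0
            (hP1.trans (ray_zero _ v)) hP3 hP
        · rw [hneg, nodeTwoLetter_neg_one] at hP1
          exact originUnitFree_P_absent' hU hDN hDP hX hA hGl hGu hΔu hP0 hP1 hP3 hP
      · -- c ≥ 1: F = c·ℓ_φ (slot 0, coordinate 2c ≠ 0 in its own frame) is served below along its own ray
        have hk : Adapted (N 0) φ := by rw [h0]; exact (floorLetter_top φ c).1
        have hk0 : coord (N 0) φ ≠ 0 := by rw [h0, (floorLetter_top φ c).2]; omega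
        obtain ⟨r, -, P, hP, hNP⟩ := servedBelow_floor_dir hU hN (hDN N hN) (i := 2) (g := 0) (by decide) hfl hk hk0
        have hd : 0 < (N 0).1 - (P 0).1 := by have := hNP.2.1; omega
        have e : floorLetter φ c = ray (P 0) r ((N 0).1 - (P 0).1) := by rw [← h0]; exact hNP.2.2
        obtain ⟨-, hdc, hP0⟩ := below_floorLetter_eq (hU.2 P hP 0) hc0 hd e
        exact (ih (c - ((N 0).1 - (P 0).1)) m Kb (by omega) (by omega) hm1 hmμ hKb0).1 (by omega) (fun _ => by omega) φ v w₁ w₂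
          P hP hP0 ((hNP.1 1 (by decide)).trans h1) ((hNP.1 2 (by decide)).trans h2) ((hNP.1 3 (by decide)).trans h3)

/-- **T3 edge, level `P`.** `P{c·ℓ_φ, 2I + m·ℓ_v, FL_{w₁}, y(w₂, K)} ∉ C.upper` for `c ≥ 0`, `1 ≤ m ≤ μ − 2`, `0 ≤ K ≤ 2` (`K ≤ 1` if `c = 0`),
all phases [◇_h, RULE D, X⁺, A2I⁻, `S₄` on both levels, `Δ` on E₊].  Census (tag T3Pfl): rounds 1 – 6, 0 survivors; new ◇₈ 976 ∕ ◇₁₀ 2 152. -/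
theorem floorEdgeTowerP_absent {h μ m c K : ℤ} {C : MConfig} (hU : C.InDiamond h) (hDN : ∀ Z ∈ C.lower, RuleDMu4N C Z)
    (hDP : ∀ P ∈ C.upper, RuleDMu4P C P) (hX : XPlusClosed C) (hA : A2IMinusClosed C) (hGl : PermClosed C.lower)
    (hGu : PermClosed C.upper) (hΔu : DeltaClosed C.upper) (hh : h = 2 * μ) (hc : 0 ≤ c) (hm1 : 1 ≤ m) (hmμ : m ≤ μ - 2)
    (hK0 : 0 ≤ K) (hK : K ≤ 2) (hKc : c = 0 → K ≤ 1) {P : MCell} {φ v w₁ w₂ : Fin 4} (h0 : P 0 = floorLetter φ c)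
    (h1 : P 1 = nodeTwoLetter v m) (h2 : P 2 = floorLetter w₁ μ) (h3 : P 3 = ceilLetter h w₂ K) : P ∉ C.upper := fun hP =>
  (floorEdge_aux hU hDN hDP hX hA hGl hGu hΔu hh (c + m + K).toNat c m K (Int.self_le_toNat _) hc hm1 hmμ hK0).1 hK hKc φ v w₁ w₂ P hP
    h0 h1 (h2.trans (floorLetter_mu_eq_ceilLetter hh w₁)) h3

/-- **T3 edge, level `N`.** `N{c·ℓ_φ, 2I + m·ℓ_v, FL_{w₁}, y(w₂, K)} ∉ C.lower` for `c ≥ 0`, `1 ≤ m ≤ μ − 2`, `0 ≤ K ≤ 1` (`K = 0` if `c = 0`),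
all phases [same].  Census (tag T3Nfl): rounds 2 – 6, 0 survivors; new ◇₈ 728 ∕ ◇₁₀ 1 528. -/
theorem floorEdgeTowerN_absent {h μ m c K : ℤ} {C : MConfig} (hU : C.InDiamond h) (hDN : ∀ Z ∈ C.lower, RuleDMu4N C Z)
    (hDP : ∀ P ∈ C.upper, RuleDMu4P C P) (hX : XPlusClosed C) (hA : A2IMinusClosed C) (hGl : PermClosed C.lower)
    (hGu : PermClosed C.upper) (hΔu : DeltaClosed C.upper) (hh : h = 2 * μ) (hc : 0 ≤ c) (hm1 : 1 ≤ m) (hmμ : m ≤ μ - 2)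
    (hK0 : 0 ≤ K) (hK : K ≤ 1) (hKc : c = 0 → K ≤ 0) {N : MCell} {φ v w₁ w₂ : Fin 4} (h0 : N 0 = floorLetter φ c)
    (h1 : N 1 = nodeTwoLetter v m) (h2 : N 2 = floorLetter w₁ μ) (h3 : N 3 = ceilLetter h w₂ K) : N ∉ C.lower := fun hN =>
  (floorEdge_aux hU hDN hDP hX hA hGl hGu hΔu hh (c + m + K).toNat c m K (Int.self_le_toNat _) hc hm1 hmμ hK0).2 hK hKc φ v w₁ w₂ N hN
    h0 h1 (h2.trans (floorLetter_mu_eq_ceilLetter hh w₁)) h3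

/-! ### §2d The two-ceiling-letter block `{F, L(m), y(w₁, Ka), y(w₂, Kb)}`, `Ka ≤ μ − 2` — induction on `(μ − 2 − Ka) + Kb` -/

/-- the `P`-step: under the pin `y(w₁, Ka)` (slot 2) the inner letter `y(w₂, Kb)` (slot 3) climbs to `y(w₂, Kb − e)`: an `N`-cell of the block with
smaller `Kb` (`ihN`) or, at `Kb − e = −1` (`hI`), a T1 ∕ T2 cell of §1. -/
theorem twoCeil_P_step {h μ c m Ka Kb : ℤ} {C : MConfig} (hU : C.InDiamond h) (hDN : ∀ Z ∈ C.lower, RuleDMu4N C Z)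
    (hDP : ∀ P ∈ C.upper, RuleDMu4P C P) (hX : XPlusClosed C) (hA : A2IMinusClosed C) (hGl : PermClosed C.lower)
    (hGu : PermClosed C.upper) (hh : h = 2 * μ) (hc : 0 ≤ c) (hm1 : 1 ≤ m) (hmμ : m ≤ μ - 2) (hKa0 : 0 ≤ Ka) (hKa : Ka ≤ μ - 2)
    (hKb0 : 0 ≤ Kb) {φ v w₁ w₂ : Fin 4}
    (ihN : ∀ Kb' : ℤ, 0 ≤ Kb' → Kb' < Kb → ∀ N ∈ C.lower, N 0 = floorLetter φ c → N 1 = nodeTwoLetter v m →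
      N 2 = ceilLetter h w₁ Ka → N 3 = ceilLetter h w₂ Kb' → False)
    {P : MCell} (hP : P ∈ C.upper) (h0 : P 0 = floorLetter φ c) (h1 : P 1 = nodeTwoLetter v m) (h2 : P 2 = ceilLetter h w₁ Ka)
    (h3 : P 3 = ceilLetter h w₂ Kb) : False := by
  obtain ⟨N, hN, hNP, e, he1, he2, hN3⟩ := upLine_ceilLetter' hU hP (hDP P hP) (g := 2) (j := 3) (by decide)
    (by rw [h2]; exact onCeiling_ceilLetter h w₁ (by omega)) hKb0 h3
  have hN0 : N 0 = floorLetter φ c := (hNP 0 (by decide)).trans h0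
  have hN1 : N 1 = nodeTwoLetter v m := (hNP 1 (by decide)).trans h1
  have hN2 : N 2 = ceilLetter h w₁ Ka := (hNP 2 (by decide)).trans h2
  rcases (show 0 ≤ Kb - e ∨ Kb - e = -1 by omega) with hge | hneg
  · exact ihN (Kb - e) hge (by omega) N hN hN0 hN1 hN2 hN3
  · rw [hneg, ceilLetter_neg_one] at hN3
    exact floorTowerN_absent hU hDN hDP hX hA hGl hGu hh hm1 hmμ hc hN0 hN1 hN3
      (fun _ => by rw [hN2]; exact ceilLetter_ne_origin w₁ (by omega)) hN

/-- the `N`-step: under the floor pin `F` (slot 0) the outer letter `y(w₁, Ka)` (slot 2) slides to `y(w₁, Ka + d)`: a `P`-cell of the block with larger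
`Ka` (`ihP`) or the edge cell `P{F, L(m), FL_{w₁}, y(w₂, Kb)}` (`edgeP`). -/
theorem twoCeil_N_step {h μ c m Ka Kb : ℤ} {C : MConfig} (hU : C.InDiamond h) (hDN : ∀ Z ∈ C.lower, RuleDMu4N C Z)
    (hh : h = 2 * μ) (hc : 0 ≤ c) (hKa0 : 0 ≤ Ka) (hKa : Ka ≤ μ - 2) {φ v w₁ w₂ : Fin 4}
    (ihP : ∀ Ka' : ℤ, Ka < Ka' → Ka' ≤ μ - 2 → ∀ P ∈ C.upper, P 0 = floorLetter φ c → P 1 = nodeTwoLetter v m →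
      P 2 = ceilLetter h w₁ Ka' → P 3 = ceilLetter h w₂ Kb → False)
    (edgeP : ∀ P ∈ C.upper, P 0 = floorLetter φ c → P 1 = nodeTwoLetter v m → P 2 = ceilLetter h w₁ (μ - 1) →
      P 3 = ceilLetter h w₂ Kb → False)
    {N : MCell} (hN : N ∈ C.lower) (h0 : N 0 = floorLetter φ c) (h1 : N 1 = nodeTwoLetter v m) (h2 : N 2 = ceilLetter h w₁ Ka)
    (h3 : N 3 = ceilLetter h w₂ Kb) : False := by
  have hfl : OnFloor (N 0) := by rw [h0]; exact onFloor_floorLetter φ hc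
  have hk : Adapted (N 2) (w₁ + 2) := by rw [h2]; exact (ceilLetter_node h w₁ Ka).1
  have hk0 : coord (N 2) (w₁ + 2) ≠ 0 := by rw [h2, (ceilLetter_node h w₁ Ka).2]; omega
  obtain ⟨r, hr, P, hP, hNP⟩ := servedBelow_floor_dir hU hN (hDN N hN) (i := 0) (g := 2) (by decide) hfl hk hk0
  have hr' : r ≠ w₁ := fun e => hr (e.trans (fin4_add_two_add_two w₁).symm)
  have hd : 0 < (N 2).1 - (P 2).1 := by have := hNP.2.1; omega
  have e : ceilLetter h w₁ Ka = ray (P 2) r ((N 2).1 - (P 2).1) := by rw [← h2]; exact hNP.2.2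
  obtain ⟨-, hbd, hP2⟩ := below_ceilLetter_offTop hKa0 (hU.2 P hP 2) hd hr' e
  have hP0 : P 0 = floorLetter φ c := (hNP.1 0 (by decide)).trans h0
  have hP1 : P 1 = nodeTwoLetter v m := (hNP.1 1 (by decide)).trans h1
  have hP3 : P 3 = ceilLetter h w₂ Kb := (hNP.1 3 (by decide)).trans h3
  rcases (show Ka + ((N 2).1 - (P 2).1) ≤ μ - 2 ∨ Ka + ((N 2).1 - (P 2).1) = μ - 1 by omega) with hle | heq
  · exact ihP (Ka + ((N 2).1 - (P 2).1)) (by omega) hle P hP hP0 hP1 hP2 hP3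
  · rw [heq] at hP2; exact edgeP P hP hP0 hP1 hP2 hP3

/-- both levels of the two-ceiling-letter block at once, by induction on `(μ − 2 − Ka) + Kb` (level `P`: `Kb ≤ 3`, level `N`: `Kb ≤ 2`, one
less for `c = 0`; the edge `Ka + d = μ − 1` is §2c). -/
theorem twoCeil_aux {h μ c m : ℤ} {C : MConfig} (hU : C.InDiamond h) (hDN : ∀ Z ∈ C.lower, RuleDMu4N C Z)
    (hDP : ∀ P ∈ C.upper, RuleDMu4P C P) (hX : XPlusClosed C) (hA : A2IMinusClosed C) (hGl : PermClosed C.lower)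
    (hGu : PermClosed C.upper) (hΔu : DeltaClosed C.upper) (hh : h = 2 * μ) (hc : 0 ≤ c) (hm1 : 1 ≤ m) (hmμ : m ≤ μ - 2)
    (φ v w₁ w₂ : Fin 4) :
    ∀ n : ℕ, ∀ (Ka Kb : ℤ), μ - 2 - Ka + Kb ≤ n → 0 ≤ Ka → Ka ≤ μ - 2 → 0 ≤ Kb →
      (Kb ≤ 3 → (c = 0 → Kb ≤ 2) → ∀ P ∈ C.upper, P 0 = floorLetter φ c → P 1 = nodeTwoLetter v m →
          P 2 = ceilLetter h w₁ Ka → P 3 = ceilLetter h w₂ Kb → False) ∧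
      (Kb ≤ 2 → (c = 0 → Kb ≤ 1) → ∀ N ∈ C.lower, N 0 = floorLetter φ c → N 1 = nodeTwoLetter v m →
          N 2 = ceilLetter h w₁ Ka → N 3 = ceilLetter h w₂ Kb → False) := by
  have edge : ∀ Kb : ℤ, 0 ≤ Kb → Kb ≤ 2 → (c = 0 → Kb ≤ 1) → ∀ P ∈ C.upper, P 0 = floorLetter φ c → P 1 = nodeTwoLetter v m →
      P 2 = ceilLetter h w₁ (μ - 1) → P 3 = ceilLetter h w₂ Kb → False :=
    fun Kb hKb0 hKb hKbc P hP h0 h1 h2 h3 =>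
      (floorEdge_aux hU hDN hDP hX hA hGl hGu hΔu hh (c + m + Kb).toNat c m Kb (Int.self_le_toNat _) hc hm1 hmμ hKb0).1 hKb hKbc
        φ v w₁ w₂ P hP h0 h1 h2 h3
  have level : ∀ Ka Kb : ℤ, 0 ≤ Ka → Ka ≤ μ - 2 → 0 ≤ Kb →
      (∀ Ka' Kb' : ℤ, 0 ≤ Ka' → Ka' ≤ μ - 2 → 0 ≤ Kb' → μ - 2 - Ka' + Kb' < μ - 2 - Ka + Kb →
        (Kb' ≤ 3 → (c = 0 → Kb' ≤ 2) → ∀ P ∈ C.upper, P 0 = floorLetter φ c → P 1 = nodeTwoLetter v m →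
            P 2 = ceilLetter h w₁ Ka' → P 3 = ceilLetter h w₂ Kb' → False) ∧
        (Kb' ≤ 2 → (c = 0 → Kb' ≤ 1) → ∀ N ∈ C.lower, N 0 = floorLetter φ c → N 1 = nodeTwoLetter v m →
            N 2 = ceilLetter h w₁ Ka' → N 3 = ceilLetter h w₂ Kb' → False)) →
      (Kb ≤ 3 → (c = 0 → Kb ≤ 2) → ∀ P ∈ C.upper, P 0 = floorLetter φ c → P 1 = nodeTwoLetter v m →
          P 2 = ceilLetter h w₁ Ka → P 3 = ceilLetter h w₂ Kb → False) ∧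
      (Kb ≤ 2 → (c = 0 → Kb ≤ 1) → ∀ N ∈ C.lower, N 0 = floorLetter φ c → N 1 = nodeTwoLetter v m →
          N 2 = ceilLetter h w₁ Ka → N 3 = ceilLetter h w₂ Kb → False) := by
    intro Ka Kb hKa0 hKa hKb0 ih
    refine ⟨fun hKb hKbc P hP h0 h1 h2 h3 => ?_, fun hKb hKbc N hN h0 h1 h2 h3 => ?_⟩
    · exact twoCeil_P_step hU hDN hDP hX hA hGl hGu hh hc hm1 hmμ hKa0 hKa hKb0
        (fun Kb' hKb'0 hlt N hN hN0 hN1 hN2 hN3 => (ih Ka Kb' hKa0 hKa hKb'0 (by omega)).2 (by omega)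
          (fun h0c => by have := hKbc h0c; omega) N hN hN0 hN1 hN2 hN3) hP h0 h1 h2 h3
    · exact twoCeil_N_step hU hDN hh hc hKa0 hKa
        (fun Ka' hlt hle P hP hP0 hP1 hP2 hP3 => (ih Ka' Kb (by omega) hle hKb0 (by omega)).1 (by omega)
          (fun h0c => by have := hKbc h0c; omega) P hP hP0 hP1 hP2 hP3) (edge Kb hKb0 hKb hKbc) hN h0 h1 h2 h3
  intro n
  induction n with
  | zero => intro Ka Kb hn hKa0 hKa hKb0; exact level Ka Kb hKa0 hKa hKb0 (fun Ka' Kb' h1 h2 h3 hlt => absurd hlt (by omega))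
  | succ n ih => intro Ka Kb hn hKa0 hKa hKb0; exact level Ka Kb hKa0 hKa hKb0 (fun Ka' Kb' h1 h2 h3 hlt => ih Ka' Kb' (by omega) h1 h2 h3)

/-- **T3, level `P`: THE TWO-CEILING-LETTER TOWER.** `P{c·ℓ_φ, 2I + m·ℓ_v, y(w₁, Ka), y(w₂, Kb)} ∉ C.upper` for `c ≥ 0`, `1 ≤ m ≤ μ − 2`,
`0 ≤ Ka ≤ μ − 2`, `0 ≤ Kb ≤ 3` (`Kb ≤ 2` if `c = 0`), ALL phases (`h = 2μ`) [◇_h, RULE D, X⁺, A2I⁻, `S₄` on both levels, `Δ` on E₊]; `Kb = 0` is the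
`cu` column.  Census (`tools/famX.py`, tag T3Pyy): ◇₈ 2 652 ∕ ◇₁₀ 8 538 orbits of rounds 1 – 6, 0 survivors; new ◇₈ 1 230 ∕ ◇₁₀ 5 658. -/
theorem twoCeilTowerP_absent {h μ m c Ka Kb : ℤ} {C : MConfig} (hU : C.InDiamond h) (hDN : ∀ Z ∈ C.lower, RuleDMu4N C Z)
    (hDP : ∀ P ∈ C.upper, RuleDMu4P C P) (hX : XPlusClosed C) (hA : A2IMinusClosed C) (hGl : PermClosed C.lower)
    (hGu : PermClosed C.upper) (hΔu : DeltaClosed C.upper) (hh : h = 2 * μ) (hc : 0 ≤ c) (hm1 : 1 ≤ m) (hmμ : m ≤ μ - 2)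
    (hKa0 : 0 ≤ Ka) (hKa : Ka ≤ μ - 2) (hKb0 : 0 ≤ Kb) (hKb : Kb ≤ 3) (hKbc : c = 0 → Kb ≤ 2) {P : MCell} {φ v w₁ w₂ : Fin 4}
    (h0 : P 0 = floorLetter φ c) (h1 : P 1 = nodeTwoLetter v m) (h2 : P 2 = ceilLetter h w₁ Ka) (h3 : P 3 = ceilLetter h w₂ Kb) :
    P ∉ C.upper := fun hP =>
  (twoCeil_aux hU hDN hDP hX hA hGl hGu hΔu hh hc hm1 hmμ φ v w₁ w₂ (μ - 2 - Ka + Kb).toNat Ka Kb (Int.self_le_toNat _) hKa0 hKa hKb0).1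
    hKb hKbc P hP h0 h1 h2 h3

/-- **T3, level `N`.** `N{c·ℓ_φ, 2I + m·ℓ_v, y(w₁, Ka), y(w₂, Kb)} ∉ C.lower` for `c ≥ 0`, `1 ≤ m ≤ μ − 2`, `0 ≤ Ka ≤ μ − 2`, `0 ≤ Kb ≤ 2`
(`Kb ≤ 1` if `c = 0`), all phases [same].  Census (tag T3Nyy): rounds 1 – 6, 0 survivors; new ◇₈ 1 430 ∕ ◇₁₀ 5 610. -/
theorem twoCeilTowerN_absent {h μ m c Ka Kb : ℤ} {C : MConfig} (hU : C.InDiamond h) (hDN : ∀ Z ∈ C.lower, RuleDMu4N C Z)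
    (hDP : ∀ P ∈ C.upper, RuleDMu4P C P) (hX : XPlusClosed C) (hA : A2IMinusClosed C) (hGl : PermClosed C.lower)
    (hGu : PermClosed C.upper) (hΔu : DeltaClosed C.upper) (hh : h = 2 * μ) (hc : 0 ≤ c) (hm1 : 1 ≤ m) (hmμ : m ≤ μ - 2)
    (hKa0 : 0 ≤ Ka) (hKa : Ka ≤ μ - 2) (hKb0 : 0 ≤ Kb) (hKb : Kb ≤ 2) (hKbc : c = 0 → Kb ≤ 1) {N : MCell} {φ v w₁ w₂ : Fin 4}
    (h0 : N 0 = floorLetter φ c) (h1 : N 1 = nodeTwoLetter v m) (h2 : N 2 = ceilLetter h w₁ Ka) (h3 : N 3 = ceilLetter h w₂ Kb) :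
    N ∉ C.lower := fun hN =>
  (twoCeil_aux hU hDN hDP hX hA hGl hGu hΔu hh hc hm1 hmμ φ v w₁ w₂ (μ - 2 - Ka + Kb).toNat Ka Kb (Int.self_le_toNat _) hKa0 hKa hKb0).2
    hKb hKbc N hN h0 h1 h2 h3


/-! ## §3 T4 — the SUB-DIAGONAL block `{F, L(m), σ_d(u), y(w, K)}` and the `A`-rows `{F, L(m), A, y(w, K)}` (no induction)

`σ_d(u) := subDiagLetter h u d = (h−2−2d)·I + d·ℓ_u` on the first sub-diagonal `a + 2c = h − 2` (`σ_0 = A = (h−2)·I`, `σ_{−1} = cu_{u+2}`,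
`σ_{μ−2} = L(μ−2)_u`); top frame `u` (coordinate `h − 2`), node frame `u + 2` (coordinate `h − 2 − 2d`).  MOVES: (A) level `P`, ceiling pin —
`σ_d(u)` climbs its TOP frame to `y(u, d)` only (`above_subDiag_top`; child T3); (B) or its NODE line to `σ_{d−e}`, `A`, `cu_{u+2}`
(`above_subDiag_node`); `A` climbs to a ceiling unit (`subApex_upServer'`); (C) level `N`, floor pin — `y(w,K)` slides outward
(`below_ceilLetter_offTop`); (D) `K = μ−1`: `F` resp. `L(m)` descends.  RESULTS (`c ≥ 0`, `1 ≤ m ≤ μ − 2`, `d ≥ 1`, `0 ≤ K ≤ μ − 1`, all phases):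
`apexRowP ∕ N_absent` for ALL `K`; `subDiagTowerP_absent` whenever `[K ≤ 2 ∧ d ≤ μ−2 ∧ (c = 0 → K ≤ 1)] ∨ [K ≤ μ−2 ∧ d ≤ 3 ∧ (c = 0 → d ≤ 2)] ∨
[d ≤ 2 ∧ (c = 0 → d ≤ 1)]`; `subDiagTowerN_absent` whenever `[K ≤ μ−2 ∧ d ≤ 2 ∧ (c = 0 → d ≤ 1)] ∨ [d = 1 ∧ c ≥ 1]` — sharp for this move set
(the excluded corners are deep).  Census (`tools/famY.py`): 0 SURVIVORS; NEW ◇₈ 3 652 ∕ ◇₁₀ 18 660. -/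

/-- the letter `σ_d(u) = (h − 2 − 2d)·I + d·ℓ_u` of the first sub-diagonal `a + 2c = h − 2` (`σ_0 = A = (h−2)·I`, `σ_{−1} = cu_{u+2}`). -/
abbrev subDiagLetter (h : ℤ) (u : Fin 4) (d : ℤ) : BPoint := ray ((h - 2 - 2 * d, 0, 0) : BPoint) u d

theorem subDiagLetter_top (h : ℤ) (u : Fin 4) (d : ℤ) : Adapted (subDiagLetter h u d) u ∧ coord (subDiagLetter h u d) u = h - 2 := by
  refine ⟨(adapted_ray_apex _ u d).1, ?_⟩
  rw [coord_ray_self, coord_of_isApex ⟨rfl, rfl⟩]; ring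

theorem subDiagLetter_node (h : ℤ) (u : Fin 4) (d : ℤ) :
    Adapted (subDiagLetter h u d) (u + 2) ∧ coord (subDiagLetter h u d) (u + 2) = h - 2 - 2 * d :=
  ⟨(adapted_ray_apex _ u _).2, coord_ray_apex_antip _ u _⟩

theorem subDiagLetter_not_isApex {h d : ℤ} (u : Fin 4) (hd : d ≠ 0) : ¬ isApex (subDiagLetter h u d) := by
  fin_cases u <;> simp [ray, isApex, hd]

theorem subDiagLetter_zero (h : ℤ) (u : Fin 4) : subDiagLetter h u 0 = (h - 2, 0, 0) := by
  fin_cases u <;> simp [ray]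

theorem subDiagLetter_neg_one (h : ℤ) (u : Fin 4) : subDiagLetter h u (-1) = ceilingUnit h (u + 2) := by
  fin_cases u <;> simp [ray] <;> omega

/-- the node ray of `σ_d(u)`: `σ_d(u) + e·ℓ_{u+2} = σ_{d−e}(u)`. -/
theorem ray_subDiag_node (h d e : ℤ) (u : Fin 4) : ray (subDiagLetter h u d) (u + 2) e = subDiagLetter h u (d - e) := by
  fin_cases u <;> simp [ray] <;> omega

/-- `σ_c(u)` read from the sub-apex: `σ_c(u) = A − c·ℓ_{u+2}`-ray, i.e. `ray A (u+2) (−c)`. -/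
theorem subDiagLetter_flip (h c : ℤ) (u : Fin 4) : subDiagLetter h u c = ray ((h - 2, 0, 0) : BPoint) (u + 2) (-c) := by
  fin_cases u <;> simp [ray] <;> omega

/-- ABOVE `σ_d(u)` (`d ≥ 0`) along its TOP direction `u` in ◇_h: one step, onto `y(u, d)`. -/
theorem above_subDiag_top {h d e : ℤ} {z : BPoint} {u : Fin 4} (hd : 0 ≤ d) (hz : InDiamond h z) (he : 0 < e)
    (heq : z = ray (subDiagLetter h u d) u e) : e = 1 ∧ z = ceilLetter h u d := by
  have hz' : z = ray ((h - 2 - 2 * d, 0, 0) : BPoint) u (d + e) := heq.trans (ray_add _ u d e).symm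
  have htop := hz.2.2.2
  rw [hz', top_ray_apex (h - 2 - 2 * d) u (by omega)] at htop
  have he1 : e = 1 := by omega
  subst he1
  exact ⟨rfl, hz'.trans (by rw [add_comm])⟩

/-- ABOVE `σ_d(u)` (`d ≥ 0`) along its NODE direction `u + 2` in ◇_h: `σ_{d−e}(u)` with `e ≤ d + 1`. -/
theorem above_subDiag_node {h d e : ℤ} {z : BPoint} {u : Fin 4} (hz : InDiamond h z)
    (heq : z = ray (subDiagLetter h u d) (u + 2) e) : e ≤ d + 1 ∧ z = subDiagLetter h u (d - e) := by
  have hz' : z = subDiagLetter h u (d - e) := heq.trans (ray_subDiag_node h d e u)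
  refine ⟨?_, hz'⟩
  by_contra hlt
  have htop := hz.2.2.2
  rw [hz', subDiagLetter_flip, top_ray_apex (h - 2) (u + 2) (by omega)] at htop
  omega

/-- the transposition `(2 3)` on a lower cell (`S₄` on E₋). -/
theorem perm23_lower {C : MConfig} (hGl : PermClosed C.lower) {N : MCell} (hN : N ∈ C.lower) :
    N.perm (Equiv.swap (2 : Fin 4) 3) ∈ C.lower ∧ N.perm (Equiv.swap (2 : Fin 4) 3) 0 = N 0 ∧ N.perm (Equiv.swap (2 : Fin 4) 3) 1 = N 1 ∧
      N.perm (Equiv.swap (2 : Fin 4) 3) 2 = N 3 ∧ N.perm (Equiv.swap (2 : Fin 4) 3) 3 = N 2 :=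
  ⟨hGl _ N hN, by show N (Equiv.swap (2 : Fin 4) 3 0) = _; simp [Equiv.swap_apply_of_ne_of_ne],
    by show N (Equiv.swap (2 : Fin 4) 3 1) = _; simp [Equiv.swap_apply_of_ne_of_ne],
    by show N (Equiv.swap (2 : Fin 4) 3 2) = _; rw [Equiv.swap_apply_left],
    by show N (Equiv.swap (2 : Fin 4) 3 3) = _; rw [Equiv.swap_apply_right]⟩

/-! ### §3a the two up-servers of `σ_d(u)` and the `cu`-child -/

/-- MOVE A: in a `P`-cell with a ceiling letter at slot `g` and `σ_d(u)` (`d ≥ 1`) at slot `j ≠ g`, slot `j` is served above along its top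
direction `u` — by `y(u, d)`. -/
theorem subDiag_upServer {h d : ℤ} {C : MConfig} (hU : C.InDiamond h) {P : MCell} (hP : P ∈ C.upper) (hD : RuleDMu4P C P)
    {g j : Fin 4} (hgj : g ≠ j) (hg : OnCeiling h (P g)) {u : Fin 4} (hd : 1 ≤ d) (hj : P j = subDiagLetter h u d) :
    ∃ N ∈ C.lower, (∀ i, i ≠ j → N i = P i) ∧ N j = ceilLetter h u d := by
  have hna : ¬ isApex (P j) := by rw [hj]; exact subDiagLetter_not_isApex u (by omega)
  have hk : Adapted (P j) u := by rw [hj]; exact (subDiagLetter_top h u d).1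
  have hkh : coord (P j) u ≠ h := by rw [hj, (subDiagLetter_top h u d).2]; omega
  obtain ⟨N, hN, hNP⟩ := upLine_of_ruleDMu4P hU hP hD hgj hg hna hk hkh
  have he0 : 0 < (N j).1 - (P j).1 := by have := hNP.2.1; omega
  have e : N j = ray (subDiagLetter h u d) u ((N j).1 - (P j).1) := by rw [← hj]; exact hNP.2.2
  obtain ⟨-, hNj⟩ := above_subDiag_top (by omega) (hU.1 N hN j) he0 e
  exact ⟨N, hN, fun i hi => (hNP.1 i hi).symm, hNj⟩

/-- MOVE B: same cell, slot `j` served above along its NODE direction `u + 2` — by `σ_{d−e}(u)`, `1 ≤ e ≤ d + 1`. -/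
theorem subDiag_nodeServer {h d : ℤ} {C : MConfig} (hU : C.InDiamond h) {P : MCell} (hP : P ∈ C.upper) (hD : RuleDMu4P C P)
    {g j : Fin 4} (hgj : g ≠ j) (hg : OnCeiling h (P g)) {u : Fin 4} (hd : 1 ≤ d) (hj : P j = subDiagLetter h u d) :
    ∃ N ∈ C.lower, (∀ i, i ≠ j → N i = P i) ∧ ∃ e, 1 ≤ e ∧ e ≤ d + 1 ∧ N j = subDiagLetter h u (d - e) := by
  have hna : ¬ isApex (P j) := by rw [hj]; exact subDiagLetter_not_isApex u (by omega)
  have hk : Adapted (P j) (u + 2) := by rw [hj]; exact (subDiagLetter_node h u d).1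
  have hkh : coord (P j) (u + 2) ≠ h := by rw [hj, (subDiagLetter_node h u d).2]; omega
  obtain ⟨N, hN, hNP⟩ := upLine_of_ruleDMu4P hU hP hD hgj hg hna hk hkh
  have he0 : 0 < (N j).1 - (P j).1 := by have := hNP.2.1; omega
  have e : N j = ray (subDiagLetter h u d) (u + 2) ((N j).1 - (P j).1) := by rw [← hj]; exact hNP.2.2
  obtain ⟨hle, hNj⟩ := above_subDiag_node (hU.1 N hN j) e
  exact ⟨N, hN, fun i hi => (hNP.1 i hi).symm, (N j).1 - (P j).1, by omega, hle, hNj⟩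

/-- the `cu`-CHILD `N{c·ℓ_φ, L(m), cu_x, y(w, K)} ∉ C.lower` for every `0 ≤ K ≤ μ − 1` (T3 with inner letter `cu_x = y(x, 0)`, resp. the `FL` edge
for `K = μ − 1`, after the transposition (2 3)). -/
theorem cuChildN_absent {h μ m c K : ℤ} {C : MConfig} (hU : C.InDiamond h) (hDN : ∀ Z ∈ C.lower, RuleDMu4N C Z)
    (hDP : ∀ P ∈ C.upper, RuleDMu4P C P) (hX : XPlusClosed C) (hA : A2IMinusClosed C) (hGl : PermClosed C.lower)
    (hGu : PermClosed C.upper) (hΔu : DeltaClosed C.upper) (hh : h = 2 * μ) (hc : 0 ≤ c) (hm1 : 1 ≤ m) (hmμ : m ≤ μ - 2)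
    (hK0 : 0 ≤ K) (hK : K ≤ μ - 1) {N : MCell} {φ v x w : Fin 4} (h0 : N 0 = floorLetter φ c) (h1 : N 1 = nodeTwoLetter v m)
    (h2 : N 2 = ceilingUnit h x) (h3 : N 3 = ceilLetter h w K) : N ∉ C.lower := fun hN => by
  obtain ⟨hN', e0, e1, e2, e3⟩ := perm23_lower hGl hN
  have e3' : N.perm (Equiv.swap (2 : Fin 4) 3) 3 = ceilLetter h x 0 := e3.trans (h2.trans (ceilLetter_zero h x).symm)
  rcases (show K ≤ μ - 2 ∨ K = μ - 1 by omega) with hle | heq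
  · exact twoCeilTowerN_absent hU hDN hDP hX hA hGl hGu hΔu hh hc hm1 hmμ hK0 hle le_rfl (by norm_num) (fun _ => by norm_num)
      (e0.trans h0) (e1.trans h1) (e2.trans h3) e3' hN'
  · subst heq
    exact floorEdgeTowerN_absent hU hDN hDP hX hA hGl hGu hΔu hh hc hm1 hmμ le_rfl (by norm_num) (fun _ => le_rfl)
      (e0.trans h0) (e1.trans h1) (e2.trans (h3.trans (floorLetter_mu_eq_ceilLetter hh w).symm)) e3' hN'

/-! ### §3b the `A`-rows `{F, L(m), A, y(w, K)}` — every `K` -/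

/-- **T4-A, level `P`.** `P{c·ℓ_φ, L(m), (h−2)·I, y(w, K)} ∉ C.upper` for `c ≥ 0`, `1 ≤ m ≤ μ − 2` and EVERY `0 ≤ K ≤ μ − 1` (incl. `cu_w` and `FL_w`):
the ceiling pin `y(w, K)` serves `A` above by a ceiling unit `cu_r`; the child is the `cu`-child. -/
theorem apexRowP_absent {h μ m c K : ℤ} {C : MConfig} (hU : C.InDiamond h) (hDN : ∀ Z ∈ C.lower, RuleDMu4N C Z)
    (hDP : ∀ P ∈ C.upper, RuleDMu4P C P) (hX : XPlusClosed C) (hA : A2IMinusClosed C) (hGl : PermClosed C.lower)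
    (hGu : PermClosed C.upper) (hΔu : DeltaClosed C.upper) (hh : h = 2 * μ) (hc : 0 ≤ c) (hm1 : 1 ≤ m) (hmμ : m ≤ μ - 2)
    (hK0 : 0 ≤ K) (hK : K ≤ μ - 1) {P : MCell} {φ v w : Fin 4} (h0 : P 0 = floorLetter φ c) (h1 : P 1 = nodeTwoLetter v m)
    (h2 : P 2 = (h - 2, 0, 0)) (h3 : P 3 = ceilLetter h w K) : P ∉ C.upper := fun hP => by
  have hg : OnCeiling h (P 3) := by rw [h3]; exact onCeiling_ceilLetter h w (by omega)
  obtain ⟨N, hN, r, -, hNP, hN2⟩ := subApex_upServer' hU hP (hDP P hP) (g := 3) (j := 2) (by decide) hg h2 0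
  exact cuChildN_absent hU hDN hDP hX hA hGl hGu hΔu hh hc hm1 hmμ hK0 hK ((hNP 0 (by decide)).trans h0)
    ((hNP 1 (by decide)).trans h1) hN2 ((hNP 3 (by decide)).trans h3) hN

/-- **T4-A, level `N`.** `N{c·ℓ_φ, L(m), (h−2)·I, y(w, K)} ∉ C.lower` for `c ≥ 0`, `1 ≤ m ≤ μ − 2` and EVERY `0 ≤ K ≤ μ − 1`: for `K ≤ μ − 2` the pin
`F` lets `y(w, K)` slide outward (level `P`); for `K = μ − 1` the pin is `FL_w` and `F` (`c ≥ 1`) resp. `L(m)` (`c = 0`) descends — to `L(m')`, `2I`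
(§2b after (2 3)) or `ℓ_{v+2}` (ON_{μ−1} after (2 3)). -/
theorem apexRowN_absent {h μ m c K : ℤ} {C : MConfig} (hU : C.InDiamond h) (hDN : ∀ Z ∈ C.lower, RuleDMu4N C Z)
    (hDP : ∀ P ∈ C.upper, RuleDMu4P C P) (hX : XPlusClosed C) (hA : A2IMinusClosed C) (hGl : PermClosed C.lower)
    (hGu : PermClosed C.upper) (hΔu : DeltaClosed C.upper) (hh : h = 2 * μ) (hc : 0 ≤ c) (hm1 : 1 ≤ m) (hmμ : m ≤ μ - 2)
    (hK0 : 0 ≤ K) (hK : K ≤ μ - 1) {N : MCell} {φ v w : Fin 4} (h0 : N 0 = floorLetter φ c) (h1 : N 1 = nodeTwoLetter v m)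
    (h2 : N 2 = (h - 2, 0, 0)) (h3 : N 3 = ceilLetter h w K) : N ∉ C.lower := fun hN => by
  rcases (show K ≤ μ - 2 ∨ K = μ - 1 by omega) with hKle | hKeq
  · -- MOVE C: pin F, serve y(w, K) below off its top frame
    have hfl : OnFloor (N 0) := by rw [h0]; exact onFloor_floorLetter φ hc
    have hk : Adapted (N 3) (w + 2) := by rw [h3]; exact (ceilLetter_node h w K).1
    have hk0 : coord (N 3) (w + 2) ≠ 0 := by rw [h3, (ceilLetter_node h w K).2]; omega
    obtain ⟨r, hr, P, hP, hNP⟩ := servedBelow_floor_dir hU hN (hDN N hN) (i := 0) (g := 3) (by decide) hfl hk hk0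
    have hr' : r ≠ w := fun e => hr (e.trans (fin4_add_two_add_two w).symm)
    have hd : 0 < (N 3).1 - (P 3).1 := by have := hNP.2.1; omega
    have e : ceilLetter h w K = ray (P 3) r ((N 3).1 - (P 3).1) := by rw [← h3]; exact hNP.2.2
    obtain ⟨-, hbd, hP3⟩ := below_ceilLetter_offTop hK0 (hU.2 P hP 3) hd hr' e
    exact apexRowP_absent hU hDN hDP hX hA hGl hGu hΔu hh hc hm1 hmμ (K := K + ((N 3).1 - (P 3).1)) (by omega) (by omega)
      ((hNP.1 0 (by decide)).trans h0) ((hNP.1 1 (by decide)).trans h1) ((hNP.1 2 (by decide)).trans h2) hP3 hP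
  · -- K = μ − 1: the pin is FL_w (slot 3, on the floor)
    subst hKeq
    have hfl : OnFloor (N 3) := by rw [h3, ← floorLetter_mu_eq_ceilLetter hh]; exact onFloor_floorLetter w (by omega)
    rcases (show c = 0 ∨ 1 ≤ c by omega) with hcz | hc1
    · subst hcz
      have hO : N 0 = (0, 0, 0) := h0.trans (ray_zero _ φ)
      have hk : Adapted (N 1) v := by rw [h1]; exact (nodeTwoLetter_top v m).1
      have hk0 : coord (N 1) v ≠ 0 := by rw [h1, (nodeTwoLetter_top v m).2]; omega
      obtain ⟨r, hr, P, hP, hNP⟩ := servedBelow_floor_dir hU hN (hDN N hN) (i := 3) (g := 1) (by decide) hfl hk hk0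
      have hd : 0 < (N 1).1 - (P 1).1 := by have := hNP.2.1; omega
      have e : nodeTwoLetter v m = ray (P 1) r ((N 1).1 - (P 1).1) := by rw [← h1]; exact hNP.2.2
      obtain ⟨-, hdm, hP1⟩ := below_nodeTwo_line hm1 (hU.2 P hP 1) hd hr e
      have hP0 : P 0 = (0, 0, 0) := (hNP.1 0 (by decide)).trans hO
      have hP2 : P 2 = (h - 2, 0, 0) := (hNP.1 2 (by decide)).trans h2
      have hP3 : P 3 = ceilLetter h w (μ - 1) := (hNP.1 3 (by decide)).trans h3
      have hg : OnCeiling h (P 3) := by rw [hP3]; exact onCeiling_ceilLetter h w (by omega)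
      rcases (show 1 ≤ m - ((N 1).1 - (P 1).1) ∨ m - ((N 1).1 - (P 1).1) = 0 ∨ m - ((N 1).1 - (P 1).1) = -1 by omega)
        with hge | hze | hneg
      · exact apexRowP_absent hU hDN hDP hX hA hGl hGu hΔu hh le_rfl hge (by omega) (K := μ - 1) (by omega) le_rfl
          (hP0.trans (ray_zero _ φ).symm) hP1 hP2 hP3 hP
      · -- P{O, 2I, A, FL_w}: the ceiling pin serves A above by cu_r'; N'{O, 2I, cu_r', FL_w} is §2b after (2 3)
        rw [hze] at hP1
        obtain ⟨N', hN', r', -, hN'P, hN'2⟩ := subApex_upServer' hU hP (hDP P hP) (g := 3) (j := 2) (by decide) hg hP2 0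
        obtain ⟨hN'', e0, e1, -, e3⟩ := perm23_lower hGl hN'
        exact originApexTwo_N_absent hU hDN hDP hX hA hGl hGu hΔu ((e0.trans (hN'P 0 (by decide))).trans hP0)
          ((e1.trans (hN'P 1 (by decide))).trans (hP1.trans (ray_zero _ v))) (e3.trans hN'2) hN''
      · -- P{O, ℓ_{v+2}, A, FL_w}: same server; N'{O, ℓ_{v+2}, cu_r', FL_w} is ON_{μ−1} after (2 3)
        rw [hneg, nodeTwoLetter_neg_one] at hP1
        obtain ⟨N', hN', r', -, hN'P, hN'2⟩ := subApex_upServer' hU hP (hDP P hP) (g := 3) (j := 2) (by decide) hg hP2 0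
        obtain ⟨hN'', e0, e1, e2, e3⟩ := perm23_lower hGl hN'
        exact originUnitCeilLine_N_absent hU hDN hDP hX hA hGl hGu hΔu (d := μ - 1) (by omega)
          ((e0.trans (hN'P 0 (by decide))).trans hP0) ((e1.trans (hN'P 1 (by decide))).trans hP1)
          ((e2.trans (hN'P 3 (by decide))).trans hP3) (e3.trans hN'2) hN''
    · -- c ≥ 1: F descends its own ray
      have hk : Adapted (N 0) φ := by rw [h0]; exact (floorLetter_top φ c).1
      have hk0 : coord (N 0) φ ≠ 0 := by rw [h0, (floorLetter_top φ c).2]; omega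
      obtain ⟨r, -, P, hP, hNP⟩ := servedBelow_floor_dir hU hN (hDN N hN) (i := 3) (g := 0) (by decide) hfl hk hk0
      have hd : 0 < (N 0).1 - (P 0).1 := by have := hNP.2.1; omega
      have e : floorLetter φ c = ray (P 0) r ((N 0).1 - (P 0).1) := by rw [← h0]; exact hNP.2.2
      obtain ⟨-, hdc, hP0⟩ := below_floorLetter_eq (hU.2 P hP 0) hc hd e
      exact apexRowP_absent hU hDN hDP hX hA hGl hGu hΔu hh (c := c - ((N 0).1 - (P 0).1)) (by omega) hm1 hmμ (K := μ - 1)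
        (by omega) le_rfl hP0 ((hNP.1 1 (by decide)).trans h1) ((hNP.1 2 (by decide)).trans h2) ((hNP.1 3 (by decide)).trans h3) hP

/-! ### §3c the sub-diagonal block, level by level (each step cites only earlier ones) -/

section subDiag
variable {h μ m c : ℤ} {C : MConfig} (hU : C.InDiamond h) (hDN : ∀ Z ∈ C.lower, RuleDMu4N C Z)
    (hDP : ∀ P ∈ C.upper, RuleDMu4P C P) (hX : XPlusClosed C) (hA : A2IMinusClosed C) (hGl : PermClosed C.lower)
    (hGu : PermClosed C.upper) (hΔu : DeltaClosed C.upper) (hh : h = 2 * μ) (hc : 0 ≤ c) (hm1 : 1 ≤ m) (hmμ : m ≤ μ - 2)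
include hU hDN hDP hX hA hGl hGu hΔu hh hc hm1 hmμ

/-- (P, `K ≤ 2`, `K ≤ 1` if `c = 0`; every `1 ≤ d ≤ μ − 2`) MOVE A: the child `N{F, L(m), y(u, d), y(w, K)}` is T3 with inner letter `y(w, K)`. -/
theorem subDiagP_lowK {d K : ℤ} (hd1 : 1 ≤ d) (hdμ : d ≤ μ - 2) (hK0 : 0 ≤ K) (hK : K ≤ 2) (hKc : c = 0 → K ≤ 1)
    {P : MCell} {φ v u w : Fin 4} (h0 : P 0 = floorLetter φ c) (h1 : P 1 = nodeTwoLetter v m) (h2 : P 2 = subDiagLetter h u d)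
    (h3 : P 3 = ceilLetter h w K) : P ∉ C.upper := fun hP => by
  have hg : OnCeiling h (P 3) := by rw [h3]; exact onCeiling_ceilLetter h w (by omega)
  obtain ⟨N, hN, hNP, hN2⟩ := subDiag_upServer hU hP (hDP P hP) (g := 3) (j := 2) (by decide) hg hd1 h2
  exact twoCeilTowerN_absent hU hDN hDP hX hA hGl hGu hΔu hh hc hm1 hmμ (Ka := d) (by omega) hdμ hK0 hK hKc
    ((hNP 0 (by decide)).trans h0) ((hNP 1 (by decide)).trans h1) hN2 ((hNP 3 (by decide)).trans h3) hN

/-- (P, `d ≤ 2`, `d ≤ 1` if `c = 0`; `K ≤ μ − 2`) MOVE A: the child is T3 with OUTER letter `y(w, K)` and inner letter `y(u, d)` (after (2 3)). -/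
theorem subDiagP_lowD {d K : ℤ} (hd1 : 1 ≤ d) (hd : d ≤ 2) (hdc : c = 0 → d ≤ 1) (hK0 : 0 ≤ K) (hK : K ≤ μ - 2)
    {P : MCell} {φ v u w : Fin 4} (h0 : P 0 = floorLetter φ c) (h1 : P 1 = nodeTwoLetter v m) (h2 : P 2 = subDiagLetter h u d)
    (h3 : P 3 = ceilLetter h w K) : P ∉ C.upper := fun hP => by
  have hg : OnCeiling h (P 3) := by rw [h3]; exact onCeiling_ceilLetter h w (by omega)
  obtain ⟨N, hN, hNP, hN2⟩ := subDiag_upServer hU hP (hDP P hP) (g := 3) (j := 2) (by decide) hg hd1 h2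
  obtain ⟨hN', e0, e1, e2, e3⟩ := perm23_lower hGl hN
  exact twoCeilTowerN_absent hU hDN hDP hX hA hGl hGu hΔu hh hc hm1 hmμ (Ka := K) (Kb := d) hK0 hK (by omega) hd hdc
    (e0.trans ((hNP 0 (by decide)).trans h0)) (e1.trans ((hNP 1 (by decide)).trans h1)) (e2.trans ((hNP 3 (by decide)).trans h3))
    (e3.trans hN2) hN'

/-- (P, `d = 1`, `K = μ − 1`: the cell `P{F, L(m), σ_1(u), FL_w}`, every `c ≥ 0`) MOVE B: `σ_1` is served above along its node direction by `A`
(child: the `A`-row at `FL`, level `N`) or by `cu_{u+2}` (the `cu`-child). -/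
theorem subDiagP_one_FL {P : MCell} {φ v u w : Fin 4} (h0 : P 0 = floorLetter φ c) (h1 : P 1 = nodeTwoLetter v m)
    (h2 : P 2 = subDiagLetter h u 1) (h3 : P 3 = ceilLetter h w (μ - 1)) : P ∉ C.upper := fun hP => by
  have hg : OnCeiling h (P 3) := by rw [h3]; exact onCeiling_ceilLetter h w (by omega)
  obtain ⟨N, hN, hNP, e, he1, he2, hN2⟩ := subDiag_nodeServer hU hP (hDP P hP) (g := 3) (j := 2) (by decide) hg le_rfl h2
  have hN0 := (hNP 0 (by decide)).trans h0
  have hN1 := (hNP 1 (by decide)).trans h1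
  have hN3 := (hNP 3 (by decide)).trans h3
  rcases (show 1 - e = 0 ∨ 1 - e = -1 by omega) with hz | hm
  · rw [hz, subDiagLetter_zero] at hN2
    exact apexRowN_absent hU hDN hDP hX hA hGl hGu hΔu hh hc hm1 hmμ (K := μ - 1) (by omega) le_rfl hN0 hN1 hN2 hN3 hN
  · rw [hm, subDiagLetter_neg_one] at hN2
    exact cuChildN_absent hU hDN hDP hX hA hGl hGu hΔu hh hc hm1 hmμ (K := μ - 1) (by omega) le_rfl hN0 hN1 hN2 hN3 hN

/-- (N, `d = 1`, `K ≤ μ − 2`, every `c ≥ 0`) MOVE C: `y(w, K)` is served below off its top frame by `y(w, K')`; the server is `subDiagP_lowD` or,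
at `K' = μ − 1`, `subDiagP_one_FL`. -/
theorem subDiagN_one {K : ℤ} (hK0 : 0 ≤ K) (hK : K ≤ μ - 2) {N : MCell} {φ v u w : Fin 4} (h0 : N 0 = floorLetter φ c)
    (h1 : N 1 = nodeTwoLetter v m) (h2 : N 2 = subDiagLetter h u 1) (h3 : N 3 = ceilLetter h w K) : N ∉ C.lower := fun hN => by
  have hfl : OnFloor (N 0) := by rw [h0]; exact onFloor_floorLetter φ hc
  have hk : Adapted (N 3) (w + 2) := by rw [h3]; exact (ceilLetter_node h w K).1
  have hk0 : coord (N 3) (w + 2) ≠ 0 := by rw [h3, (ceilLetter_node h w K).2]; omega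
  obtain ⟨r, hr, P, hP, hNP⟩ := servedBelow_floor_dir hU hN (hDN N hN) (i := 0) (g := 3) (by decide) hfl hk hk0
  have hr' : r ≠ w := fun e => hr (e.trans (fin4_add_two_add_two w).symm)
  have hd : 0 < (N 3).1 - (P 3).1 := by have := hNP.2.1; omega
  have e : ceilLetter h w K = ray (P 3) r ((N 3).1 - (P 3).1) := by rw [← h3]; exact hNP.2.2
  obtain ⟨-, hbd, hP3⟩ := below_ceilLetter_offTop hK0 (hU.2 P hP 3) hd hr' e
  have hP0 := (hNP.1 0 (by decide)).trans h0
  have hP1 := (hNP.1 1 (by decide)).trans h1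
  have hP2 := (hNP.1 2 (by decide)).trans h2
  rcases (show K + ((N 3).1 - (P 3).1) ≤ μ - 2 ∨ K + ((N 3).1 - (P 3).1) = μ - 1 by omega) with hle | heq
  · exact subDiagP_lowD hU hDN hDP hX hA hGl hGu hΔu hh hc hm1 hmμ le_rfl (by norm_num) (fun _ => le_rfl) (by omega) hle
      hP0 hP1 hP2 hP3 hP
  · rw [heq] at hP3
    exact subDiagP_one_FL hU hDN hDP hX hA hGl hGu hΔu hh hc hm1 hmμ hP0 hP1 hP2 hP3 hP

end subDiag

/-- (N, `d = 1`, `K = μ − 1`, `c ≥ 1`: `N{c·ℓ_φ, L(m), σ_1(u), FL_w}`) MOVE D: `F` descends its own ray; the server is `subDiagP_one_FL` (any `c' ≥ 0`). -/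
theorem subDiagN_one_FL {h μ m c : ℤ} {C : MConfig} (hU : C.InDiamond h) (hDN : ∀ Z ∈ C.lower, RuleDMu4N C Z)
    (hDP : ∀ P ∈ C.upper, RuleDMu4P C P) (hX : XPlusClosed C) (hA : A2IMinusClosed C) (hGl : PermClosed C.lower)
    (hGu : PermClosed C.upper) (hΔu : DeltaClosed C.upper) (hh : h = 2 * μ) (hc : 1 ≤ c) (hm1 : 1 ≤ m) (hmμ : m ≤ μ - 2)
    {N : MCell} {φ v u w : Fin 4} (h0 : N 0 = floorLetter φ c) (h1 : N 1 = nodeTwoLetter v m) (h2 : N 2 = subDiagLetter h u 1)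
    (h3 : N 3 = ceilLetter h w (μ - 1)) : N ∉ C.lower := fun hN => by
  have hfl : OnFloor (N 3) := by rw [h3, ← floorLetter_mu_eq_ceilLetter hh]; exact onFloor_floorLetter w (by omega)
  have hk : Adapted (N 0) φ := by rw [h0]; exact (floorLetter_top φ c).1
  have hk0 : coord (N 0) φ ≠ 0 := by rw [h0, (floorLetter_top φ c).2]; omega
  obtain ⟨r, -, P, hP, hNP⟩ := servedBelow_floor_dir hU hN (hDN N hN) (i := 3) (g := 0) (by decide) hfl hk hk0
  have hd : 0 < (N 0).1 - (P 0).1 := by have := hNP.2.1; omega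
  have e : floorLetter φ c = ray (P 0) r ((N 0).1 - (P 0).1) := by rw [← h0]; exact hNP.2.2
  obtain ⟨-, hdc, hP0⟩ := below_floorLetter_eq (hU.2 P hP 0) (by omega) hd e
  exact subDiagP_one_FL hU hDN hDP hX hA hGl hGu hΔu hh (c := c - ((N 0).1 - (P 0).1)) (by omega) hm1 hmμ hP0
    ((hNP.1 1 (by decide)).trans h1) ((hNP.1 2 (by decide)).trans h2) ((hNP.1 3 (by decide)).trans h3) hP

section subDiag2
variable {h μ m c : ℤ} {C : MConfig} (hU : C.InDiamond h) (hDN : ∀ Z ∈ C.lower, RuleDMu4N C Z)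
    (hDP : ∀ P ∈ C.upper, RuleDMu4P C P) (hX : XPlusClosed C) (hA : A2IMinusClosed C) (hGl : PermClosed C.lower)
    (hGu : PermClosed C.upper) (hΔu : DeltaClosed C.upper) (hh : h = 2 * μ) (hm1 : 1 ≤ m) (hmμ : m ≤ μ - 2)
include hU hDN hDP hX hA hGl hGu hΔu hh hm1 hmμ

/-- (P, `d = 2`, `K = μ − 1`, `c ≥ 1`: `P{c·ℓ_φ, L(m), σ_2(u), FL_w}`) MOVE B: the servers `σ_1` (`subDiagN_one_FL`), `A` (the `A`-row) and
`cu_{u+2}` (the `cu`-child). -/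
theorem subDiagP_two_FL (hc : 1 ≤ c) {P : MCell} {φ v u w : Fin 4} (h0 : P 0 = floorLetter φ c)
    (h1 : P 1 = nodeTwoLetter v m) (h2 : P 2 = subDiagLetter h u 2) (h3 : P 3 = ceilLetter h w (μ - 1)) : P ∉ C.upper := fun hP => by
  have hg : OnCeiling h (P 3) := by rw [h3]; exact onCeiling_ceilLetter h w (by omega)
  obtain ⟨N, hN, hNP, e, he1, he2, hN2⟩ := subDiag_nodeServer hU hP (hDP P hP) (g := 3) (j := 2) (by decide) hg (by norm_num) h2
  have hN0 := (hNP 0 (by decide)).trans h0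
  have hN1 := (hNP 1 (by decide)).trans h1
  have hN3 := (hNP 3 (by decide)).trans h3
  rcases (show 2 - e = 1 ∨ 2 - e = 0 ∨ 2 - e = -1 by omega) with ha | hz | hm
  · rw [ha] at hN2
    exact subDiagN_one_FL hU hDN hDP hX hA hGl hGu hΔu hh hc hm1 hmμ hN0 hN1 hN2 hN3 hN
  · rw [hz, subDiagLetter_zero] at hN2
    exact apexRowN_absent hU hDN hDP hX hA hGl hGu hΔu hh (by omega) hm1 hmμ (K := μ - 1) (by omega) le_rfl hN0 hN1 hN2 hN3 hN
  · rw [hm, subDiagLetter_neg_one] at hN2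
    exact cuChildN_absent hU hDN hDP hX hA hGl hGu hΔu hh (by omega) hm1 hmμ (K := μ - 1) (by omega) le_rfl hN0 hN1 hN2 hN3 hN

/-- (N, `d = 2`, `K ≤ μ − 2`, `c ≥ 1`) MOVE C: the servers are `subDiagP_lowD` (`K' ≤ μ − 2`) or `subDiagP_two_FL`. -/
theorem subDiagN_two (hc : 1 ≤ c) {K : ℤ} (hK0 : 0 ≤ K) (hK : K ≤ μ - 2) {N : MCell} {φ v u w : Fin 4}
    (h0 : N 0 = floorLetter φ c) (h1 : N 1 = nodeTwoLetter v m) (h2 : N 2 = subDiagLetter h u 2) (h3 : N 3 = ceilLetter h w K) :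
    N ∉ C.lower := fun hN => by
  have hfl : OnFloor (N 0) := by rw [h0]; exact onFloor_floorLetter φ (by omega)
  have hk : Adapted (N 3) (w + 2) := by rw [h3]; exact (ceilLetter_node h w K).1
  have hk0 : coord (N 3) (w + 2) ≠ 0 := by rw [h3, (ceilLetter_node h w K).2]; omega
  obtain ⟨r, hr, P, hP, hNP⟩ := servedBelow_floor_dir hU hN (hDN N hN) (i := 0) (g := 3) (by decide) hfl hk hk0
  have hr' : r ≠ w := fun e => hr (e.trans (fin4_add_two_add_two w).symm)
  have hd : 0 < (N 3).1 - (P 3).1 := by have := hNP.2.1; omega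
  have e : ceilLetter h w K = ray (P 3) r ((N 3).1 - (P 3).1) := by rw [← h3]; exact hNP.2.2
  obtain ⟨-, hbd, hP3⟩ := below_ceilLetter_offTop hK0 (hU.2 P hP 3) hd hr' e
  have hP0 := (hNP.1 0 (by decide)).trans h0
  have hP1 := (hNP.1 1 (by decide)).trans h1
  have hP2 := (hNP.1 2 (by decide)).trans h2
  rcases (show K + ((N 3).1 - (P 3).1) ≤ μ - 2 ∨ K + ((N 3).1 - (P 3).1) = μ - 1 by omega) with hle | heq
  · exact subDiagP_lowD hU hDN hDP hX hA hGl hGu hΔu hh (by omega) hm1 hmμ (d := 2) (by norm_num) le_rfl (fun h0c => by omega)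
      (by omega) hle hP0 hP1 hP2 hP3 hP
  · rw [heq] at hP3
    exact subDiagP_two_FL hU hDN hDP hX hA hGl hGu hΔu hh hm1 hmμ hc hP0 hP1 hP2 hP3 hP

/-- (P, `d = 2`, `K ≤ μ − 2`, every `c ≥ 0`) MOVE B: the servers `σ_1` (`subDiagN_one`), `A` (the `A`-row) and `cu_{u+2}`. -/
theorem subDiagP_two (hc : 0 ≤ c) {K : ℤ} (hK0 : 0 ≤ K) (hK : K ≤ μ - 2) {P : MCell} {φ v u w : Fin 4}
    (h0 : P 0 = floorLetter φ c) (h1 : P 1 = nodeTwoLetter v m) (h2 : P 2 = subDiagLetter h u 2) (h3 : P 3 = ceilLetter h w K) :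
    P ∉ C.upper := fun hP => by
  have hg : OnCeiling h (P 3) := by rw [h3]; exact onCeiling_ceilLetter h w (by omega)
  obtain ⟨N, hN, hNP, e, he1, he2, hN2⟩ := subDiag_nodeServer hU hP (hDP P hP) (g := 3) (j := 2) (by decide) hg (by norm_num) h2
  have hN0 := (hNP 0 (by decide)).trans h0
  have hN1 := (hNP 1 (by decide)).trans h1
  have hN3 := (hNP 3 (by decide)).trans h3
  rcases (show 2 - e = 1 ∨ 2 - e = 0 ∨ 2 - e = -1 by omega) with ha | hz | hm
  · rw [ha] at hN2
    exact subDiagN_one hU hDN hDP hX hA hGl hGu hΔu hh hc hm1 hmμ hK0 hK hN0 hN1 hN2 hN3 hN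
  · rw [hz, subDiagLetter_zero] at hN2
    exact apexRowN_absent hU hDN hDP hX hA hGl hGu hΔu hh hc hm1 hmμ hK0 (by omega) hN0 hN1 hN2 hN3 hN
  · rw [hm, subDiagLetter_neg_one] at hN2
    exact cuChildN_absent hU hDN hDP hX hA hGl hGu hΔu hh hc hm1 hmμ hK0 (by omega) hN0 hN1 hN2 hN3 hN

/-- (P, `d = 3`, `K ≤ μ − 2`, `c ≥ 1`) MOVE B: the servers `σ_2` (`subDiagN_two`), `σ_1` (`subDiagN_one`), `A` and `cu_{u+2}`. -/
theorem subDiagP_three (hc : 1 ≤ c) {K : ℤ} (hK0 : 0 ≤ K) (hK : K ≤ μ - 2) {P : MCell} {φ v u w : Fin 4}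
    (h0 : P 0 = floorLetter φ c) (h1 : P 1 = nodeTwoLetter v m) (h2 : P 2 = subDiagLetter h u 3) (h3 : P 3 = ceilLetter h w K) :
    P ∉ C.upper := fun hP => by
  have hg : OnCeiling h (P 3) := by rw [h3]; exact onCeiling_ceilLetter h w (by omega)
  obtain ⟨N, hN, hNP, e, he1, he2, hN2⟩ := subDiag_nodeServer hU hP (hDP P hP) (g := 3) (j := 2) (by decide) hg (by norm_num) h2
  have hN0 := (hNP 0 (by decide)).trans h0
  have hN1 := (hNP 1 (by decide)).trans h1
  have hN3 := (hNP 3 (by decide)).trans h3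
  rcases (show 3 - e = 2 ∨ 3 - e = 1 ∨ 3 - e = 0 ∨ 3 - e = -1 by omega) with hb | ha | hz | hm
  · rw [hb] at hN2
    exact subDiagN_two hU hDN hDP hX hA hGl hGu hΔu hh hm1 hmμ hc hK0 hK hN0 hN1 hN2 hN3 hN
  · rw [ha] at hN2
    exact subDiagN_one hU hDN hDP hX hA hGl hGu hΔu hh (by omega) hm1 hmμ hK0 hK hN0 hN1 hN2 hN3 hN
  · rw [hz, subDiagLetter_zero] at hN2
    exact apexRowN_absent hU hDN hDP hX hA hGl hGu hΔu hh (by omega) hm1 hmμ hK0 (by omega) hN0 hN1 hN2 hN3 hN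
  · rw [hm, subDiagLetter_neg_one] at hN2
    exact cuChildN_absent hU hDN hDP hX hA hGl hGu hΔu hh (by omega) hm1 hmμ hK0 (by omega) hN0 hN1 hN2 hN3 hN

end subDiag2

/-! ### §3d T4 assembled -/

/-- **T4, level `P`.** `P{c·ℓ_φ, 2I + m·ℓ_v, σ_d(u), y(w, K)} ∉ C.upper` [◇_h, RULE D, X⁺, A2I⁻, `S₄` on both levels, `Δ` on E₊, `h = 2μ`] for `c ≥ 0`,
`1 ≤ m ≤ μ − 2`, `d ≥ 1`, `0 ≤ K ≤ μ − 1` in the ADMISSIBLE RANGE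
`[K ≤ 2 ∧ d ≤ μ − 2 ∧ (c = 0 → K ≤ 1)] ∨ [K ≤ μ − 2 ∧ d ≤ 3 ∧ (c = 0 → d ≤ 2)] ∨ [d ≤ 2 ∧ (c = 0 → d ≤ 1)]`; 0 survivors (`tools/famY.py`). -/
theorem subDiagTowerP_absent {h μ m c d K : ℤ} {C : MConfig} (hU : C.InDiamond h) (hDN : ∀ Z ∈ C.lower, RuleDMu4N C Z)
    (hDP : ∀ P ∈ C.upper, RuleDMu4P C P) (hX : XPlusClosed C) (hA : A2IMinusClosed C) (hGl : PermClosed C.lower)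
    (hGu : PermClosed C.upper) (hΔu : DeltaClosed C.upper) (hh : h = 2 * μ) (hc : 0 ≤ c) (hm1 : 1 ≤ m) (hmμ : m ≤ μ - 2)
    (hd1 : 1 ≤ d) (hK0 : 0 ≤ K) (hK : K ≤ μ - 1)
    (hadm : (K ≤ 2 ∧ d ≤ μ - 2 ∧ (c = 0 → K ≤ 1)) ∨ (K ≤ μ - 2 ∧ d ≤ 3 ∧ (c = 0 → d ≤ 2)) ∨ (d ≤ 2 ∧ (c = 0 → d ≤ 1)))
    {P : MCell} {φ v u w : Fin 4} (h0 : P 0 = floorLetter φ c) (h1 : P 1 = nodeTwoLetter v m) (h2 : P 2 = subDiagLetter h u d)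
    (h3 : P 3 = ceilLetter h w K) : P ∉ C.upper := by
  rcases hadm with ⟨hK2, hdμ, hKc⟩ | ⟨hKμ, hd3, hdc⟩ | ⟨hd2, hdc⟩
  · exact subDiagP_lowK hU hDN hDP hX hA hGl hGu hΔu hh hc hm1 hmμ hd1 hdμ hK0 hK2 hKc h0 h1 h2 h3
  · rcases (show d = 1 ∨ d = 2 ∨ d = 3 by omega) with e1 | e2 | e3
    · subst e1; exact subDiagP_lowD hU hDN hDP hX hA hGl hGu hΔu hh hc hm1 hmμ le_rfl (by norm_num) (fun _ => le_rfl) hK0 hKμ h0 h1 h2 h3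
    · subst e2; exact subDiagP_two hU hDN hDP hX hA hGl hGu hΔu hh hm1 hmμ hc hK0 hKμ h0 h1 h2 h3
    · subst e3; exact subDiagP_three hU hDN hDP hX hA hGl hGu hΔu hh hm1 hmμ (by omega) hK0 hKμ h0 h1 h2 h3
  · rcases (show K ≤ μ - 2 ∨ K = μ - 1 by omega) with hKμ | hKe
    · exact subDiagP_lowD hU hDN hDP hX hA hGl hGu hΔu hh hc hm1 hmμ hd1 hd2 hdc hK0 hKμ h0 h1 h2 h3
    · subst hKe
      rcases (show d = 1 ∨ d = 2 by omega) with e1 | e2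
      · subst e1; exact subDiagP_one_FL hU hDN hDP hX hA hGl hGu hΔu hh hc hm1 hmμ h0 h1 h2 h3
      · subst e2; exact subDiagP_two_FL hU hDN hDP hX hA hGl hGu hΔu hh hm1 hmμ (by omega) h0 h1 h2 h3

/-- **T4, level `N`.** `N{c·ℓ_φ, 2I + m·ℓ_v, σ_d(u), y(w, K)} ∉ C.lower` [same] for `c ≥ 0`, `1 ≤ m ≤ μ − 2`, `1 ≤ d ≤ μ − 2`, `0 ≤ K ≤ μ − 1` in the
ADMISSIBLE RANGE `[K ≤ μ − 2 ∧ d ≤ 2 ∧ (c = 0 → d ≤ 1)] ∨ [d = 1 ∧ 1 ≤ c]` (so `d ≤ 2`).  Census: file header; 0 survivors. -/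
theorem subDiagTowerN_absent {h μ m c d K : ℤ} {C : MConfig} (hU : C.InDiamond h) (hDN : ∀ Z ∈ C.lower, RuleDMu4N C Z)
    (hDP : ∀ P ∈ C.upper, RuleDMu4P C P) (hX : XPlusClosed C) (hA : A2IMinusClosed C) (hGl : PermClosed C.lower)
    (hGu : PermClosed C.upper) (hΔu : DeltaClosed C.upper) (hh : h = 2 * μ) (hc : 0 ≤ c) (hm1 : 1 ≤ m) (hmμ : m ≤ μ - 2)
    (hd1 : 1 ≤ d) (hK0 : 0 ≤ K) (hK : K ≤ μ - 1)
    (hadm : (K ≤ μ - 2 ∧ d ≤ 2 ∧ (c = 0 → d ≤ 1)) ∨ (d = 1 ∧ 1 ≤ c))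
    {N : MCell} {φ v u w : Fin 4} (h0 : N 0 = floorLetter φ c) (h1 : N 1 = nodeTwoLetter v m) (h2 : N 2 = subDiagLetter h u d)
    (h3 : N 3 = ceilLetter h w K) : N ∉ C.lower := by
  rcases hadm with ⟨hKμ, hd2, hdc⟩ | ⟨hd, hc1⟩
  · rcases (show d = 1 ∨ d = 2 by omega) with e1 | e2
    · subst e1; exact subDiagN_one hU hDN hDP hX hA hGl hGu hΔu hh hc hm1 hmμ hK0 hKμ h0 h1 h2 h3
    · subst e2; exact subDiagN_two hU hDN hDP hX hA hGl hGu hΔu hh hm1 hmμ (by omega) hK0 hKμ h0 h1 h2 h3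
  · subst hd
    rcases (show K ≤ μ - 2 ∨ K = μ - 1 by omega) with hKμ | hKe
    · exact subDiagN_one hU hDN hDP hX hA hGl hGu hΔu hh hc hm1 hmμ hK0 hKμ h0 h1 h2 h3
    · subst hKe; exact subDiagN_one_FL hU hDN hDP hX hA hGl hGu hΔu hh hc1 hm1 hmμ h0 h1 h2 h3

/-! ## §4  T5 — THE TWO-FLOOR-LETTER `cu`-TOWER `{c·ℓ_φ, c′·ℓ_u, 2I + m·ℓ_v, cu_w}` (both levels, every charge, all phases)

`F = c·ℓ_φ` (`c ≥ 0`), `F′ = c′·ℓ_u` (`1 ≤ c′ ≤ μ − 1`; primed forms `c′ ≤ μ`), `L(m)` (`1 ≤ m ≤ μ − 2`), `cu_w`.  ONE ℕ-induction `twoFloor_aux` on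
`c + (μ − c′) + m`: level `P` — the pin `cu_w` raises `F′` along its floor line to `(c′+e)·ℓ_u` (top: the `FL` edge of T3); level `N`, `c ≥ 1` —
the pin `F′` lowers `F` along its ray; `c = 0` — `F′` lowers `L(m)` along its line to `L(m−d)`, `2I` (§2b), `ℓ_{v+2}` (F2⁺).  No corner excluded;
with any `X ≠ L(m)` the rows `{c·ℓ, c′·ℓ, X, cu}` (`c, c′ ≥ 2`) are deep.  Census (`tools/famZ.py`): members ◇₆ 608 ∕ ◇₈ 2 208 ∕ ◇₁₀ 5 184,
0 SURVIVORS; NEW ◇₆ 16 ∕ ◇₈ 496 ∕ ◇₁₀ 2 504 (r2 488, r3 1 215, r4 583, r5 206, r6 12). -/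

/-! ### §4a slot bookkeeping and the floor line -/

/-- `S₄` on E₋, the transposition of slots `1` and `2`. -/
theorem perm12_lower {C : MConfig} (hGl : PermClosed C.lower) {N : MCell} (hN : N ∈ C.lower) :
    N.perm (Equiv.swap (1 : Fin 4) 2) ∈ C.lower ∧ N.perm (Equiv.swap (1 : Fin 4) 2) 0 = N 0 ∧ N.perm (Equiv.swap (1 : Fin 4) 2) 1 = N 2 ∧
      N.perm (Equiv.swap (1 : Fin 4) 2) 2 = N 1 ∧ N.perm (Equiv.swap (1 : Fin 4) 2) 3 = N 3 :=
  ⟨hGl _ N hN, by show N (Equiv.swap (1 : Fin 4) 2 0) = _; simp [Equiv.swap_apply_of_ne_of_ne],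
    by show N (Equiv.swap (1 : Fin 4) 2 1) = _; rw [Equiv.swap_apply_left],
    by show N (Equiv.swap (1 : Fin 4) 2 2) = _; rw [Equiv.swap_apply_right],
    by show N (Equiv.swap (1 : Fin 4) 2 3) = _; simp [Equiv.swap_apply_of_ne_of_ne]⟩

/-- `S₄` on E₊, the transposition of slots `1` and `2`. -/
theorem perm12_upper {C : MConfig} (hGu : PermClosed C.upper) {P : MCell} (hP : P ∈ C.upper) :
    P.perm (Equiv.swap (1 : Fin 4) 2) ∈ C.upper ∧ P.perm (Equiv.swap (1 : Fin 4) 2) 0 = P 0 ∧ P.perm (Equiv.swap (1 : Fin 4) 2) 1 = P 2 ∧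
      P.perm (Equiv.swap (1 : Fin 4) 2) 2 = P 1 ∧ P.perm (Equiv.swap (1 : Fin 4) 2) 3 = P 3 :=
  ⟨hGu _ P hP, by show P (Equiv.swap (1 : Fin 4) 2 0) = _; simp [Equiv.swap_apply_of_ne_of_ne],
    by show P (Equiv.swap (1 : Fin 4) 2 1) = _; rw [Equiv.swap_apply_left],
    by show P (Equiv.swap (1 : Fin 4) 2 2) = _; rw [Equiv.swap_apply_right],
    by show P (Equiv.swap (1 : Fin 4) 2 3) = _; simp [Equiv.swap_apply_of_ne_of_ne]⟩

/-- the FLOOR LINE: `e` null steps above `c·ℓ_u` along `u` is `(c + e)·ℓ_u`. -/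
theorem ray_floorLetter_line (u : Fin 4) (c e : ℤ) : ray (floorLetter u c) u e = floorLetter u (c + e) := (ray_add _ u c e).symm

/-- a floor letter `c·ℓ_u` (`c ≥ 0`) of ◇_h has `2c ≤ h`. -/
theorem two_mul_le_of_floorLetter_inDiamond {h c : ℤ} {u : Fin 4} (hc : 0 ≤ c) (hz : InDiamond h (floorLetter u c)) : 2 * c ≤ h := by
  have := hz.2.2.2
  rw [show floorLetter u c = ray ((0, 0, 0) : BPoint) u c from rfl, top_ray_apex 0 u hc] at this
  omega

/-- a floor letter is not the apex `hI` when `c ≠ h`. -/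
theorem floorLetter_ne_hI {h c : ℤ} (u : Fin 4) (hc : c ≠ h) : floorLetter u c ≠ (h, 0, 0) := fun e => by
  have := congrArg Prod.fst e; rw [floorLetter_fst] at this; exact hc this

/-! ### §4b the induction -/

/-- **T5 engine**: both levels of the two-floor-letter `cu`-tower at once, by induction on `c + (μ − c′) + m`. -/
theorem twoFloor_aux {h μ : ℤ} {C : MConfig} (hU : C.InDiamond h) (hDN : ∀ Z ∈ C.lower, RuleDMu4N C Z)
    (hDP : ∀ P ∈ C.upper, RuleDMu4P C P) (hX : XPlusClosed C) (hA : A2IMinusClosed C) (hGl : PermClosed C.lower)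
    (hGu : PermClosed C.upper) (hΔu : DeltaClosed C.upper) (hh : h = 2 * μ) :
    ∀ n : ℕ, ∀ (c c' m : ℤ), c + (μ - c') + m ≤ n → 0 ≤ c → 1 ≤ c' → c' ≤ μ - 1 → 1 ≤ m → m ≤ μ - 2 →
      (∀ (φ u v w : Fin 4), ∀ P ∈ C.upper, P 0 = floorLetter φ c → P 1 = floorLetter u c' → P 2 = nodeTwoLetter v m →
          P 3 = ceilingUnit h w → False) ∧
      (∀ (φ u v w : Fin 4), ∀ N ∈ C.lower, N 0 = floorLetter φ c → N 1 = floorLetter u c' → N 2 = nodeTwoLetter v m →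
          N 3 = ceilingUnit h w → False) := by
  intro n
  induction n with
  | zero => intro c c' m hn hc0 hc1 hcμ hm1 hmμ; exact absurd hn (by omega)
  | succ n ih =>
    intro c c' m hn hc0 hc1 hcμ hm1 hmμ
    refine ⟨fun φ u v w P hP h0 h1 h2 h3 => ?_, fun φ u v w N hN h0 h1 h2 h3 => ?_⟩
    · -- level P: under the pin `cu_w` (slot 3) the floor letter `c′·ℓ_u` (slot 1) is served above along its floor line `u`
      have hna : ¬ isApex (P 1) := by rw [h1]; exact floorLetter_not_isApex u (by omega)
      have hk : Adapted (P 1) u := by rw [h1]; exact (floorLetter_top u c').1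
      have hkh : coord (P 1) u ≠ h := by rw [h1, (floorLetter_top u c').2]; omega
      obtain ⟨N, hN, hNP⟩ := upLine_of_ruleDMu4P hU hP (hDP P hP) (g := 3) (j := 1) (by decide)
        (by rw [h3]; exact onCeiling_ceilingUnit h w) hna hk hkh
      obtain ⟨e, he⟩ : ∃ e, e = (N 1).1 - (P 1).1 := ⟨_, rfl⟩
      have he0 : 0 < e := by have := hNP.2.1; omega
      have hN1 : N 1 = floorLetter u (c' + e) := by rw [hNP.2.2, ← he, h1]; exact ray_floorLetter_line u c' e
      have htop : 2 * (c' + e) ≤ h := two_mul_le_of_floorLetter_inDiamond (by omega) (by rw [← hN1]; exact hU.1 N hN 1)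
      have hN0 : N 0 = floorLetter φ c := (hNP.1 0 (by decide)).symm.trans h0
      have hN2 : N 2 = nodeTwoLetter v m := (hNP.1 2 (by decide)).symm.trans h2
      have hN3 : N 3 = ceilingUnit h w := (hNP.1 3 (by decide)).symm.trans h3
      rcases (show c' + e ≤ μ - 1 ∨ c' + e = μ by omega) with hlt | hfl
      · exact (ih c (c' + e) m (by omega) hc0 (by omega) hlt hm1 hmμ).2 φ u v w N hN hN0 hN1 hN2 hN3
      · -- the top server `N{F, FL_u, L(m), cu_w}` is the `FL` edge of T3 (slots 1, 2 transposed)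
        rw [hfl] at hN1
        obtain ⟨hN', e0, e1, e2, e3⟩ := perm12_lower hGl hN
        exact floorEdgeTowerN_absent hU hDN hDP hX hA hGl hGu hΔu hh hc0 hm1 hmμ (K := 0) le_rfl (by norm_num) (fun _ => le_rfl)
          (e0.trans hN0) (e1.trans hN2) (e2.trans hN1) (e3.trans (hN3.trans (ceilLetter_zero h w).symm)) hN'
    · have hfl : OnFloor (N 1) := by rw [h1]; exact onFloor_floorLetter u (by omega)
      rcases (show c = 0 ∨ 1 ≤ c by omega) with hcz | hc1'
      · -- the corner `N{O, c′·ℓ_u, L(m), cu_w}`: under the floor pin `c′·ℓ_u`, `L(m)` (slot 2) is served below along its own line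
        subst hcz
        have hO : N 0 = (0, 0, 0) := h0.trans (ray_zero _ φ)
        have hk : Adapted (N 2) v := by rw [h2]; exact (nodeTwoLetter_top v m).1
        have hk0 : coord (N 2) v ≠ 0 := by rw [h2, (nodeTwoLetter_top v m).2]; omega
        obtain ⟨r, hr, P, hP, hNP⟩ := servedBelow_floor_dir hU hN (hDN N hN) (i := 1) (g := 2) (by decide) hfl hk hk0
        have hd : 0 < (N 2).1 - (P 2).1 := by have := hNP.2.1; omega
        have e : nodeTwoLetter v m = ray (P 2) r ((N 2).1 - (P 2).1) := by rw [← h2]; exact hNP.2.2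
        obtain ⟨-, hdm, hP2⟩ := below_nodeTwo_line hm1 (hU.2 P hP 2) hd hr e
        have hP0 : P 0 = (0, 0, 0) := (hNP.1 0 (by decide)).trans hO
        have hP1 : P 1 = floorLetter u c' := (hNP.1 1 (by decide)).trans h1
        have hP3 : P 3 = ceilingUnit h w := (hNP.1 3 (by decide)).trans h3
        rcases (show 1 ≤ m - ((N 2).1 - (P 2).1) ∨ m - ((N 2).1 - (P 2).1) = 0 ∨ m - ((N 2).1 - (P 2).1) = -1 by omega)
          with hge | hze | hneg
        · exact (ih 0 c' (m - ((N 2).1 - (P 2).1)) (by omega) le_rfl hc1 hcμ hge (by omega)).1 φ u v w P hP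
            (hP0.trans (ray_zero _ φ).symm) hP1 hP2 hP3
        · rw [hze] at hP2
          obtain ⟨hP', e0, e1, e2, e3⟩ := perm12_upper hGu hP
          exact originApexTwo_P_absent hU hDN hDP hX hA hGl hGu hΔu (by rw [e2, hP1]; exact floorLetter_ne_hI u (by omega))
            (e0.trans hP0) (e1.trans (hP2.trans (ray_zero _ v))) (e3.trans hP3) hP'
        · rw [hneg, nodeTwoLetter_neg_one] at hP2
          obtain ⟨hP', e0, e1, -, e3⟩ := perm12_upper hGu hP
          exact originUnitFree_P_absent' hU hDN hDP hX hA hGl hGu hΔu (e0.trans hP0) (e1.trans hP2) (e3.trans hP3) hP'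
      · -- `c ≥ 1`: under the floor pin `c′·ℓ_u`, `F = c·ℓ_φ` (slot 0) is served below along its own ray
        have hk : Adapted (N 0) φ := by rw [h0]; exact (floorLetter_top φ c).1
        have hk0 : coord (N 0) φ ≠ 0 := by rw [h0, (floorLetter_top φ c).2]; omega
        obtain ⟨r, -, P, hP, hNP⟩ := servedBelow_floor_dir hU hN (hDN N hN) (i := 1) (g := 0) (by decide) hfl hk hk0
        have hd : 0 < (N 0).1 - (P 0).1 := by have := hNP.2.1; omega
        have e : floorLetter φ c = ray (P 0) r ((N 0).1 - (P 0).1) := by rw [← h0]; exact hNP.2.2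
        obtain ⟨-, hdc, hP0⟩ := below_floorLetter_eq (hU.2 P hP 0) hc0 hd e
        exact (ih (c - ((N 0).1 - (P 0).1)) c' m (by omega) (by omega) hc1 hcμ hm1 hmμ).1 φ u v w P hP hP0
          ((hNP.1 1 (by decide)).trans h1) ((hNP.1 2 (by decide)).trans h2) ((hNP.1 3 (by decide)).trans h3)

/-! ### §4c the theorems -/

/-- **T5, level `P`.** `P{c·ℓ_φ, c′·ℓ_u, 2I + m·ℓ_v, cu_w} ∉ C.upper` for `c ≥ 0`, `1 ≤ c′ ≤ μ − 1`, `1 ≤ m ≤ μ − 2`, ALL phases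
[◇_h, RULE D, X⁺, A2I⁻, `S₄` on both levels, `Δ` on E₊].  Census (tag ZP): 0 survivors; new ◇₈ 144 ∕ ◇₁₀ 1 232 (`c′ = μ` is `floorEdgeTowerP_absent`). -/
theorem twoFloorTowerP_absent {h μ c c' m : ℤ} {C : MConfig} (hU : C.InDiamond h) (hDN : ∀ Z ∈ C.lower, RuleDMu4N C Z)
    (hDP : ∀ P ∈ C.upper, RuleDMu4P C P) (hX : XPlusClosed C) (hA : A2IMinusClosed C) (hGl : PermClosed C.lower)
    (hGu : PermClosed C.upper) (hΔu : DeltaClosed C.upper) (hh : h = 2 * μ) (hc : 0 ≤ c) (hc1 : 1 ≤ c') (hcμ : c' ≤ μ - 1)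
    (hm1 : 1 ≤ m) (hmμ : m ≤ μ - 2) {P : MCell} {φ u v w : Fin 4} (h0 : P 0 = floorLetter φ c) (h1 : P 1 = floorLetter u c')
    (h2 : P 2 = nodeTwoLetter v m) (h3 : P 3 = ceilingUnit h w) : P ∉ C.upper := fun hP =>
  (twoFloor_aux hU hDN hDP hX hA hGl hGu hΔu hh (c + (μ - c') + m).toNat c c' m (Int.self_le_toNat _) hc hc1 hcμ hm1 hmμ).1 φ u v w
    P hP h0 h1 h2 h3

/-- **T5, level `N`.** `N{c·ℓ_φ, c′·ℓ_u, 2I + m·ℓ_v, cu_w} ∉ C.lower` for `c ≥ 0`, `1 ≤ c′ ≤ μ − 1`, `1 ≤ m ≤ μ − 2`, ALL phases [same].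
Census (tag ZN): ◇₆ 304 ∕ ◇₈ 1 104 ∕ ◇₁₀ 2 592 member orbits, 0 survivors; new ◇₆ 16 ∕ ◇₈ 352 ∕ ◇₁₀ 1 272. -/
theorem twoFloorTowerN_absent {h μ c c' m : ℤ} {C : MConfig} (hU : C.InDiamond h) (hDN : ∀ Z ∈ C.lower, RuleDMu4N C Z)
    (hDP : ∀ P ∈ C.upper, RuleDMu4P C P) (hX : XPlusClosed C) (hA : A2IMinusClosed C) (hGl : PermClosed C.lower)
    (hGu : PermClosed C.upper) (hΔu : DeltaClosed C.upper) (hh : h = 2 * μ) (hc : 0 ≤ c) (hc1 : 1 ≤ c') (hcμ : c' ≤ μ - 1)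
    (hm1 : 1 ≤ m) (hmμ : m ≤ μ - 2) {N : MCell} {φ u v w : Fin 4} (h0 : N 0 = floorLetter φ c) (h1 : N 1 = floorLetter u c')
    (h2 : N 2 = nodeTwoLetter v m) (h3 : N 3 = ceilingUnit h w) : N ∉ C.lower := fun hN =>
  (twoFloor_aux hU hDN hDP hX hA hGl hGu hΔu hh (c + (μ - c') + m).toNat c c' m (Int.self_le_toNat _) hc hc1 hcμ hm1 hmμ).2 φ u v w
    N hN h0 h1 h2 h3

/-- **T5, the symmetric form** (both floor letters charged, either may reach `FL`): `{c·ℓ_φ, c′·ℓ_u, 2I + m·ℓ_v, cu_w} ∉ E_±` for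
`1 ≤ c ≤ μ`, `1 ≤ c′ ≤ μ`, not both `= μ` … stated for `P` with `c′ ≤ μ`: the case `c′ = μ` is the T3 edge. -/
theorem twoFloorTowerP_absent' {h μ c c' m : ℤ} {C : MConfig} (hU : C.InDiamond h) (hDN : ∀ Z ∈ C.lower, RuleDMu4N C Z)
    (hDP : ∀ P ∈ C.upper, RuleDMu4P C P) (hX : XPlusClosed C) (hA : A2IMinusClosed C) (hGl : PermClosed C.lower)
    (hGu : PermClosed C.upper) (hΔu : DeltaClosed C.upper) (hh : h = 2 * μ) (hc : 0 ≤ c) (hc1 : 1 ≤ c') (hcμ : c' ≤ μ)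
    (hm1 : 1 ≤ m) (hmμ : m ≤ μ - 2) {P : MCell} {φ u v w : Fin 4} (h0 : P 0 = floorLetter φ c) (h1 : P 1 = floorLetter u c')
    (h2 : P 2 = nodeTwoLetter v m) (h3 : P 3 = ceilingUnit h w) : P ∉ C.upper := fun hP => by
  rcases (show c' ≤ μ - 1 ∨ c' = μ by omega) with hlt | hfl
  · exact twoFloorTowerP_absent hU hDN hDP hX hA hGl hGu hΔu hh hc hc1 hlt hm1 hmμ h0 h1 h2 h3 hP
  · subst hfl
    obtain ⟨hP', e0, e1, e2, e3⟩ := perm12_upper hGu hP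
    exact floorEdgeTowerP_absent hU hDN hDP hX hA hGl hGu hΔu hh hc hm1 hmμ (K := 0) le_rfl (by norm_num) (fun _ => by norm_num)
      (e0.trans h0) (e1.trans h2) (e2.trans h1) (e3.trans (h3.trans (ceilLetter_zero h w).symm)) hP'

/-- the same at level `N` (`c′ = μ` is `floorEdgeTowerN_absent`). -/
theorem twoFloorTowerN_absent' {h μ c c' m : ℤ} {C : MConfig} (hU : C.InDiamond h) (hDN : ∀ Z ∈ C.lower, RuleDMu4N C Z)
    (hDP : ∀ P ∈ C.upper, RuleDMu4P C P) (hX : XPlusClosed C) (hA : A2IMinusClosed C) (hGl : PermClosed C.lower)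
    (hGu : PermClosed C.upper) (hΔu : DeltaClosed C.upper) (hh : h = 2 * μ) (hc : 0 ≤ c) (hc1 : 1 ≤ c') (hcμ : c' ≤ μ)
    (hm1 : 1 ≤ m) (hmμ : m ≤ μ - 2) {N : MCell} {φ u v w : Fin 4} (h0 : N 0 = floorLetter φ c) (h1 : N 1 = floorLetter u c')
    (h2 : N 2 = nodeTwoLetter v m) (h3 : N 3 = ceilingUnit h w) : N ∉ C.lower := fun hN => by
  rcases (show c' ≤ μ - 1 ∨ c' = μ by omega) with hlt | hfl
  · exact twoFloorTowerN_absent hU hDN hDP hX hA hGl hGu hΔu hh hc hc1 hlt hm1 hmμ h0 h1 h2 h3 hN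
  · subst hfl
    obtain ⟨hN', e0, e1, e2, e3⟩ := perm12_lower hGl hN
    exact floorEdgeTowerN_absent hU hDN hDP hX hA hGl hGu hΔu hh hc hm1 hmμ (K := 0) le_rfl (by norm_num) (fun _ => le_rfl)
      (e0.trans h0) (e1.trans h2) (e2.trans h1) (e3.trans (h3.trans (ceilLetter_zero h w).symm)) hN'

/-! ## §5 T6 — the SECOND SUB-DIAGONAL `a + 2c = h − 4`: the `B = (h−4)·I` rows, the `τ_1` `P`-rows, the origin `τ`-column

`τ_d(u) := tauLetter h u d = (h − 4 − 2d)·I + d·ℓ_u` (`τ_0 = B`, `τ_{−1} = σ_1(u+2)`, `τ_{−2} = y(u+2, 1)`, `τ_{μ−2} = (μ−2)·ℓ_u`); top frame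
`u` (coordinate `h − 4`), node frame `u + 2` (coordinate `h − 4 − 2d`).  MOVES (RULE D with a pin, as in §3): (A′) under a ceiling pin `τ_d(u)`
climbs its TOP line — to `σ_{d+1}(u)` or `y(u, d+1)` (`above_tau_top`, `tau_upServer`); (B′) or its NODE line — to `τ_{d−e}(u)`, `1 ≤ e ≤ d + 2`
(`above_tau_node`, `tau_nodeServer`); (B″) the apex `B` climbs in some direction `r` to `σ_1(r)` or `y(r, 1)` (`above_apexHm4`, `bApex_upServer`);
(C) under the floor pin `F`, `y(w, K)` slides outward to `y(w, K')` (`K' = μ − 1` wants `c ≥ 1` at level `P`); (D′) in `N{O, L(m), X, cu_w}` the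
pin `O` lowers `L(m)` to `L(m')`, `2I` (§2b, `X ≠ hI`) or `ℓ_{v+2}` (F2⁺).  Every child is T3 ∕ T4 ∕ the `FL` edge ∕ §2b ∕ F2⁺ ∕ a row of this §.
NOT closed by these moves (RULE-D-circular, memo §4): `N{c·ℓ, L(m), τ_d, cu}`, `d ≤ μ − 5` (`d = μ − 4`: §6), and the `P`-rows `τ_d`,
`2 ≤ d ≤ μ − 4`.  Census (`tools/famAA.py 4 6 8 10`, control g23): member orbits ◇₆ 614 ∕ ◇₈ 2 280 ∕ ◇₁₀ 6 318, 0 SURVIVORS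
at every `h`; NEW ◇₆ 158 ∕ ◇₈ 1 272 ∕ ◇₁₀ 5 518 (◇₁₀: r2 16, r3 1 075, r4 1 265, r5 1 623, r6 1 539). -/

/-- the letter `τ_d(u) = (h − 4 − 2d)·I + d·ℓ_u` of the second sub-diagonal `a + 2c = h − 4` (`τ_0 = B = (h−4)·I`, `τ_{−1} = σ_1(u+2)`,
`τ_{−2} = y(u+2, 1)`). -/
abbrev tauLetter (h : ℤ) (u : Fin 4) (d : ℤ) : BPoint := ray ((h - 4 - 2 * d, 0, 0) : BPoint) u d

theorem tauLetter_top (h : ℤ) (u : Fin 4) (d : ℤ) : Adapted (tauLetter h u d) u ∧ coord (tauLetter h u d) u = h - 4 := by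
  refine ⟨(adapted_ray_apex _ u d).1, ?_⟩
  rw [coord_ray_self, coord_of_isApex ⟨rfl, rfl⟩]; ring

theorem tauLetter_node (h : ℤ) (u : Fin 4) (d : ℤ) :
    Adapted (tauLetter h u d) (u + 2) ∧ coord (tauLetter h u d) (u + 2) = h - 4 - 2 * d :=
  ⟨(adapted_ray_apex _ u _).2, coord_ray_apex_antip _ u _⟩

theorem tauLetter_not_isApex {h d : ℤ} (u : Fin 4) (hd : d ≠ 0) : ¬ isApex (tauLetter h u d) := by
  fin_cases u <;> simp [ray, isApex, hd]

theorem tauLetter_ne_hI {h d : ℤ} (u : Fin 4) (hd : d ≠ 0) : tauLetter h u d ≠ (h, 0, 0) := fun e =>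
  tauLetter_not_isApex u hd (by rw [e]; exact ⟨rfl, rfl⟩)

theorem tauLetter_zero (h : ℤ) (u : Fin 4) : tauLetter h u 0 = (h - 4, 0, 0) := by
  fin_cases u <;> simp [ray]

theorem tauLetter_neg_one (h : ℤ) (u : Fin 4) : tauLetter h u (-1) = subDiagLetter h (u + 2) 1 := by
  fin_cases u <;> simp [ray] <;> omega

theorem tauLetter_neg_two (h : ℤ) (u : Fin 4) : tauLetter h u (-2) = ceilLetter h (u + 2) 1 := by
  fin_cases u <;> simp [ray] <;> omega

/-- `τ_{μ−2}(u) = (μ−2)·ℓ_u` (a T5 row). -/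
theorem tauLetter_floor {h μ : ℤ} (hh : h = 2 * μ) (u : Fin 4) : tauLetter h u (μ - 2) = floorLetter u (μ - 2) := by
  subst hh; fin_cases u <;> simp [ray] <;> omega

/-- the node ray of `τ_d(u)`: `τ_d(u) + e·ℓ_{u+2} = τ_{d−e}(u)`. -/
theorem ray_tau_node (h d e : ℤ) (u : Fin 4) : ray (tauLetter h u d) (u + 2) e = tauLetter h u (d - e) := by
  fin_cases u <;> simp [ray] <;> omega

/-- `τ_c(u)` read from the apex `B`: `τ_c(u) = ray B (u+2) (−c)`. -/
theorem tauLetter_flip (h c : ℤ) (u : Fin 4) : tauLetter h u c = ray ((h - 4, 0, 0) : BPoint) (u + 2) (-c) := by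
  fin_cases u <;> simp [ray] <;> omega

theorem subDiagLetter_succ (h d : ℤ) (u : Fin 4) : subDiagLetter h u (d + 1) = ray ((h - 4 - 2 * d, 0, 0) : BPoint) u (d + 1) := by
  fin_cases u <;> simp [ray] <;> omega

theorem ceilLetter_succ (h d : ℤ) (u : Fin 4) : ceilLetter h u (d + 1) = ray ((h - 4 - 2 * d, 0, 0) : BPoint) u (d + 2) := by
  fin_cases u <;> simp [ray] <;> omega

theorem apexHm4_ne_hI (h : ℤ) : ((h - 4, 0, 0) : BPoint) ≠ (h, 0, 0) := fun e =>
  absurd (congrArg Prod.fst e : h - 4 = h) (by omega)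

/-- ABOVE `τ_d(u)` (`d ≥ 0`) along its TOP direction `u` in ◇_h: `σ_{d+1}(u)` (one step) or `y(u, d+1)` (two steps, onto the ceiling). -/
theorem above_tau_top {h d e : ℤ} {z : BPoint} {u : Fin 4} (hd : 0 ≤ d) (hz : InDiamond h z) (he : 0 < e)
    (heq : z = ray (tauLetter h u d) u e) : (e = 1 ∧ z = subDiagLetter h u (d + 1)) ∨ (e = 2 ∧ z = ceilLetter h u (d + 1)) := by
  have hz' : z = ray ((h - 4 - 2 * d, 0, 0) : BPoint) u (d + e) := heq.trans (ray_add _ u d e).symm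
  have htop := hz.2.2.2
  rw [hz', top_ray_apex (h - 4 - 2 * d) u (by omega)] at htop
  rcases (show e = 1 ∨ e = 2 by omega) with e1 | e2
  · subst e1; exact Or.inl ⟨rfl, hz'.trans (subDiagLetter_succ h d u).symm⟩
  · subst e2; exact Or.inr ⟨rfl, hz'.trans (ceilLetter_succ h d u).symm⟩

/-- ABOVE `τ_d(u)` along its NODE direction `u + 2` in ◇_h: `τ_{d−e}(u)` with `e ≤ d + 2`. -/
theorem above_tau_node {h d e : ℤ} {z : BPoint} {u : Fin 4} (hz : InDiamond h z)
    (heq : z = ray (tauLetter h u d) (u + 2) e) : e ≤ d + 2 ∧ z = tauLetter h u (d - e) := by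
  have hz' : z = tauLetter h u (d - e) := heq.trans (ray_tau_node h d e u)
  refine ⟨?_, hz'⟩
  by_contra hlt
  have htop := hz.2.2.2
  rw [hz', tauLetter_flip, top_ray_apex (h - 4) (u + 2) (by omega)] at htop
  omega

/-- ABOVE the apex `B = (h−4)·I` in direction `r` in ◇_h: `σ_1(r)` or `y(r, 1)`. -/
theorem above_apexHm4 {h e : ℤ} {z : BPoint} {r : Fin 4} (he : 0 < e) (hz : InDiamond h z)
    (hze : z = ray ((h - 4, 0, 0) : BPoint) r e) : (e = 1 ∧ z = subDiagLetter h r 1) ∨ (e = 2 ∧ z = ceilLetter h r 1) := by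
  have e0 : z = ray (tauLetter h r 0) r e := by rw [tauLetter_zero]; exact hze
  rcases above_tau_top le_rfl hz he e0 with ⟨h1, hz1⟩ | ⟨h2, hz2⟩
  · exact Or.inl ⟨h1, hz1.trans (by rw [zero_add])⟩
  · exact Or.inr ⟨h2, hz2.trans (by rw [zero_add])⟩

/-! ### §5a the servers of `τ_d(u)` and of the apex `B` -/

/-- MOVE A′: in a `P`-cell with a ceiling letter at slot `g` and `τ_d(u)` (`d ≥ 1`) at slot `j ≠ g`, slot `j` is served above along its top
direction `u` — by `σ_{d+1}(u)` or by `y(u, d+1)`. -/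
theorem tau_upServer {h d : ℤ} {C : MConfig} (hU : C.InDiamond h) {P : MCell} (hP : P ∈ C.upper) (hD : RuleDMu4P C P)
    {g j : Fin 4} (hgj : g ≠ j) (hg : OnCeiling h (P g)) {u : Fin 4} (hd : 1 ≤ d) (hj : P j = tauLetter h u d) :
    ∃ N ∈ C.lower, (∀ i, i ≠ j → N i = P i) ∧ (N j = subDiagLetter h u (d + 1) ∨ N j = ceilLetter h u (d + 1)) := by
  have hna : ¬ isApex (P j) := by rw [hj]; exact tauLetter_not_isApex u (by omega)
  have hk : Adapted (P j) u := by rw [hj]; exact (tauLetter_top h u d).1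
  have hkh : coord (P j) u ≠ h := by rw [hj, (tauLetter_top h u d).2]; omega
  obtain ⟨N, hN, hNP⟩ := upLine_of_ruleDMu4P hU hP hD hgj hg hna hk hkh
  have he0 : 0 < (N j).1 - (P j).1 := by have := hNP.2.1; omega
  have e : N j = ray (tauLetter h u d) u ((N j).1 - (P j).1) := by rw [← hj]; exact hNP.2.2
  rcases above_tau_top (by omega) (hU.1 N hN j) he0 e with ⟨-, hNj⟩ | ⟨-, hNj⟩
  · exact ⟨N, hN, fun i hi => (hNP.1 i hi).symm, Or.inl hNj⟩
  · exact ⟨N, hN, fun i hi => (hNP.1 i hi).symm, Or.inr hNj⟩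

/-- MOVE B′: same cell, slot `j` served above along its NODE direction `u + 2` — by `τ_{d−e}(u)`, `1 ≤ e ≤ d + 2`. -/
theorem tau_nodeServer {h d : ℤ} {C : MConfig} (hU : C.InDiamond h) {P : MCell} (hP : P ∈ C.upper) (hD : RuleDMu4P C P)
    {g j : Fin 4} (hgj : g ≠ j) (hg : OnCeiling h (P g)) {u : Fin 4} (hd : 1 ≤ d) (hj : P j = tauLetter h u d) :
    ∃ N ∈ C.lower, (∀ i, i ≠ j → N i = P i) ∧ ∃ e, 1 ≤ e ∧ e ≤ d + 2 ∧ N j = tauLetter h u (d - e) := by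
  have hna : ¬ isApex (P j) := by rw [hj]; exact tauLetter_not_isApex u (by omega)
  have hk : Adapted (P j) (u + 2) := by rw [hj]; exact (tauLetter_node h u d).1
  have hkh : coord (P j) (u + 2) ≠ h := by rw [hj, (tauLetter_node h u d).2]; omega
  obtain ⟨N, hN, hNP⟩ := upLine_of_ruleDMu4P hU hP hD hgj hg hna hk hkh
  have he0 : 0 < (N j).1 - (P j).1 := by have := hNP.2.1; omega
  have e : N j = ray (tauLetter h u d) (u + 2) ((N j).1 - (P j).1) := by rw [← hj]; exact hNP.2.2
  obtain ⟨hle, hNj⟩ := above_tau_node (hU.1 N hN j) e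
  exact ⟨N, hN, fun i hi => (hNP.1 i hi).symm, (N j).1 - (P j).1, by omega, hle, hNj⟩

/-- MOVE B″: the apex `B = (h−4)·I` at slot `j ≠ g` of a `P`-cell with a ceiling letter at slot `g` is served above, in some direction `r`,
by `σ_1(r)` or by `y(r, 1)`. -/
theorem bApex_upServer {h : ℤ} {C : MConfig} (hU : C.InDiamond h) {P : MCell} (hP : P ∈ C.upper) (hD : RuleDMu4P C P)
    {g j : Fin 4} (hgj : g ≠ j) (hg : OnCeiling h (P g)) (hj : P j = (h - 4, 0, 0)) :
    ∃ N ∈ C.lower, (∀ i, i ≠ j → N i = P i) ∧ ∃ r : Fin 4, N j = subDiagLetter h r 1 ∨ N j = ceilLetter h r 1 := by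
  have hk : Adapted (P j) 0 := by rw [hj]; simp [Adapted]
  have hkh : coord (P j) 0 ≠ h := by rw [hj, coord_of_isApex ⟨rfl, rfl⟩]; show h - 4 ≠ h; omega
  obtain ⟨r, N, hN, hNP⟩ := servedAbove_ceiling_apex hU hP hD hgj hg hk hkh
  have he0 : 0 < (N j).1 - (P j).1 := by have := hNP.2.1; omega
  have e : N j = ray ((h - 4, 0, 0) : BPoint) r ((N j).1 - (P j).1) := by rw [← hj]; exact hNP.2.2
  rcases above_apexHm4 he0 (hU.1 N hN j) e with ⟨-, hNj⟩ | ⟨-, hNj⟩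
  · exact ⟨N, hN, fun i hi => (hNP.1 i hi).symm, r, Or.inl hNj⟩
  · exact ⟨N, hN, fun i hi => (hNP.1 i hi).symm, r, Or.inr hNj⟩

/-! ### §5b the `B`-rows `{F, L(m), (h−4)·I, y(w, K)}` -/

/-- **T6-B, level `P`.** `P{c·ℓ_φ, 2I + m·ℓ_v, (h−4)·I, y(w, K)} ∉ C.upper` for `c ≥ 0`, `1 ≤ m ≤ μ − 2`, `0 ≤ K ≤ μ − 1` with `K ≤ μ − 2 ∨ c ≥ 1`
(MOVE B″: children `N{F, L(m), σ_1(r), y}` = T4 and `N{F, L(m), y(w, K), y(r, 1)}` = T3 ∕ the `FL` edge).  Census (tags BP·): 0 survivors; new ◇₁₀ 1 102. -/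
theorem bApexRowP_absent {h μ m c K : ℤ} {C : MConfig} (hU : C.InDiamond h) (hDN : ∀ Z ∈ C.lower, RuleDMu4N C Z)
    (hDP : ∀ P ∈ C.upper, RuleDMu4P C P) (hX : XPlusClosed C) (hA : A2IMinusClosed C) (hGl : PermClosed C.lower)
    (hGu : PermClosed C.upper) (hΔu : DeltaClosed C.upper) (hh : h = 2 * μ) (hc : 0 ≤ c) (hm1 : 1 ≤ m) (hmμ : m ≤ μ - 2)
    (hK0 : 0 ≤ K) (hK : K ≤ μ - 1) (hadm : K ≤ μ - 2 ∨ 1 ≤ c) {P : MCell} {φ v w : Fin 4} (h0 : P 0 = floorLetter φ c)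
    (h1 : P 1 = nodeTwoLetter v m) (h2 : P 2 = (h - 4, 0, 0)) (h3 : P 3 = ceilLetter h w K) : P ∉ C.upper := fun hP => by
  have hg : OnCeiling h (P 3) := by rw [h3]; exact onCeiling_ceilLetter h w (by omega)
  obtain ⟨N, hN, hNP, r, hN2⟩ := bApex_upServer hU hP (hDP P hP) (g := 3) (j := 2) (by decide) hg h2
  have hN0 := (hNP 0 (by decide)).trans h0
  have hN1 := (hNP 1 (by decide)).trans h1
  have hN3 := (hNP 3 (by decide)).trans h3
  rcases hN2 with hs | hy
  · refine subDiagTowerN_absent hU hDN hDP hX hA hGl hGu hΔu hh hc hm1 hmμ (d := 1) le_rfl hK0 hK ?_ hN0 hN1 hs hN3 hN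
    rcases hadm with hKμ | hc1
    · exact Or.inl ⟨hKμ, by norm_num, fun _ => le_rfl⟩
    · exact Or.inr ⟨rfl, hc1⟩
  · obtain ⟨hN', e0, e1, e2, e3⟩ := perm23_lower hGl hN
    rcases (show K ≤ μ - 2 ∨ K = μ - 1 by omega) with hKμ | hKe
    · exact twoCeilTowerN_absent hU hDN hDP hX hA hGl hGu hΔu hh hc hm1 hmμ (Ka := K) (Kb := 1) hK0 hKμ (by norm_num) (by norm_num)
        (fun _ => le_rfl) (e0.trans hN0) (e1.trans hN1) (e2.trans hN3) (e3.trans hy) hN'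
    · have hc1 : 1 ≤ c := by rcases hadm with hKμ | hc1 <;> omega
      rw [hKe, ← floorLetter_mu_eq_ceilLetter hh] at hN3
      exact floorEdgeTowerN_absent hU hDN hDP hX hA hGl hGu hΔu hh hc hm1 hmμ (K := 1) (by norm_num) le_rfl (fun h0c => by omega)
        (e0.trans hN0) (e1.trans hN1) (e2.trans hN3) (e3.trans hy) hN'

/-- **T6-B, level `N`.** `N{c·ℓ_φ, 2I + m·ℓ_v, (h−4)·I, y(w, K)} ∉ C.lower` for `1 ≤ m ≤ μ − 2`, `0 ≤ K` and `(c ≥ 1 ∧ K ≤ μ − 2) ∨ (c = 0 ∧ K = 0)`: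
MOVE C (server `bApexRowP_absent`), resp. MOVE D′ for the corner `N{O, L(m), (h−4)·I, cu_w}`.  Census (tags BN·): 0 survivors; new ◇₁₀ 924. -/
theorem bApexRowN_absent {h μ m c K : ℤ} {C : MConfig} (hU : C.InDiamond h) (hDN : ∀ Z ∈ C.lower, RuleDMu4N C Z)
    (hDP : ∀ P ∈ C.upper, RuleDMu4P C P) (hX : XPlusClosed C) (hA : A2IMinusClosed C) (hGl : PermClosed C.lower)
    (hGu : PermClosed C.upper) (hΔu : DeltaClosed C.upper) (hh : h = 2 * μ) (hm1 : 1 ≤ m) (hmμ : m ≤ μ - 2) (hK0 : 0 ≤ K)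
    (hadm : (1 ≤ c ∧ K ≤ μ - 2) ∨ (c = 0 ∧ K = 0)) {N : MCell} {φ v w : Fin 4} (h0 : N 0 = floorLetter φ c)
    (h1 : N 1 = nodeTwoLetter v m) (h2 : N 2 = (h - 4, 0, 0)) (h3 : N 3 = ceilLetter h w K) : N ∉ C.lower := fun hN => by
  rcases hadm with ⟨hc1, hKμ⟩ | ⟨hcz, hKz⟩
  · -- MOVE C: pin F, serve y(w, K) below off its top frame; the server is the P-row (any K')
    have hfl : OnFloor (N 0) := by rw [h0]; exact onFloor_floorLetter φ (by omega)
    have hk : Adapted (N 3) (w + 2) := by rw [h3]; exact (ceilLetter_node h w K).1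
    have hk0 : coord (N 3) (w + 2) ≠ 0 := by rw [h3, (ceilLetter_node h w K).2]; omega
    obtain ⟨r, hr, P, hP, hNP⟩ := servedBelow_floor_dir hU hN (hDN N hN) (i := 0) (g := 3) (by decide) hfl hk hk0
    have hr' : r ≠ w := fun e => hr (e.trans (fin4_add_two_add_two w).symm)
    have hd : 0 < (N 3).1 - (P 3).1 := by have := hNP.2.1; omega
    have e : ceilLetter h w K = ray (P 3) r ((N 3).1 - (P 3).1) := by rw [← h3]; exact hNP.2.2
    obtain ⟨-, hbd, hP3⟩ := below_ceilLetter_offTop hK0 (hU.2 P hP 3) hd hr' e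
    exact bApexRowP_absent hU hDN hDP hX hA hGl hGu hΔu hh (by omega) hm1 hmμ (K := K + ((N 3).1 - (P 3).1)) (by omega) (by omega)
      (Or.inr hc1) ((hNP.1 0 (by decide)).trans h0) ((hNP.1 1 (by decide)).trans h1) ((hNP.1 2 (by decide)).trans h2) hP3 hP
  · -- MOVE D′: the corner N{O, L(m), B, cu_w} — the pin O lowers L(m) along its own line
    subst hcz; subst hKz
    have hO : N 0 = (0, 0, 0) := h0.trans (ray_zero _ φ)
    have hfl : OnFloor (N 0) := by rw [hO]; simp [OnFloor, absCharge, chargeOf]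
    have hk : Adapted (N 1) v := by rw [h1]; exact (nodeTwoLetter_top v m).1
    have hk0 : coord (N 1) v ≠ 0 := by rw [h1, (nodeTwoLetter_top v m).2]; omega
    obtain ⟨r, hr, P, hP, hNP⟩ := servedBelow_floor_dir hU hN (hDN N hN) (i := 0) (g := 1) (by decide) hfl hk hk0
    have hd : 0 < (N 1).1 - (P 1).1 := by have := hNP.2.1; omega
    have e : nodeTwoLetter v m = ray (P 1) r ((N 1).1 - (P 1).1) := by rw [← h1]; exact hNP.2.2
    obtain ⟨-, hdm, hP1⟩ := below_nodeTwo_line hm1 (hU.2 P hP 1) hd hr e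
    have hP0 : P 0 = (0, 0, 0) := (hNP.1 0 (by decide)).trans hO
    have hP2 : P 2 = (h - 4, 0, 0) := (hNP.1 2 (by decide)).trans h2
    have hP3 : P 3 = ceilLetter h w 0 := (hNP.1 3 (by decide)).trans h3
    rcases (show 1 ≤ m - ((N 1).1 - (P 1).1) ∨ m - ((N 1).1 - (P 1).1) = 0 ∨ m - ((N 1).1 - (P 1).1) = -1 by omega)
      with hge | hze | hneg
    · exact bApexRowP_absent hU hDN hDP hX hA hGl hGu hΔu hh le_rfl hge (by omega) (K := 0) le_rfl (by omega) (Or.inl (by omega))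
        (hP0.trans (ray_zero _ φ).symm) hP1 hP2 hP3 hP
    · rw [hze] at hP1
      exact originApexTwo_P_absent hU hDN hDP hX hA hGl hGu hΔu (by rw [hP2]; exact apexHm4_ne_hI h) hP0
        (hP1.trans (ray_zero _ v)) (hP3.trans (ceilLetter_zero h w)) hP
    · rw [hneg, nodeTwoLetter_neg_one] at hP1
      exact originUnitFree_P_absent' hU hDN hDP hX hA hGl hGu hΔu hP0 hP1 (hP3.trans (ceilLetter_zero h w)) hP

/-! ### §5c the `τ_1` `P`-rows `{F, L(m), τ_1(u), y(w, K)}`, `c ≥ 1`, `K ≤ μ − 2` -/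

/-- **T6-τ₁, level `P`.** `P{c·ℓ_φ, 2I + m·ℓ_v, τ_1(u), y(w, K)} ∉ C.upper` (`τ_1(u) = (h−6)·I + ℓ_u`) for `c ≥ 1`, `1 ≤ m ≤ μ − 2`, `0 ≤ K ≤ μ − 2`,
all phases: MOVE A′ — children `N{F, L(m), σ_2(u), y(w, K)}` (T4) and `N{F, L(m), y(w, K), y(u, 2)}` (T3, `Kb = 2`).  Census (tag TP): rounds 1 – 6,
0 survivors; new ◇₈ 480 ∕ ◇₁₀ 3 328. -/
theorem tauOneRowP_absent {h μ m c K : ℤ} {C : MConfig} (hU : C.InDiamond h) (hDN : ∀ Z ∈ C.lower, RuleDMu4N C Z)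
    (hDP : ∀ P ∈ C.upper, RuleDMu4P C P) (hX : XPlusClosed C) (hA : A2IMinusClosed C) (hGl : PermClosed C.lower)
    (hGu : PermClosed C.upper) (hΔu : DeltaClosed C.upper) (hh : h = 2 * μ) (hc : 1 ≤ c) (hm1 : 1 ≤ m) (hmμ : m ≤ μ - 2)
    (hK0 : 0 ≤ K) (hK : K ≤ μ - 2) {P : MCell} {φ v u w : Fin 4} (h0 : P 0 = floorLetter φ c) (h1 : P 1 = nodeTwoLetter v m)
    (h2 : P 2 = tauLetter h u 1) (h3 : P 3 = ceilLetter h w K) : P ∉ C.upper := fun hP => by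
  have hg : OnCeiling h (P 3) := by rw [h3]; exact onCeiling_ceilLetter h w (by omega)
  obtain ⟨N, hN, hNP, hN2⟩ := tau_upServer hU hP (hDP P hP) (g := 3) (j := 2) (by decide) hg le_rfl h2
  have hN0 := (hNP 0 (by decide)).trans h0
  have hN1 := (hNP 1 (by decide)).trans h1
  have hN3 := (hNP 3 (by decide)).trans h3
  rcases hN2 with hs | hy
  · exact subDiagTowerN_absent hU hDN hDP hX hA hGl hGu hΔu hh (by omega) hm1 hmμ (d := 1 + 1) (by norm_num) hK0 (by omega)
      (Or.inl ⟨hK, by norm_num, fun h0c => by omega⟩) hN0 hN1 hs hN3 hN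
  · obtain ⟨hN', e0, e1, e2, e3⟩ := perm23_lower hGl hN
    exact twoCeilTowerN_absent hU hDN hDP hX hA hGl hGu hΔu hh (by omega) hm1 hmμ (Ka := K) (Kb := 1 + 1) hK0 hK (by norm_num)
      (by norm_num) (fun h0c => by omega) (e0.trans hN0) (e1.trans hN1) (e2.trans hN3) (e3.trans hy) hN'

/-! ### §5d the origin `τ`-column `{O, L(m), τ_d(u), cu_w}` — induction on `d + m` -/

/-- both levels of the ORIGIN `τ`-COLUMN at once, by induction on `d + m`: level `P` — MOVE B′ (leaves `bApexRowN_absent`, T4, T3);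
level `N` — MOVE D′ (leaves §2b, F2⁺). -/
theorem originTauCol_aux {h μ : ℤ} {C : MConfig} (hU : C.InDiamond h) (hDN : ∀ Z ∈ C.lower, RuleDMu4N C Z)
    (hDP : ∀ P ∈ C.upper, RuleDMu4P C P) (hX : XPlusClosed C) (hA : A2IMinusClosed C) (hGl : PermClosed C.lower)
    (hGu : PermClosed C.upper) (hΔu : DeltaClosed C.upper) (hh : h = 2 * μ) :
    ∀ n : ℕ, ∀ (d m : ℤ), d + m ≤ n → 1 ≤ d → d ≤ μ - 2 → 1 ≤ m → m ≤ μ - 2 →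
      (∀ (v u w : Fin 4), ∀ P ∈ C.upper, P 0 = (0, 0, 0) → P 1 = nodeTwoLetter v m → P 2 = tauLetter h u d →
          P 3 = ceilingUnit h w → False) ∧
      (∀ (v u w : Fin 4), ∀ N ∈ C.lower, N 0 = (0, 0, 0) → N 1 = nodeTwoLetter v m → N 2 = tauLetter h u d →
          N 3 = ceilingUnit h w → False) := by
  intro n
  induction n with
  | zero => intro d m hn hd1 hdμ hm1 hmμ; exact absurd hn (by omega)
  | succ n ih =>
    intro d m hn hd1 hdμ hm1 hmμ
    refine ⟨fun v u w P hP h0 h1 h2 h3 => ?_, fun v u w N hN h0 h1 h2 h3 => ?_⟩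
    · -- level P: MOVE B′ under the pin cu_w (slot 3)
      have hg : OnCeiling h (P 3) := by rw [h3]; exact onCeiling_ceilingUnit h w
      obtain ⟨N, hN, hNP, e, he1, he2, hN2⟩ := tau_nodeServer hU hP (hDP P hP) (g := 3) (j := 2) (by decide) hg hd1 h2
      have hN0 : N 0 = (0, 0, 0) := (hNP 0 (by decide)).trans h0
      have hN1 : N 1 = nodeTwoLetter v m := (hNP 1 (by decide)).trans h1
      have hN3 : N 3 = ceilingUnit h w := (hNP 3 (by decide)).trans h3
      rcases (show 1 ≤ d - e ∨ d - e = 0 ∨ d - e = -1 ∨ d - e = -2 by omega) with hge | hz | hm | hmm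
      · exact (ih (d - e) m (by omega) hge (by omega) hm1 hmμ).2 v u w N hN hN0 hN1 hN2 hN3
      · rw [hz, tauLetter_zero] at hN2
        exact bApexRowN_absent hU hDN hDP hX hA hGl hGu hΔu hh hm1 hmμ (K := 0) le_rfl (Or.inr ⟨rfl, rfl⟩)
          (hN0.trans (ray_zero _ v).symm) hN1 hN2 (hN3.trans (ceilLetter_zero h w).symm) hN
      · rw [hm, tauLetter_neg_one] at hN2
        exact subDiagTowerN_absent hU hDN hDP hX hA hGl hGu hΔu hh le_rfl hm1 hmμ (d := 1) le_rfl (K := 0) le_rfl (by omega)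
          (Or.inl ⟨by omega, by norm_num, fun _ => le_rfl⟩) (hN0.trans (ray_zero _ v).symm) hN1 hN2
          (hN3.trans (ceilLetter_zero h w).symm) hN
      · rw [hmm, tauLetter_neg_two] at hN2
        obtain ⟨hN', e0, e1, e2, e3⟩ := perm23_lower hGl hN
        exact twoCeilTowerN_absent hU hDN hDP hX hA hGl hGu hΔu hh le_rfl hm1 hmμ (Ka := 0) (Kb := 1) le_rfl (by omega) (by norm_num)
          (by norm_num) (fun _ => le_rfl) (e0.trans (hN0.trans (ray_zero _ v).symm)) (e1.trans hN1)
          (e2.trans (hN3.trans (ceilLetter_zero h w).symm)) (e3.trans hN2) hN'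
    · -- level N: MOVE D′ — the pin O (slot 0) lowers L(m) (slot 1) along its own line
      have hfl : OnFloor (N 0) := by rw [h0]; simp [OnFloor, absCharge, chargeOf]
      have hk : Adapted (N 1) v := by rw [h1]; exact (nodeTwoLetter_top v m).1
      have hk0 : coord (N 1) v ≠ 0 := by rw [h1, (nodeTwoLetter_top v m).2]; omega
      obtain ⟨r, hr, P, hP, hNP⟩ := servedBelow_floor_dir hU hN (hDN N hN) (i := 0) (g := 1) (by decide) hfl hk hk0
      have hd : 0 < (N 1).1 - (P 1).1 := by have := hNP.2.1; omega
      have e : nodeTwoLetter v m = ray (P 1) r ((N 1).1 - (P 1).1) := by rw [← h1]; exact hNP.2.2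
      obtain ⟨-, hdm, hP1⟩ := below_nodeTwo_line hm1 (hU.2 P hP 1) hd hr e
      have hP0 : P 0 = (0, 0, 0) := (hNP.1 0 (by decide)).trans h0
      have hP2 : P 2 = tauLetter h u d := (hNP.1 2 (by decide)).trans h2
      have hP3 : P 3 = ceilingUnit h w := (hNP.1 3 (by decide)).trans h3
      rcases (show 1 ≤ m - ((N 1).1 - (P 1).1) ∨ m - ((N 1).1 - (P 1).1) = 0 ∨ m - ((N 1).1 - (P 1).1) = -1 by omega)
        with hge | hze | hneg
      · exact (ih d (m - ((N 1).1 - (P 1).1)) (by omega) hd1 hdμ hge (by omega)).1 v u w P hP hP0 hP1 hP2 hP3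
      · rw [hze] at hP1
        exact originApexTwo_P_absent hU hDN hDP hX hA hGl hGu hΔu (by rw [hP2]; exact tauLetter_ne_hI u (by omega)) hP0
          (hP1.trans (ray_zero _ v)) hP3 hP
      · rw [hneg, nodeTwoLetter_neg_one] at hP1
        exact originUnitFree_P_absent' hU hDN hDP hX hA hGl hGu hΔu hP0 hP1 hP3 hP

/-- **T6-column, level `P`.** `P{O, 2I + m·ℓ_v, τ_d(u), cu_w} ∉ C.upper` for `1 ≤ m ≤ μ − 2`, `1 ≤ d ≤ μ − 2`, all phases (`d = μ − 2`:
`τ_{μ−2}(u) = (μ−2)·ℓ_u`, a T5 cell).  Census (tags CPd·, TPo): rounds 2 – 5, 0 survivors; new ◇₁₀ 74. -/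
theorem originTauColP_absent {h μ m d : ℤ} {C : MConfig} (hU : C.InDiamond h) (hDN : ∀ Z ∈ C.lower, RuleDMu4N C Z)
    (hDP : ∀ P ∈ C.upper, RuleDMu4P C P) (hX : XPlusClosed C) (hA : A2IMinusClosed C) (hGl : PermClosed C.lower)
    (hGu : PermClosed C.upper) (hΔu : DeltaClosed C.upper) (hh : h = 2 * μ) (hm1 : 1 ≤ m) (hmμ : m ≤ μ - 2) (hd1 : 1 ≤ d)
    (hdμ : d ≤ μ - 2) {P : MCell} {v u w : Fin 4} (h0 : P 0 = (0, 0, 0)) (h1 : P 1 = nodeTwoLetter v m) (h2 : P 2 = tauLetter h u d)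
    (h3 : P 3 = ceilingUnit h w) : P ∉ C.upper := fun hP =>
  (originTauCol_aux hU hDN hDP hX hA hGl hGu hΔu hh (d + m).toNat d m (Int.self_le_toNat _) hd1 hdμ hm1 hmμ).1 v u w P hP h0 h1 h2 h3

/-- **T6-column, level `N`.** `N{O, 2I + m·ℓ_v, τ_d(u), cu_w} ∉ C.lower` for `1 ≤ m ≤ μ − 2`, `1 ≤ d ≤ μ − 2`, all phases [same].
Census (tags CNd·): ◇₈ 58 ∕ ◇₁₀ 138 orbits of rounds 2 – 5, 0 survivors; new ◇₈ 26 ∕ ◇₁₀ 90. -/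
theorem originTauColN_absent {h μ m d : ℤ} {C : MConfig} (hU : C.InDiamond h) (hDN : ∀ Z ∈ C.lower, RuleDMu4N C Z)
    (hDP : ∀ P ∈ C.upper, RuleDMu4P C P) (hX : XPlusClosed C) (hA : A2IMinusClosed C) (hGl : PermClosed C.lower)
    (hGu : PermClosed C.upper) (hΔu : DeltaClosed C.upper) (hh : h = 2 * μ) (hm1 : 1 ≤ m) (hmμ : m ≤ μ - 2) (hd1 : 1 ≤ d)
    (hdμ : d ≤ μ - 2) {N : MCell} {v u w : Fin 4} (h0 : N 0 = (0, 0, 0)) (h1 : N 1 = nodeTwoLetter v m) (h2 : N 2 = tauLetter h u d)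
    (h3 : N 3 = ceilingUnit h w) : N ∉ C.lower := fun hN =>
  (originTauCol_aux hU hDN hDP hX hA hGl hGu hΔu hh (d + m).toNat d m (Int.self_le_toNat _) hd1 hdμ hm1 hmμ).2 v u w N hN h0 h1 h2 h3

/-! ## §6 T7 — the TWO-NODE-LETTER `cu`-ROWS `{c·ℓ_φ, L(m)_v, L(m′)_x, cu_w}` and the `τ_{μ−4}` `N`-rows (control g23, v0.6; ONE pin move each)

Level `N`: under the floor pin `F` (`c ≥ 0`) the letter `L(m′)_x`, served below through its NODE frame `x + 2` (`servedBelow_floor_dir`), can only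
step down its TOP line to `(m′+1)·ℓ_x` (`below_nodeTwo_offNode`, MOVE E): the child is T5 after (1 2).  Level `P`: under the pin `cu_w`, `L(m′)_x`
climbs its top line (MOVE F) to `L(m′+e)_x`, `m′ + e ≤ μ − 1`: the `N`-row, or `L(μ−1)_x = y(x, μ−2)` (`nodeTwoLetter_top_eq_ceilLetter`) and T3-N.
The `τ_{μ−4}(u)` `N`-rows (`μ ≥ 5`): `τ_d` steps down its top line to `τ_{d+e}`, `d + e ≤ μ − 2` (MOVE E′): children `τ_{μ−3} = L(μ−3)_u`
(`tauLetter_nodeTwo`) and `τ_{μ−2} = (μ−2)·ℓ_u` (T5).  NOT closed: `τ_d` `N`-rows with `d ≤ μ − 5` ∕ `τ_d` `P`-rows with `2 ≤ d ≤ μ − 4`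
(mutually circular), `{F, L, L′, y(K ≥ 1)}`.  Census (`tools/famAB.py 4 6 8 10`): members ◇₆ 260 ∕ ◇₈ 1 224 ∕ ◇₁₀ 4 284, 0 SURVIVORS at every
`h`; NEW ◇₆ 0 ∕ ◇₈ 170 ∕ ◇₁₀ 2 702 (◇₁₀: r2 640, r3 1 577, r4 389, r5 92, r6 4). -/

/-! ### §6a letter lemmas and the three servers -/

/-- the top line of a node-2 letter read upward: `L(n)_u + e·n_u = L(n + e)_u`. -/
theorem ray_nodeTwoLetter_line (u : Fin 4) (n e : ℤ) : ray (nodeTwoLetter u n) u e = nodeTwoLetter u (n + e) := (ray_add _ u n e).symm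

/-- the top node-2 letter lies on the ceiling: `L(μ−1)_x = y(x, μ−2)` in ◇_{2μ}. -/
theorem nodeTwoLetter_top_eq_ceilLetter {h μ : ℤ} (hh : h = 2 * μ) (x : Fin 4) : nodeTwoLetter x (μ - 1) = ceilLetter h x (μ - 2) := by
  subst hh
  show ray ((2 : ℤ), (0 : ℤ), (0 : ℤ)) x (μ - 1) = ray ((2 * μ - 2 - 2 * (μ - 2), 0, 0) : BPoint) x (1 + (μ - 2))
  rw [show (2 * μ - 2 - 2 * (μ - 2) : ℤ) = 2 by ring, show (1 + (μ - 2) : ℤ) = μ - 1 by ring]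

/-- `τ_{μ−3}(u) = L(μ−3)_u`: the second sub-diagonal meets the node-2 line. -/
theorem tauLetter_nodeTwo {h μ : ℤ} (hh : h = 2 * μ) (u : Fin 4) : tauLetter h u (μ - 3) = nodeTwoLetter u (μ - 3) := by
  subst hh
  show ray ((2 * μ - 4 - 2 * (μ - 3), 0, 0) : BPoint) u (μ - 3) = ray ((2 : ℤ), (0 : ℤ), (0 : ℤ)) u (μ - 3)
  rw [show (2 * μ - 4 - 2 * (μ - 3) : ℤ) = 2 by ring]

/-- BELOW a node-2 letter `L(n)_u` (`n ≥ 1`) OFF its top frame `u`: one step down its top line, the floor letter `(n+1)·ℓ_u`. -/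
theorem below_nodeTwo_offNode {h n e : ℤ} {z : BPoint} {u r : Fin 4} (hn : 1 ≤ n) (hz : InDiamond h z) (he : 0 < e) (hr : r ≠ u)
    (heq : nodeTwoLetter u n = ray z r e) : r = u + 2 ∧ e = 1 ∧ z = floorLetter u (n + 1) := by
  obtain ⟨α, a, b⟩ := z
  obtain ⟨hax, h1, -, -⟩ := hz
  simp only [AxisPt, absCharge, chargeOf, ray, Prod.mk.injEq] at hax h1 heq ⊢
  fin_cases u <;> fin_cases r <;> simp at hax h1 heq hr ⊢ <;>
    (simp only [abs_eq_max_neg, max_def] at h1; split_ifs at h1 <;> omega)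

/-- BELOW `τ_d(u)` (`d ≥ 1`) OFF its top frame `u`: down its top line, `τ_{d+e}(u)`, and it stays in ◇_h while `2(d + e) + 4 ≤ h`. -/
theorem below_tau_offNode {h d e : ℤ} {z : BPoint} {u r : Fin 4} (hd : 1 ≤ d) (hz : InDiamond h z) (he : 0 < e) (hr : r ≠ u)
    (heq : tauLetter h u d = ray z r e) : r = u + 2 ∧ 2 * (d + e) + 4 ≤ h ∧ z = tauLetter h u (d + e) := by
  obtain ⟨α, a, b⟩ := z
  obtain ⟨hax, h1, -, -⟩ := hz
  simp only [AxisPt, absCharge, chargeOf, ray, Prod.mk.injEq] at hax h1 heq ⊢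
  fin_cases u <;> fin_cases r <;> simp at hax h1 heq hr ⊢ <;>
    (simp only [abs_eq_max_neg, max_def] at h1; split_ifs at h1 <;> omega)

/-- MOVE E (level `N`): under a floor pin at slot `i`, `L(n)_x` (`n ≥ 1`) at slot `g ≠ i` is served below through its node frame `x + 2`
(`servedBelow_floor_dir`) — by the floor letter `(n+1)·ℓ_x` only. -/
theorem nodeTwo_downServer {h n : ℤ} {C : MConfig} (hU : C.InDiamond h) {Z : MCell} (hZ : Z ∈ C.lower) (hD : RuleDMu4N C Z) {i g : Fin 4}
    (hig : i ≠ g) (hi : OnFloor (Z i)) {x : Fin 4} (hn : 1 ≤ n) (hg : Z g = nodeTwoLetter x n) :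
    ∃ P ∈ C.upper, (∀ j, j ≠ g → P j = Z j) ∧ P g = floorLetter x (n + 1) := by
  have hk : Adapted (Z g) (x + 2) := by rw [hg]; exact (nodeTwoLetter_node x n).1
  have hk0 : coord (Z g) (x + 2) ≠ 0 := by rw [hg, (nodeTwoLetter_node x n).2]; omega
  obtain ⟨r, hr, P, hP, hZP⟩ := servedBelow_floor_dir hU hZ hD hig hi hk hk0
  have hr' : r ≠ x := fun e => hr (e.trans (fin4_add_two_add_two x).symm)
  have hd : 0 < (Z g).1 - (P g).1 := by have := hZP.2.1; omega
  have e : nodeTwoLetter x n = ray (P g) r ((Z g).1 - (P g).1) := by rw [← hg]; exact hZP.2.2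
  obtain ⟨-, -, hPg⟩ := below_nodeTwo_offNode hn (hU.2 P hP g) hd hr' e
  exact ⟨P, hP, fun j hj => hZP.1 j hj, hPg⟩

/-- MOVE E′ (level `N`): under a floor pin at slot `i`, `τ_d(u)` (`d ≥ 1`, node coordinate `h − 4 − 2d ≠ 0`) at slot `g ≠ i` is served below through
its node frame — by `τ_{d+e}(u)`, `e ≥ 1`, `2(d + e) + 4 ≤ h`. -/
theorem tau_downServer {h d : ℤ} {C : MConfig} (hU : C.InDiamond h) {Z : MCell} (hZ : Z ∈ C.lower) (hD : RuleDMu4N C Z) {i g : Fin 4}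
    (hig : i ≠ g) (hi : OnFloor (Z i)) {u : Fin 4} (hd : 1 ≤ d) (hdh : 2 * d + 4 ≠ h) (hg : Z g = tauLetter h u d) :
    ∃ P ∈ C.upper, (∀ j, j ≠ g → P j = Z j) ∧ ∃ e, 1 ≤ e ∧ 2 * (d + e) + 4 ≤ h ∧ P g = tauLetter h u (d + e) := by
  have hk : Adapted (Z g) (u + 2) := by rw [hg]; exact (tauLetter_node h u d).1
  have hk0 : coord (Z g) (u + 2) ≠ 0 := by rw [hg, (tauLetter_node h u d).2]; omega
  obtain ⟨r, hr, P, hP, hZP⟩ := servedBelow_floor_dir hU hZ hD hig hi hk hk0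
  have hr' : r ≠ u := fun e => hr (e.trans (fin4_add_two_add_two u).symm)
  have he : 0 < (Z g).1 - (P g).1 := by have := hZP.2.1; omega
  have e : tauLetter h u d = ray (P g) r ((Z g).1 - (P g).1) := by rw [← hg]; exact hZP.2.2
  obtain ⟨-, hbd, hPg⟩ := below_tau_offNode hd (hU.2 P hP g) he hr' e
  exact ⟨P, hP, fun j hj => hZP.1 j hj, _, by omega, hbd, hPg⟩

/-- MOVE F (level `P`): under a ceiling pin at slot `g`, `L(n)_x` (`n ≥ 1`, top coordinate `2 + 2n ≠ h`) at slot `j ≠ g` is served above along its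
top line (`upLine_of_ruleDMu4P`) — by `L(n+e)_x`, `e ≥ 1`, `2(n + e) + 2 ≤ h`. -/
theorem nodeTwo_upServer {h n : ℤ} {C : MConfig} (hU : C.InDiamond h) {P : MCell} (hP : P ∈ C.upper) (hD : RuleDMu4P C P)
    {g j : Fin 4} (hgj : g ≠ j) (hg : OnCeiling h (P g)) {x : Fin 4} (hn : 1 ≤ n) (hnh : 2 + 2 * n ≠ h) (hj : P j = nodeTwoLetter x n) :
    ∃ N ∈ C.lower, (∀ i, i ≠ j → N i = P i) ∧ ∃ e, 1 ≤ e ∧ 2 * (n + e) + 2 ≤ h ∧ N j = nodeTwoLetter x (n + e) := by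
  have hna : ¬ isApex (P j) := by rw [hj]; exact nodeTwoLetter_not_isApex x (by omega)
  have hk : Adapted (P j) x := by rw [hj]; exact (nodeTwoLetter_top x n).1
  have hkh : coord (P j) x ≠ h := by rw [hj, (nodeTwoLetter_top x n).2]; exact hnh
  obtain ⟨N, hN, hNP⟩ := upLine_of_ruleDMu4P hU hP hD hgj hg hna hk hkh
  have he0 : 0 < (N j).1 - (P j).1 := by have := hNP.2.1; omega
  have e : N j = nodeTwoLetter x (n + ((N j).1 - (P j).1)) := by rw [← ray_nodeTwoLetter_line, ← hj]; exact hNP.2.2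
  have htop := (hU.1 N hN j).2.2.2
  rw [e, show nodeTwoLetter x (n + ((N j).1 - (P j).1)) = ray ((2, 0, 0) : BPoint) x (n + ((N j).1 - (P j).1)) from rfl,
    top_ray_apex 2 x (by omega)] at htop
  exact ⟨N, hN, fun i hi => (hNP.1 i hi).symm, _, by omega, by omega, e⟩

/-! ### §6b the theorems -/

/-- **T7, level `N`: THE TWO-NODE-LETTER `cu`-ROW.** `N{c·ℓ_φ, L(m)_v, L(m′)_x, cu_w} ∉ C.lower` for `c ≥ 0`, `1 ≤ m, m′ ≤ μ − 2`, ALL phases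
[◇_h, RULE D, X⁺, A2I⁻, `S₄` on both levels, Δ on E₊; `h = 2μ`]: MOVE E lowers `L(m′)_x` to `(m′+1)·ℓ_x`; the child is T5 after (1 2). -/
theorem twoNodeTowerN_absent {h μ c m m' : ℤ} {C : MConfig} (hU : C.InDiamond h) (hDN : ∀ Z ∈ C.lower, RuleDMu4N C Z)
    (hDP : ∀ P ∈ C.upper, RuleDMu4P C P) (hX : XPlusClosed C) (hA : A2IMinusClosed C) (hGl : PermClosed C.lower)
    (hGu : PermClosed C.upper) (hΔu : DeltaClosed C.upper) (hh : h = 2 * μ) (hc : 0 ≤ c) (hm1 : 1 ≤ m) (hmμ : m ≤ μ - 2)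
    (hm1' : 1 ≤ m') (hmμ' : m' ≤ μ - 2) {N : MCell} {φ v x w : Fin 4} (h0 : N 0 = floorLetter φ c) (h1 : N 1 = nodeTwoLetter v m)
    (h2 : N 2 = nodeTwoLetter x m') (h3 : N 3 = ceilingUnit h w) : N ∉ C.lower := fun hN => by
  have hfl : OnFloor (N 0) := by rw [h0]; exact onFloor_floorLetter φ hc
  obtain ⟨P, hP, hPN, hP2⟩ := nodeTwo_downServer hU hN (hDN N hN) (i := 0) (g := 2) (by decide) hfl hm1' h2
  obtain ⟨hP', e0, e1, e2, e3⟩ := perm12_upper hGu hP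
  exact twoFloorTowerP_absent hU hDN hDP hX hA hGl hGu hΔu hh hc (c' := m' + 1) (by omega) (by omega) hm1 hmμ
    (e0.trans ((hPN 0 (by decide)).trans h0)) (e1.trans hP2) (e2.trans ((hPN 1 (by decide)).trans h1))
    (e3.trans ((hPN 3 (by decide)).trans h3)) hP'

/-- **T7, level `P`.** `P{c·ℓ_φ, L(m)_v, L(m′)_x, cu_w} ∉ C.upper`, same range and hypotheses: MOVE F raises `L(m′)_x` to `L(m′+e)_x` — the `N`-row
(`m′ + e ≤ μ − 2`) or `y(x, μ−2)` and T3-N with `(Ka, Kb) = (μ−2, 0)`. -/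
theorem twoNodeTowerP_absent {h μ c m m' : ℤ} {C : MConfig} (hU : C.InDiamond h) (hDN : ∀ Z ∈ C.lower, RuleDMu4N C Z)
    (hDP : ∀ P ∈ C.upper, RuleDMu4P C P) (hX : XPlusClosed C) (hA : A2IMinusClosed C) (hGl : PermClosed C.lower)
    (hGu : PermClosed C.upper) (hΔu : DeltaClosed C.upper) (hh : h = 2 * μ) (hc : 0 ≤ c) (hm1 : 1 ≤ m) (hmμ : m ≤ μ - 2)
    (hm1' : 1 ≤ m') (hmμ' : m' ≤ μ - 2) {P : MCell} {φ v x w : Fin 4} (h0 : P 0 = floorLetter φ c) (h1 : P 1 = nodeTwoLetter v m)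
    (h2 : P 2 = nodeTwoLetter x m') (h3 : P 3 = ceilingUnit h w) : P ∉ C.upper := fun hP => by
  have hcl : OnCeiling h (P 3) := by rw [h3]; exact onCeiling_ceilingUnit h w
  obtain ⟨N, hN, hNP, e, he1, htop, hN2⟩ :=
    nodeTwo_upServer hU hP (hDP P hP) (g := 3) (j := 2) (by decide) hcl hm1' (by omega) h2
  have hN0 : N 0 = floorLetter φ c := (hNP 0 (by decide)).trans h0
  have hN1 : N 1 = nodeTwoLetter v m := (hNP 1 (by decide)).trans h1
  have hN3 : N 3 = ceilingUnit h w := (hNP 3 (by decide)).trans h3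
  rcases (show m' + e ≤ μ - 2 ∨ m' + e = μ - 1 by omega) with hle | heq
  · exact twoNodeTowerN_absent hU hDN hDP hX hA hGl hGu hΔu hh hc hm1 hmμ (m' := m' + e) (by omega) hle hN0 hN1 hN2 hN3 hN
  · rw [heq, nodeTwoLetter_top_eq_ceilLetter hh] at hN2
    exact twoCeilTowerN_absent hU hDN hDP hX hA hGl hGu hΔu hh hc hm1 hmμ (Ka := μ - 2) (Kb := 0) (by omega) le_rfl le_rfl
      (by norm_num) (fun _ => by norm_num) hN0 hN1 hN2 (hN3.trans (ceilLetter_zero h w).symm) hN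

/-- **T7-τ, level `N`: the penultimate `τ`-row.** `N{c·ℓ_φ, L(m)_v, τ_{μ−4}(u), cu_w} ∉ C.lower` for `μ ≥ 5`, `c ≥ 0`, `1 ≤ m ≤ μ − 2`, ALL phases:
MOVE E′ lowers `τ_{μ−4}(u)` to `τ_{μ−3}(u) = L(μ−3)_u` (`twoNodeTowerP_absent`) or to `τ_{μ−2}(u) = (μ−2)·ℓ_u` (T5 after (1 2)). -/
theorem tauPenultRowN_absent {h μ c m : ℤ} {C : MConfig} (hU : C.InDiamond h) (hDN : ∀ Z ∈ C.lower, RuleDMu4N C Z)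
    (hDP : ∀ P ∈ C.upper, RuleDMu4P C P) (hX : XPlusClosed C) (hA : A2IMinusClosed C) (hGl : PermClosed C.lower)
    (hGu : PermClosed C.upper) (hΔu : DeltaClosed C.upper) (hh : h = 2 * μ) (hμ : 5 ≤ μ) (hc : 0 ≤ c) (hm1 : 1 ≤ m) (hmμ : m ≤ μ - 2)
    {N : MCell} {φ v u w : Fin 4} (h0 : N 0 = floorLetter φ c) (h1 : N 1 = nodeTwoLetter v m) (h2 : N 2 = tauLetter h u (μ - 4))
    (h3 : N 3 = ceilingUnit h w) : N ∉ C.lower := fun hN => by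
  have hfl : OnFloor (N 0) := by rw [h0]; exact onFloor_floorLetter φ hc
  obtain ⟨P, hP, hPN, e, he1, hbd, hP2⟩ :=
    tau_downServer hU hN (hDN N hN) (i := 0) (g := 2) (by decide) hfl (by omega) (by omega) h2
  have hP0 : P 0 = floorLetter φ c := (hPN 0 (by decide)).trans h0
  have hP1 : P 1 = nodeTwoLetter v m := (hPN 1 (by decide)).trans h1
  have hP3 : P 3 = ceilingUnit h w := (hPN 3 (by decide)).trans h3
  rcases (show e = 1 ∨ e = 2 by omega) with e1 | e2
  · rw [e1, show μ - 4 + 1 = μ - 3 by ring, tauLetter_nodeTwo hh] at hP2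
    exact twoNodeTowerP_absent hU hDN hDP hX hA hGl hGu hΔu hh hc hm1 hmμ (m' := μ - 3) (by omega) (by omega) hP0 hP1 hP2 hP3 hP
  · rw [e2, show μ - 4 + 2 = μ - 2 by ring, tauLetter_floor hh] at hP2
    obtain ⟨hP', e0, e1', e2', e3⟩ := perm12_upper hGu hP
    exact twoFloorTowerP_absent hU hDN hDP hX hA hGl hGu hΔu hh hc (c' := μ - 2) (by omega) (by omega) hm1 hmμ
      (e0.trans hP0) (e1'.trans hP2) (e2'.trans hP1) (e3.trans hP3) hP'

end Summit.HodgeConjecture.HodgeConjecture.Cruxes.BlochSeedDiscOne.FloorPinTower
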